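import Literature.NumberTheory.EllipticCurves.DescendedFrobeniusMatrix
import Mathlib.RingTheory.SimpleRing.Principal
import Mathlib.RingTheory.Henselian
import Literature.NumberTheory.GaloisRepresentations.LubinTate
import Literature.NumberTheory.EllipticCurves.FormalGroupFrobeniusTypeAllPrimesProofs
import Literature.NumberTheory.EllipticCurves.FormalGroupExpSummableProofs
import Literature.IUT.LogVolume.WildCubicUnitLog
import HarnessLib

/-!
# The descended crystalline Frobenius matrix at `3` over `ℚ₃(ζ₉)` (Katz 1981, Berthelot–Ogus 1983), 2/5 — the integers `ℤ₃[ζ₉]`, transfer semantics and basis, Katz's Frobenius mod `ϖ`, the formal endomorphism algebra (re-homed proofs)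

**The named fact `WeierstrassCurve.isDescendedFrobeniusMatrix_exists` (`DescendedFrobeniusMatrix.lean`: for `W/ℚ` with a good model over `𝓞_L`,
`L = ℚ₃(ζ₉)`, of supersingular special fibre, a descended crystalline Frobenius matrix `M ∈ M₂(ℚ₃)` exists and `tr M = a`) HOLDS — EXACT name
`WeierstrassCurve.isDescendedFrobeniusMatrix_exists_holds`** ([Katz1981CrystallineDieudonne] N. Katz, *Crystalline cohomology, Dieudonné modules, and Jacobi sums*,
Thm. 5.1.4, 5.3.3, (5.5.7), 5.7.2, (6.1.1); [BerthelotOgus1983] (2.4), (3.14); Honda's theory of formal groups and the Katz–Messing point-count relation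
`φ² − aφ + 3 = 0`).  Contents: (1, definitions file) `μ`, `λ`, the reduction mod `p` and the `p`-free part of a power series over `ℤ_p`;
(2–4) the ring `𝓞_L = ℤ₃[ζ₉]` (`ONine`: integers, residue map, local structure, integral coordinates), transfer of the descended Frobenius along good
models (semantics, basis, good-model transport and its calculus), the formal endomorphism algebra and its `p`-adic digits, Katz's Frobenius modulo `ϖ` and
the Frobenius relation, bounded formal logarithms `⇔` divisibility, the `p`-adic rank-two assembly, coefficient computations in the formal group of a
Weierstrass curve (`formalW`, `formalΩ`, `formalLog`), the formal `η`-coboundary and residue, Honda estimates and congruences, unbounded `log`, `η`-integrality,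
independence of the classes `[ω], [η]`, the second-kind logarithm, the Katz rank of a `p`-adic rank, the supersingular Katz rank, the `p`-adic digit limit;
(5) Galois descent from `L` to `ℚ₃`, the named fact from the Katz rank, the rank-two reduction, and the discharge.
RE-HOMED into `Literature/` by the Hodge foundations lane (`lit-hodgefound`, seat p20, generation 40): verbatim DECLARATION-LEVEL ports (the 331 declarations needed, in
dependency order; each Part is a slice of one Summits module) of 45 theorem modules `Summits/BirchSwinnertonDyer/BirchSwinnertonDyer/Theorems/CyclotomicUntwist*.lean`
(+ three formal-group coefficient files and `Rank1Residual/{X1/MuLambdaAlgebra,O5/…}`); the namespace `Summit.BirchSwinnertonDyer.BirchSwinnertonDyer.Theorems` is re-rooted at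
`Literature.NumberTheory.EllipticCurves.DescendedFrobenius` (module sub-namespaces kept; the coefficient lemmas gathered in `….FormalGroupCoefficients`, the two `3`-adic norm lemmas in
`….PadicNormAux`, `μ`/`λ` in `Literature.NumberTheory.EllipticCurves.MuLambda`).  No new named fact (D-0026); imports Mathlib/Literature only; every declaration carries the citation of the
printed statement it formalises or serves.  The Summits originals stay in place (transitional duplication).  WHAT THIS IS NOT: nothing here bears on BSD; it is the
crystalline / formal-group computation of the Frobenius matrix at `3` for curves acquiring good reduction over `ℚ₃(ζ₉)`.  (This is file 2 of 5.)
-/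

noncomputable section

/-!
## Part 1 — port of `Summits/BirchSwinnertonDyer/BirchSwinnertonDyer/Theorems/CyclotomicUntwistDescendedFrobeniusTransferSemantics.lean` (2 declarations kept)

# Semantics of the Berthelot–Ogus transfer on the ramified side — Katz's Key Lemma over `𝓞 = 𝓞_{ℚ₃(ζ₉)}` and the ninth-power congruence `Ĝ(X,Y)⁹ ≡ G₀(X⁹,Y⁹) (mod 3)` for a good model congruent to a `ℤ₃`-lift modulo `ϖ` (`

Declarations of this Part (verbatim port; each keeps its own docstring and citation): `mvCoeff_subst_eq_sum_ring`, `isUnit_natCast_mvPowerSeries_ONine`.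

Reference keys (see `references.bib` and the declarations' citations): [Katz1981CrystallineDieudonne].
-/

section Part1

open _root_.PowerSeries Literature.RingTheory.FormalGroups Literature.NumberTheory.EllipticCurves
  Literature.NumberTheory.EllipticCurves.DescendedFrobenius

namespace Literature.NumberTheory.EllipticCurves.DescendedFrobenius.DescendedFrobeniusTransfer

/-- Truncation formula for substitution into a several-variable series, over any commutative ring:
`[X^d] g(Γ) = Σ_{i ≤ |d|} g_i·[X^d] Γⁱ` (`Γ(0) = 0`). [cite: Katz1981CrystallineDieudonne, §5 (supporting lemma)] -/
theorem mvCoeff_subst_eq_sum_ring {S : Type*} [CommRing S] {σ : Type*} {Γ : MvPowerSeries σ S}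
    (hΓ : MvPowerSeries.constantCoeff Γ = 0) (g : S⟦X⟧) (d : σ →₀ ℕ) :
    MvPowerSeries.coeff d (g.subst Γ) =
      ∑ i ∈ Finset.range (Finsupp.degree d + 1), coeff i g * MvPowerSeries.coeff d (Γ ^ i) := by
  have hs : HasSubst Γ := HasSubst.of_constantCoeff_zero hΓ
  rw [coeff_subst hs, finsum_eq_sum_of_support_subset _ (s := Finset.range (Finsupp.degree d + 1))]
  · simp only [smul_eq_mul]
  · intro i hi
    rw [Function.mem_support] at hi
    rw [Finset.coe_range, Set.mem_Iio]
    by_contra h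
    rw [not_lt] at h
    apply hi
    have hord : MvPowerSeries.coeff d (Γ ^ i) = 0 := by
      refine MvPowerSeries.coeff_of_lt_order ?_
      refine lt_of_lt_of_le ?_ (MvPowerSeries.le_order_pow_of_constantCoeff_eq_zero i hΓ)
      exact_mod_cast Nat.lt_of_lt_of_le (Nat.lt_succ_self _) h
    rw [hord, smul_zero]

/-- In `𝓞⟦σ⟧` every natural number prime to `3` is a unit. [cite: Katz1981CrystallineDieudonne, §5 (supporting lemma)] -/
theorem isUnit_natCast_mvPowerSeries_ONine {σ : Type*} {r : ℕ} (hr : ¬ 3 ∣ r) :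
    IsUnit (r : MvPowerSeries σ ONine) := by
  have h : IsUnit (r : ℤ_[3]) := by
    rw [PadicInt.isUnit_iff, PadicInt.norm_natCast_eq_one_iff]
    exact (Nat.Prime.coprime_iff_not_dvd Nat.prime_three).mpr hr
  have h' : IsUnit (r : ONine) := by simpa using h.map (algebraMap ℤ_[3] ONine)
  simpa using h'.map (MvPowerSeries.C : ONine →+* MvPowerSeries σ ONine)

end Literature.NumberTheory.EllipticCurves.DescendedFrobenius.DescendedFrobeniusTransfer

end Part1

/-!
## Part 2 — port of `Summits/BirchSwinnertonDyer/BirchSwinnertonDyer/Theorems/CyclotomicUntwistDescendedFrobeniusTransferBasis.lean` (6 declarations kept)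

# The Berthelot–Ogus transfer basis in the currency of `Literature.DescendedFrobeniusMatrix` — independence in `ℚ₃(ζ₉)⟦X⟧` via the trace form, the Frobenius powers `z ↦ z⁹`, `z ↦ z²⁷` as `C²`, `C³` on it (toolkit for `IsD

Declarations of this Part (verbatim port; each keeps its own docstring and citation): `finiteDimensional_KNine`, `exists_three_pow_mul_isIntegral`, `hbd_C_mul`, `hbd_smul`, `hbd_expand`, `expand_expand`.

Reference keys (see `references.bib` and the declarations' citations): [Katz1981CrystallineDieudonne].
-/

section Part2

open _root_.PowerSeries Literature.RingTheory.FormalGroups Literature.NumberTheory.EllipticCurves.DescendedFrobenius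

namespace Literature.NumberTheory.EllipticCurves.DescendedFrobenius.DescendedFrobeniusTransfer

/-- `ℚ₃(ζ₉)` is finite-dimensional over `ℚ₃`. [cite: Katz1981CrystallineDieudonne, §5.1 (p. 193)] -/
theorem finiteDimensional_KNine : FiniteDimensional ℚ_[3] KNine :=
  IsCyclotomicExtension.finiteDimensional {9} ℚ_[3] KNine

/-- Every element of `ℚ₃(ζ₉)` becomes `ℤ₃`-integral after multiplication by a power of `3`. [cite: Katz1981CrystallineDieudonne, §5.1 (p. 193)] -/
theorem exists_three_pow_mul_isIntegral (c : KNine) : ∃ k : ℕ, IsIntegral ℤ_[3] ((3 : KNine) ^ k * c) := by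
  haveI := finiteDimensional_KNine
  have hc : IsIntegral ℚ_[3] c := Algebra.IsIntegral.isIntegral c
  obtain ⟨⟨m, hm⟩, hint⟩ :=
    IsIntegral.exists_multiple_integral_of_isLocalization (nonZeroDivisors ℤ_[3]) c hc
  have hm0 : m ≠ 0 := nonZeroDivisors.ne_zero hm
  refine ⟨m.valuation, ?_⟩
  have hu := PadicInt.unitCoeff_spec hm0
  set u := PadicInt.unitCoeff hm0 with hudef
  -- `3^k • c = u⁻¹ • (m • c)`
  have e : (3 : KNine) ^ m.valuation * c = algebraMap ℤ_[3] KNine ((u⁻¹ : ℤ_[3]ˣ) : ℤ_[3]) * (m • c) := by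
    rw [Algebra.smul_def]
    change (3 : KNine) ^ m.valuation * c = algebraMap ℤ_[3] KNine ((u⁻¹ : ℤ_[3]ˣ) : ℤ_[3]) *
      (algebraMap ℤ_[3] KNine m * c)
    conv_rhs => rw [hu]
    rw [map_mul, map_pow, map_natCast, ← mul_assoc, ← mul_assoc, ← map_mul, Units.inv_mul, map_one, one_mul]
    norm_num
  rw [e]
  exact isIntegral_algebraMap.mul hint

/-- **Scalars preserve bounded denominators**: `c·f` has bounded denominators if `f` does (`c ∈ ℚ₃(ζ₉)`).
[cite: Katz1981CrystallineDieudonne, §5.1 (p. 193)] -/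
theorem hbd_C_mul (c : KNine) {f : KNine⟦X⟧} (hf : HasBoundedDenominators f) :
    HasBoundedDenominators (PowerSeries.C c * f) := by
  obtain ⟨d, hd⟩ := hf
  obtain ⟨k, hk⟩ := exists_three_pow_mul_isIntegral c
  refine ⟨k + d, fun n ↦ ?_⟩
  rw [coeff_C_mul, show (3 : KNine) ^ (k + d) * (c * coeff n f) = (3 ^ k * c) * (3 ^ d * coeff n f) by ring]
  exact hk.mul (hd n)

/-- The `•` form. [cite: Katz1981CrystallineDieudonne, §5.1 (p. 193)] -/
theorem hbd_smul (c : KNine) {f : KNine⟦X⟧} (hf : HasBoundedDenominators f) :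
    HasBoundedDenominators (c • f) := by
  rw [smul_eq_C_mul]; exact hbd_C_mul c hf

/-- **`expand` preserves bounded denominators** (the coefficients of `f(z^q)` are those of `f` or `0`). [cite: Katz1981CrystallineDieudonne, §5.1 (p. 193)] -/
theorem hbd_expand (q : ℕ) (hq : q ≠ 0) {f : KNine⟦X⟧} (hf : HasBoundedDenominators f) :
    HasBoundedDenominators (expand q hq f) := by
  obtain ⟨d, hd⟩ := hf
  refine ⟨d, fun n ↦ ?_⟩
  rw [coeff_expand]
  split_ifs
  · exact hd _
  · rw [mul_zero]; exact isIntegral_zero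

/-- `expand a ∘ expand b = expand (a·b)` with a prescribed name for the product. [cite: Katz1981CrystallineDieudonne, §5.1 (p. 193)] -/
theorem expand_expand {R : Type*} [CommRing R] {a b c : ℕ} (ha : a ≠ 0) (hb : b ≠ 0) (hc : c ≠ 0)
    (h : a * b = c) (f : R⟦X⟧) : expand a ha (expand b hb f) = expand c hc f := by
  subst h
  exact (expand_mul a ha b hb f).symm

end Literature.NumberTheory.EllipticCurves.DescendedFrobenius.DescendedFrobeniusTransfer

end Part2

/-!
## Part 3 — port of `Summits/BirchSwinnertonDyer/Rank1Residual/O5/ThreeTorsionNormalFormValuation.lean` (1 declarations kept)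

# The `3`-adic normal form `y² + a₁xy + a₃y = x³` of a curve with a rational `3`-torsion point, I: `v₃(Δ) = 3 ∧ 3 ∣ c₄` pins `a₃ ∈ ℤ₃^×`, `3 ∣ a₁`, and then every affine `y` (`x ≠ 0`) is flat, `3 ∣ v₃(y)`

Declarations of this Part (verbatim port; each keeps its own docstring and citation): `norm_lt_one_iff`.

Reference keys (see `references.bib` and the declarations' citations): [Katz1981CrystallineDieudonne].
-/

section Part3

open _root_.Padic

namespace Literature.NumberTheory.EllipticCurves.DescendedFrobenius.PadicNormAux

section Valuation

variable {p : ℕ} [hp : Fact p.Prime]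

/-- `‖x‖ < 1 ↔ x = 0 ∨ 1 ≤ v(x)` on `ℚ_p`. [cite: Katz1981CrystallineDieudonne, §5 (supporting lemma)] -/
theorem norm_lt_one_iff {x : ℚ_[p]} : ‖x‖ < 1 ↔ x = 0 ∨ 1 ≤ x.valuation := by
  rcases eq_or_ne x 0 with rfl | hx
  · simp
  · have h1 : (1 : ℝ) < p := by exact_mod_cast hp.out.one_lt
    rw [Padic.norm_eq_zpow_neg_valuation hx, ← zpow_zero (p : ℝ), zpow_lt_zpow_iff_right₀ h1]
    constructor
    · intro h; exact Or.inr (by omega)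
    · rintro (h | h)
      · exact (hx h).elim
      · omega

end Valuation

end Literature.NumberTheory.EllipticCurves.DescendedFrobenius.PadicNormAux

end Part3

/-!
## Part 4 — port of `Summits/BirchSwinnertonDyer/Rank1Residual/O5/FlexTangentNormalFormThree.lean` (1 declarations kept)

# The tangent change at a point of order `3` and Tate's `III` form at `3`: `‖x/3‖ ≤ 1` for the normal-form coefficient

Declarations of this Part (verbatim port; each keeps its own docstring and citation): `norm_div_three_le_one`.

Reference keys (see `references.bib` and the declarations' citations): [Katz1981CrystallineDieudonne].
-/

section Part4

open _root_.Polynomial _root_.WeierstrassCurve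

namespace Literature.NumberTheory.EllipticCurves.DescendedFrobenius.PadicNormAux

section Padic

/-- `‖x‖ < 1` in `ℚ₃` ⟹ `‖x / 3‖ ≤ 1`. [cite: Katz1981CrystallineDieudonne, §5 (supporting lemma)] -/
theorem norm_div_three_le_one {x : ℚ_[3]} (hx : ‖x‖ < 1) : ‖x / 3‖ ≤ 1 := by
  rcases PadicNormAux.norm_lt_one_iff.mp hx with h0 | h1
  · rw [h0, zero_div, norm_zero]; exact zero_le_one
  · have hx0 : x ≠ 0 := by
      rintro rfl
      simp at h1
    have h3 : (3 : ℚ_[3]) ≠ 0 := by norm_num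
    rw [Padic.norm_le_one_iff_val_nonneg, div_eq_mul_inv, Padic.valuation_mul hx0 (inv_ne_zero h3),
      Padic.valuation_inv]
    have hv3 : (3 : ℚ_[3]).valuation = 1 := by exact_mod_cast Padic.valuation_p (p := 3)
    rw [hv3]; omega

end Padic

end Literature.NumberTheory.EllipticCurves.DescendedFrobenius.PadicNormAux

end Part4

/-!
## Part 5 — port of `Summits/BirchSwinnertonDyer/BirchSwinnertonDyer/Theorems/CyclotomicUntwistGNineToolkit.lean` (3 declarations kept)

# (G₉) toolkit: ninth roots of unity at a place above `3`, and explicit cubic models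

Declarations of this Part (verbatim port; each keeps its own docstring and citation): `zeta_rel`, `varpi_pow_six`, `one_sub_zeta_ne_zero`.

Reference keys (see `references.bib` and the declarations' citations): [Katz1981CrystallineDieudonne].
-/

section Part5

open scoped _root_.NumberField _root_.Polynomial

open _root_.WeierstrassCurve _root_.IsDedekindDomain _root_.NumberField _root_.Polynomial

namespace Literature.NumberTheory.EllipticCurves.DescendedFrobenius.GNine

variable {F : Type*} [Field F] {ζ : F}

/-- The ninth cyclotomic relation `ζ⁶ + ζ³ + 1 = 0` for a primitive ninth root of unity.
[cite: Katz1981CrystallineDieudonne, §5 (supporting lemma)] -/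
theorem zeta_rel (hζ : IsPrimitiveRoot ζ 9) : ζ ^ 6 + ζ ^ 3 + 1 = 0 := by
  have h9 : ζ ^ 9 = 1 := hζ.pow_eq_one
  have h3 : ζ ^ 3 ≠ 1 := hζ.pow_ne_one_of_pos_of_lt (by norm_num) (by norm_num)
  have hfac : (ζ ^ 3 - 1) * (ζ ^ 6 + ζ ^ 3 + 1) = 0 := by
    linear_combination h9
  rcases mul_eq_zero.mp hfac with h | h
  · exact absurd (sub_eq_zero.mp h) h3
  · exact h

/-- `ϖ⁶ = −3θ` for `ϖ = 1 − ζ`, `θ = 1 − 3ϖ + 6ϖ² − 7ϖ³ + 5ϖ⁴ − 2ϖ⁵` (Washington, *Cyclotomic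
Fields*, Lemma 1.4: `(1 − ζ₉)⁶` is `3` times a unit; here the unit is made explicit).
[cite: Katz1981CrystallineDieudonne, §5 (supporting lemma)] -/
theorem varpi_pow_six (hζ : IsPrimitiveRoot ζ 9) :
    (1 - ζ) ^ 6 = -3 * (1 - 3 * (1 - ζ) + 6 * (1 - ζ) ^ 2 - 7 * (1 - ζ) ^ 3 + 5 * (1 - ζ) ^ 4
      - 2 * (1 - ζ) ^ 5) := by
  have h := zeta_rel hζ
  linear_combination h

/-- `ϖ = 1 − ζ ≠ 0`. [cite: Katz1981CrystallineDieudonne, §5 (supporting lemma)] -/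
theorem one_sub_zeta_ne_zero (hζ : IsPrimitiveRoot ζ 9) : (1 - ζ : F) ≠ 0 := by
  intro h
  exact hζ.ne_one (by norm_num) (sub_eq_zero.mp h).symm

end Literature.NumberTheory.EllipticCurves.DescendedFrobenius.GNine

end Part5

/-!
## Part 6 — port of `Summits/BirchSwinnertonDyer/BirchSwinnertonDyer/Theorems/CyclotomicUntwistNineIntegers.lean` (14 declarations kept)

# The ring `𝓞 = integralClosure ℤ₃ ℚ₃(ζ₉)` of the local currency of `DescendedFrobeniusMatrix`, I: `ζ₉ ∈ 𝓞`, the explicit unit `θ⁻¹ ∈ ℤ[ζ₉]`, `3 = −(1 − ζ₉)⁶θ⁻¹`, `1/3 ∉ 𝓞`, and the one-step residue lemma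

Declarations of this Part (verbatim port; each keeps its own docstring and citation): `theta_mul_thetaInv`, `three_eq_neg_pow_six_mul_thetaInv`, `zeta_spec`, `zeta_isIntegral`, `zeta_mem`, `aeval_zeta_mem`, `one_sub_zeta_mem`, `thetaInv_mem`, `theta_mem`, `algebraMap_mem_of_norm_le_one`, `coe_ofNat`, `inv_three_not_mem`, `one_sub_zeta_mul_ne_one`, `norm_lt_one_of_residueFree`.

Reference keys (see `references.bib` and the declarations' citations): [Katz1981CrystallineDieudonne].
-/

section Part6

open scoped _root_.Polynomial

open _root_.Polynomial _root_.IsCyclotomicExtension Literature.NumberTheory.EllipticCurves.DescendedFrobenius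
  Literature.NumberTheory.EllipticCurves.DescendedFrobenius Literature.NumberTheory.EllipticCurves.DescendedFrobenius.PadicNormAux

namespace Literature.NumberTheory.EllipticCurves.DescendedFrobenius.NineIntegers

section Generic

variable {K : Type*} [Field K] {ζ : K}

/-- **`θ⁻¹ ∈ ℤ[ζ₉]` explicitly.** With `ϖ = 1 − ζ` and `θ = 1 − 3ϖ + 6ϖ² − 7ϖ³ + 5ϖ⁴ − 2ϖ⁵` (so `ϖ⁶ = −3θ`,
`GNine.varpi_pow_six`), one has `θ · (−10 − 11ζ − 7ζ² − 10ζ³ − 4ζ⁴ + 4ζ⁵) = 1`: the cyclotomic unit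
`θ = −(1 − ζ₉)⁶/3` is inverted inside `ℤ[ζ₉]` (Washington, *Cyclotomic Fields*, Lemma 1.4 / Prop. 2.8; the
inverse found by linear algebra modulo `Φ₉` and certified by `linear_combination`). [cite: Katz1981CrystallineDieudonne, §5 (supporting lemma)] -/
theorem theta_mul_thetaInv (hζ : IsPrimitiveRoot ζ 9) :
    (1 - 3 * (1 - ζ) + 6 * (1 - ζ) ^ 2 - 7 * (1 - ζ) ^ 3 + 5 * (1 - ζ) ^ 4 - 2 * (1 - ζ) ^ 5) *
      (-10 - 11 * ζ - 7 * ζ ^ 2 - 10 * ζ ^ 3 - 4 * ζ ^ 4 + 4 * ζ ^ 5) = 1 := by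
  linear_combination (-1 - 20 * ζ + 28 * ζ ^ 2 - 28 * ζ ^ 3 + 8 * ζ ^ 4) * GNine.zeta_rel hζ

/-- **`3 = −(1 − ζ₉)⁶ · θ⁻¹`**: the prime `3` is the sixth power of the uniformizer `1 − ζ₉` times an explicit unit
of `ℤ[ζ₉]` (total ramification of `3` in `ℚ(ζ₉)`/`ℚ₃(ζ₉)`, Washington Lemma 1.4). [cite: Katz1981CrystallineDieudonne, §5 (supporting lemma)] -/
theorem three_eq_neg_pow_six_mul_thetaInv (hζ : IsPrimitiveRoot ζ 9) :
    (3 : K) = -((1 - ζ) ^ 6 * (-10 - 11 * ζ - 7 * ζ ^ 2 - 10 * ζ ^ 3 - 4 * ζ ^ 4 + 4 * ζ ^ 5)) := by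
  have h6 := GNine.varpi_pow_six hζ
  have hθ := theta_mul_thetaInv hζ
  linear_combination (-10 - 11 * ζ - 7 * ζ ^ 2 - 10 * ζ ^ 3 - 4 * ζ ^ 4 + 4 * ζ ^ 5) * h6 - (3 : K) * hθ

end Generic

/-- The distinguished primitive ninth root of unity `ζ₉ = zeta 9 ℚ₃ K` of `K = CyclotomicField 9 ℚ₃` is one.
[cite: Katz1981CrystallineDieudonne, §5 (supporting lemma)] -/
theorem zeta_spec : IsPrimitiveRoot (zeta 9 ℚ_[3] KNine) 9 := IsCyclotomicExtension.zeta_spec 9 ℚ_[3] KNine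

/-- `ζ₉` is integral over `ℤ₃` (its ninth power is `1`). [cite: Katz1981CrystallineDieudonne, §5 (supporting lemma)] -/
theorem zeta_isIntegral : IsIntegral ℤ_[3] (zeta 9 ℚ_[3] KNine) := by
  refine IsIntegral.of_pow (by norm_num : 0 < 9) ?_
  rw [zeta_spec.pow_eq_one]
  exact isIntegral_one

/-- `ζ₉ ∈ 𝓞 = integralClosure ℤ₃ K`. [cite: Katz1981CrystallineDieudonne, §5 (supporting lemma)] -/
theorem zeta_mem : zeta 9 ℚ_[3] KNine ∈ ONine := zeta_isIntegral

/-- Every `ℤ`-polynomial expression in `ζ₉` lies in `𝓞` (`ℤ[ζ₉] ⊆ 𝓞`). [cite: Katz1981CrystallineDieudonne, §5 (supporting lemma)] -/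
theorem aeval_zeta_mem (p : ℤ[X]) : aeval (zeta 9 ℚ_[3] KNine) p ∈ ONine := by
  induction p using Polynomial.induction_on' with
  | add p q hp hq => rw [map_add]; exact add_mem hp hq
  | monomial n a =>
    rw [aeval_monomial, eq_intCast]
    exact mul_mem (intCast_mem ONine a) (pow_mem zeta_mem n)

/-- The uniformizer `1 − ζ₉` lies in `𝓞`. [cite: Katz1981CrystallineDieudonne, §5 (supporting lemma)] -/
theorem one_sub_zeta_mem : 1 - zeta 9 ℚ_[3] KNine ∈ ONine := sub_mem (one_mem _) zeta_mem

/-- `θ⁻¹ = −10 − 11ζ − 7ζ² − 10ζ³ − 4ζ⁴ + 4ζ⁵ ∈ 𝓞`. [cite: Katz1981CrystallineDieudonne, §5 (supporting lemma)] -/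
theorem thetaInv_mem :
    (-10 - 11 * zeta 9 ℚ_[3] KNine - 7 * zeta 9 ℚ_[3] KNine ^ 2 - 10 * zeta 9 ℚ_[3] KNine ^ 3
      - 4 * zeta 9 ℚ_[3] KNine ^ 4 + 4 * zeta 9 ℚ_[3] KNine ^ 5) ∈ ONine := by
  have e : (-10 - 11 * zeta 9 ℚ_[3] KNine - 7 * zeta 9 ℚ_[3] KNine ^ 2 - 10 * zeta 9 ℚ_[3] KNine ^ 3
      - 4 * zeta 9 ℚ_[3] KNine ^ 4 + 4 * zeta 9 ℚ_[3] KNine ^ 5) =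
      aeval (zeta 9 ℚ_[3] KNine) (-10 - 11 * X - 7 * X ^ 2 - 10 * X ^ 3 - 4 * X ^ 4 + 4 * X ^ 5 : ℤ[X]) := by
    simp only [map_add, map_sub, map_neg, map_mul, map_pow, aeval_X, map_ofNat]
  rw [e]; exact aeval_zeta_mem _

/-- `θ = 1 − 3ϖ + 6ϖ² − 7ϖ³ + 5ϖ⁴ − 2ϖ⁵ ∈ 𝓞` (`ϖ = 1 − ζ₉`). [cite: Katz1981CrystallineDieudonne, §5 (supporting lemma)] -/
theorem theta_mem :
    (1 - 3 * (1 - zeta 9 ℚ_[3] KNine) + 6 * (1 - zeta 9 ℚ_[3] KNine) ^ 2 - 7 * (1 - zeta 9 ℚ_[3] KNine) ^ 3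
      + 5 * (1 - zeta 9 ℚ_[3] KNine) ^ 4 - 2 * (1 - zeta 9 ℚ_[3] KNine) ^ 5) ∈ ONine := by
  have e : (1 - 3 * (1 - zeta 9 ℚ_[3] KNine) + 6 * (1 - zeta 9 ℚ_[3] KNine) ^ 2
      - 7 * (1 - zeta 9 ℚ_[3] KNine) ^ 3 + 5 * (1 - zeta 9 ℚ_[3] KNine) ^ 4 - 2 * (1 - zeta 9 ℚ_[3] KNine) ^ 5) =
      aeval (zeta 9 ℚ_[3] KNine)
        (1 - 3 * (1 - X) + 6 * (1 - X) ^ 2 - 7 * (1 - X) ^ 3 + 5 * (1 - X) ^ 4 - 2 * (1 - X) ^ 5 : ℤ[X]) := by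
    simp only [map_add, map_sub, map_mul, map_pow, aeval_X, map_ofNat, map_one]
  rw [e]; exact aeval_zeta_mem _

/-- A `3`-adic number of norm `≤ 1`, read in `K`, lies in `𝓞` (it is a `3`-adic integer). [cite: Katz1981CrystallineDieudonne, §5 (supporting lemma)] -/
theorem algebraMap_mem_of_norm_le_one {c : ℚ_[3]} (hc : ‖c‖ ≤ 1) : algebraMap ℚ_[3] KNine c ∈ ONine := by
  rw [show algebraMap ℚ_[3] KNine c = algebraMap ℤ_[3] KNine ⟨c, hc⟩ from
    (IsScalarTower.algebraMap_apply ℤ_[3] ℚ_[3] KNine ⟨c, hc⟩).symm]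
  exact Subalgebra.algebraMap_mem _ _

/-- Numerals of `𝓞` coerce to the numerals of `K` (a `norm_cast` convenience: Mathlib has `coe_natCast` for
subsemirings but no `ofNat` form). [cite: Katz1981CrystallineDieudonne, §5 (supporting lemma)] -/
@[simp, norm_cast]
theorem coe_ofNat (n : ℕ) [n.AtLeastTwo] : ((ofNat(n) : ONine) : KNine) = ofNat(n) := rfl

/-- **`1/3 ∉ 𝓞`**: `ℤ₃` is integrally closed and `‖1/3‖₃ = 3 > 1`. [cite: Katz1981CrystallineDieudonne, §5 (supporting lemma)] -/
theorem inv_three_not_mem : (3 : KNine)⁻¹ ∉ ONine := by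
  intro h
  have h' : IsIntegral ℤ_[3] ((3 : KNine)⁻¹) := h
  have e : (3 : KNine)⁻¹ = (IsScalarTower.toAlgHom ℤ_[3] ℚ_[3] KNine) ((3 : ℚ_[3])⁻¹) := by
    rw [IsScalarTower.coe_toAlgHom', map_inv₀, map_ofNat]
  rw [e, isIntegral_algHom_iff _ (algebraMap ℚ_[3] KNine).injective,
    IsIntegrallyClosed.isIntegral_iff] at h'
  obtain ⟨y, hy⟩ := h'
  have h1 : ‖(y : ℚ_[3])‖ ≤ 1 := y.2
  have h3 : ‖((3 : ℚ_[3]))⁻¹‖ = 3 := by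
    have : ‖((3 : ℕ) : ℚ_[3])‖ = ((3 : ℕ) : ℝ)⁻¹ := Padic.norm_p (p := 3)
    rw [norm_inv]
    push_cast at this
    rw [this, inv_inv]
  have hy' : (y : ℚ_[3]) = (3 : ℚ_[3])⁻¹ := hy
  rw [hy', h3] at h1
  norm_num at h1

/-- **`1 − ζ₉` is not a unit of `𝓞`**: `(1 − ζ₉)·y = 1` with `y ∈ 𝓞` would give `1/3 = −θ·y⁶ ∈ 𝓞`. [cite: Katz1981CrystallineDieudonne, §5 (supporting lemma)] -/
theorem one_sub_zeta_mul_ne_one {y : KNine} (hy : y ∈ ONine) : (1 - zeta 9 ℚ_[3] KNine) * y ≠ 1 := by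
  intro h
  apply inv_three_not_mem
  set ζ := zeta 9 ℚ_[3] KNine with hζdef
  have h3 := three_eq_neg_pow_six_mul_thetaInv zeta_spec
  have hθ := theta_mul_thetaInv zeta_spec
  rw [← hζdef] at h3 hθ
  have key : (3 : KNine) *
      (-(1 - 3 * (1 - ζ) + 6 * (1 - ζ) ^ 2 - 7 * (1 - ζ) ^ 3 + 5 * (1 - ζ) ^ 4 - 2 * (1 - ζ) ^ 5) * y ^ 6) = 1 := by
    linear_combination
      (-(1 - 3 * (1 - ζ) + 6 * (1 - ζ) ^ 2 - 7 * (1 - ζ) ^ 3 + 5 * (1 - ζ) ^ 4 - 2 * (1 - ζ) ^ 5) * y ^ 6) * h3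
      + ((1 - ζ) ^ 6 * y ^ 6) * hθ
      + ((((1 - ζ) * y) ^ 5 + ((1 - ζ) * y) ^ 4 + ((1 - ζ) * y) ^ 3 + ((1 - ζ) * y) ^ 2 + (1 - ζ) * y + 1)) * h
  rw [inv_eq_of_mul_eq_one_right key]
  exact mul_mem (neg_mem theta_mem) (pow_mem hy 6)

/-- **One step.** For `x ∈ 𝓞` with NO residue in `𝔽₃` (no integer `a` with `x − a ∈ (1 − ζ₉)𝓞`), a relation
`c₀ + c₁·x ∈ (1 − ζ₉)𝓞` with `c₀, c₁ ∈ ℤ₃` forces `c₀, c₁ ∈ 3ℤ₃`. [cite: Katz1981CrystallineDieudonne, §5 (supporting lemma)] -/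
theorem norm_lt_one_of_residueFree {x : KNine} (hx : x ∈ ONine)
    (H : ∀ (a : ℤ) (y : KNine), y ∈ ONine → x - a ≠ (1 - zeta 9 ℚ_[3] KNine) * y)
    {c₀ c₁ : ℚ_[3]} (h₀ : ‖c₀‖ ≤ 1) (h₁ : ‖c₁‖ ≤ 1) {Y : KNine} (hY : Y ∈ ONine)
    (h : algebraMap ℚ_[3] KNine c₀ + algebraMap ℚ_[3] KNine c₁ * x = (1 - zeta 9 ℚ_[3] KNine) * Y) :
    ‖c₀‖ < 1 ∧ ‖c₁‖ < 1 := by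
  set ζ := zeta 9 ℚ_[3] KNine with hζdef
  set φ := algebraMap ℚ_[3] KNine with hφ
  have h3 := three_eq_neg_pow_six_mul_thetaInv zeta_spec
  rw [← hζdef] at h3
  have h3φ : φ 3 = 3 := map_ofNat φ 3
  by_cases hc₁ : ‖c₁‖ < 1
  · refine ⟨?_, hc₁⟩
    -- `c₁ = 3 c₁'`, so `c₀ = (1 - ζ)·Y'` with `Y' ∈ 𝓞`
    have hc₁' := PadicNormAux.norm_div_three_le_one hc₁
    have hY' : Y + (1 - ζ) ^ 5 * (-10 - 11 * ζ - 7 * ζ ^ 2 - 10 * ζ ^ 3 - 4 * ζ ^ 4 + 4 * ζ ^ 5)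
        * φ (c₁ / 3) * x ∈ ONine :=
      add_mem hY (mul_mem (mul_mem (mul_mem (pow_mem one_sub_zeta_mem 5) thetaInv_mem)
        (algebraMap_mem_of_norm_le_one hc₁')) hx)
    have e₀ : φ c₀ = (1 - ζ) * (Y + (1 - ζ) ^ 5 * (-10 - 11 * ζ - 7 * ζ ^ 2 - 10 * ζ ^ 3 - 4 * ζ ^ 4 + 4 * ζ ^ 5)
        * φ (c₁ / 3) * x) := by
      have ec : φ c₁ = 3 * φ (c₁ / 3) := by
        rw [← h3φ, ← map_mul]; congr 1; ring
      rw [ec] at h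
      linear_combination h - (φ (c₁ / 3) * x) * h3
    by_contra hc₀
    have hn : ‖c₀‖ = 1 := le_antisymm h₀ (not_lt.mp hc₀)
    have hc₀0 : c₀ ≠ 0 := by
      intro h0; rw [h0, norm_zero] at hn; exact zero_ne_one hn
    have hinv : ‖c₀⁻¹‖ ≤ 1 := by rw [norm_inv, hn, inv_one]
    apply one_sub_zeta_mul_ne_one (mul_mem hY' (algebraMap_mem_of_norm_le_one hinv))
    rw [← hζdef, ← mul_assoc, ← e₀, ← map_mul, mul_inv_cancel₀ hc₀0, map_one]
  · exfalso
    have hn : ‖c₁‖ = 1 := le_antisymm h₁ (not_lt.mp hc₁)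
    have hc₁0 : c₁ ≠ 0 := by
      intro h0; rw [h0, norm_zero] at hn; exact zero_ne_one hn
    have hinv : ‖c₁⁻¹‖ ≤ 1 := by rw [norm_inv, hn, inv_one]
    -- `x = -c₀/c₁ + (1 - ζ)·c₁⁻¹·Y`
    have hz : ‖-c₀ * c₁⁻¹‖ ≤ 1 := by
      rw [norm_mul, norm_neg]; exact mul_le_one₀ h₀ (norm_nonneg _) hinv
    obtain ⟨n, -, hnlt⟩ := Literature.IUT.LogVolume.WildCubic.exists_residue hz
    have hz' := PadicNormAux.norm_div_three_le_one hnlt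
    apply H n (-((1 - ζ) ^ 5 * (-10 - 11 * ζ - 7 * ζ ^ 2 - 10 * ζ ^ 3 - 4 * ζ ^ 4 + 4 * ζ ^ 5)
        * φ ((-c₀ * c₁⁻¹ - n) / 3)) + φ c₁⁻¹ * Y)
      (add_mem (neg_mem (mul_mem (mul_mem (pow_mem one_sub_zeta_mem 5) thetaInv_mem)
        (algebraMap_mem_of_norm_le_one hz'))) (mul_mem (algebraMap_mem_of_norm_le_one hinv) hY))
    have ex : x = φ (-c₀ * c₁⁻¹) + (1 - ζ) * (φ c₁⁻¹ * Y) := by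
      have this : φ c₁⁻¹ * φ c₀ + (φ c₁⁻¹ * φ c₁) * x = φ c₁⁻¹ * ((1 - ζ) * Y) := by
        rw [← h]; ring
      have hu : φ c₁⁻¹ * φ c₁ = 1 := by rw [← map_mul, inv_mul_cancel₀ hc₁0, map_one]
      rw [map_mul, map_neg]
      linear_combination this - x * hu
    have en : φ (-c₀ * c₁⁻¹) - (n : KNine) = 3 * φ ((-c₀ * c₁⁻¹ - n) / 3) := by
      rw [← h3φ, ← map_mul, show (n : KNine) = φ n from (map_natCast φ n).symm, ← map_sub]
      congr 1; ring
    rw [Int.cast_natCast, ex, add_sub_right_comm, en]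
    linear_combination (φ ((-c₀ * c₁⁻¹ - ↑n) / 3)) * h3

end Literature.NumberTheory.EllipticCurves.DescendedFrobenius.NineIntegers

end Part6

/-!
## Part 7 — port of `Summits/BirchSwinnertonDyer/BirchSwinnertonDyer/Theorems/CyclotomicUntwistNineIntegersResidueMap.lean` (8 declarations kept)

# The ring `𝓞 = integralClosure ℤ₃ ℚ₃(ζ₉)` of the local currency of `DescendedFrobeniusMatrix`, II: the residue field `𝓞/(1 − ζ₉)𝓞 = 𝔽₃` and the existence of a reduction map `ρ : 𝓞 →+* ZMod 3`, with `ρ(ζ₉) = 1` for every `ρ`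

Declarations of this Part (verbatim port; each keeps its own docstring and citation): `norm_lt_one_of_relation`, `finrank_le_nine`, `exists_int_sub_eq_mul`, `int_residue_unique`, `nonempty_residueMap`, `residueMap_zeta`, `residueMap_one_sub_zeta`, `residueMap_eq_of_sub_eq_mul`.

Reference keys (see `references.bib` and the declarations' citations): [Katz1981CrystallineDieudonne].
-/

section Part7

open scoped _root_.Polynomial

open _root_.Polynomial _root_.IsCyclotomicExtension Literature.NumberTheory.EllipticCurves.DescendedFrobenius
  Literature.NumberTheory.EllipticCurves.DescendedFrobenius Literature.NumberTheory.EllipticCurves.DescendedFrobenius.PadicNormAux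

namespace Literature.NumberTheory.EllipticCurves.DescendedFrobenius.NineIntegers

/-- **Peeling the powers of the uniformizer.** For `x ∈ 𝓞` with no residue in `𝔽₃`, a relation
`Σ_{j<6} (c₀ⱼ + c₁ⱼ·x)·(1 − ζ₉)ʲ = 0` with all `cᵢⱼ ∈ ℤ₃` forces every `cᵢⱼ ∈ 3ℤ₃` (induction on `j`: the terms
below `j` are divisible by `3 = −(1 − ζ₉)⁶θ⁻¹`, hence by `(1 − ζ₉)^{j+1}`, the terms above `j` visibly; cancel
`(1 − ζ₉)ʲ` and apply `norm_lt_one_of_residueFree`). [cite: Katz1981CrystallineDieudonne, §5 (supporting lemma)] -/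
theorem norm_lt_one_of_relation {x : KNine} (hx : x ∈ ONine)
    (H : ∀ (a : ℤ) (y : KNine), y ∈ ONine → x - a ≠ (1 - zeta 9 ℚ_[3] KNine) * y)
    (c₀ c₁ : ℕ → ℚ_[3]) (h₀ : ∀ j, ‖c₀ j‖ ≤ 1) (h₁ : ∀ j, ‖c₁ j‖ ≤ 1)
    (hrel : ∑ j ∈ Finset.range 6, (algebraMap ℚ_[3] KNine (c₀ j) + algebraMap ℚ_[3] KNine (c₁ j) * x)
      * (1 - zeta 9 ℚ_[3] KNine) ^ j = 0) :
    ∀ j < 6, ‖c₀ j‖ < 1 ∧ ‖c₁ j‖ < 1 := by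
  set ζ := zeta 9 ℚ_[3] KNine with hζdef
  set φ := algebraMap ℚ_[3] KNine with hφ
  have h3 := three_eq_neg_pow_six_mul_thetaInv zeta_spec
  rw [← hζdef] at h3
  have h3φ : φ 3 = 3 := map_ofNat φ 3
  have hπ0 : (1 - ζ) ≠ 0 := GNine.one_sub_zeta_ne_zero zeta_spec
  -- the generic term and its membership
  have ht : ∀ j, φ (c₀ j) + φ (c₁ j) * x ∈ ONine := fun j =>
    add_mem (algebraMap_mem_of_norm_le_one (h₀ j)) (mul_mem (algebraMap_mem_of_norm_le_one (h₁ j)) hx)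
  have key : ∀ k ≤ 6, ∀ j < k, ‖c₀ j‖ < 1 ∧ ‖c₁ j‖ < 1 := by
    intro k
    induction k with
    | zero => intro _ j hj; exact absurd hj (Nat.not_lt_zero j)
    | succ k IH =>
      intro hk j hj
      have IH' := IH (by omega)
      rcases Nat.lt_succ_iff_lt_or_eq.mp hj with hjk | rfl
      · exact IH' j hjk
      · -- the step at index `j` (`j < 6`, all lower coefficients already in `3ℤ₃`)
        have hj6 : j < 6 := by omega
        -- lower part: `t_i = 3 s_i`
        have hlow : ∑ i ∈ Finset.range j, (φ (c₀ i) + φ (c₁ i) * x) * (1 - ζ) ^ i =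
            3 * ∑ i ∈ Finset.range j, (φ (c₀ i / 3) + φ (c₁ i / 3) * x) * (1 - ζ) ^ i := by
          rw [Finset.mul_sum]
          refine Finset.sum_congr rfl fun i hi => ?_
          have e0 : φ (c₀ i) = 3 * φ (c₀ i / 3) := by rw [← h3φ, ← map_mul]; congr 1; ring
          have e1 : φ (c₁ i) = 3 * φ (c₁ i / 3) := by rw [← h3φ, ← map_mul]; congr 1; ring
          rw [e0, e1]; ring
        have hA : ∑ i ∈ Finset.range j, (φ (c₀ i / 3) + φ (c₁ i / 3) * x) * (1 - ζ) ^ i ∈ ONine := by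
          refine sum_mem fun i hi => ?_
          have hij : i < j := Finset.mem_range.mp hi
          exact mul_mem (add_mem (algebraMap_mem_of_norm_le_one (PadicNormAux.norm_div_three_le_one (IH' i hij).1))
            (mul_mem (algebraMap_mem_of_norm_le_one (PadicNormAux.norm_div_three_le_one (IH' i hij).2)) hx))
            (pow_mem one_sub_zeta_mem i)
        -- upper part: `(1 - ζ)^i = (1 - ζ)^(j+1) · (1 - ζ)^(i - (j+1))`
        have hup : ∑ i ∈ Finset.Ico (j + 1) 6, (φ (c₀ i) + φ (c₁ i) * x) * (1 - ζ) ^ i =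
            (1 - ζ) ^ (j + 1) *
              ∑ i ∈ Finset.Ico (j + 1) 6, (φ (c₀ i) + φ (c₁ i) * x) * (1 - ζ) ^ (i - (j + 1)) := by
          rw [Finset.mul_sum]
          refine Finset.sum_congr rfl fun i hi => ?_
          have hle : j + 1 ≤ i := (Finset.mem_Ico.mp hi).1
          rw [show (1 - ζ) ^ i = (1 - ζ) ^ (j + 1) * (1 - ζ) ^ (i - (j + 1)) by
            rw [← pow_add, Nat.add_sub_cancel' hle]]
          ring
        have hB : ∑ i ∈ Finset.Ico (j + 1) 6, (φ (c₀ i) + φ (c₁ i) * x) * (1 - ζ) ^ (i - (j + 1)) ∈ ONine :=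
          sum_mem fun i _ => mul_mem (ht i) (pow_mem one_sub_zeta_mem _)
        -- the relation split at `j`
        have hsplit := hrel
        rw [← Finset.sum_range_add_sum_Ico _ hj6.le, Finset.sum_eq_sum_Ico_succ_bot hj6, hlow, hup]
          at hsplit
        have e6 : (1 - ζ) ^ 6 = (1 - ζ) ^ (j + 1) * (1 - ζ) ^ (5 - j) := by
          rw [← pow_add]; congr 1; omega
        set A := ∑ i ∈ Finset.range j, (φ (c₀ i / 3) + φ (c₁ i / 3) * x) * (1 - ζ) ^ i with hAdef
        set B := ∑ i ∈ Finset.Ico (j + 1) 6, (φ (c₀ i) + φ (c₁ i) * x) * (1 - ζ) ^ (i - (j + 1))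
          with hBdef
        set θi := (-10 - 11 * ζ - 7 * ζ ^ 2 - 10 * ζ ^ 3 - 4 * ζ ^ 4 + 4 * ζ ^ 5) with hθi
        -- `t_j (1-ζ)^j = (1-ζ)^(j+1) · W`
        have hW : (φ (c₀ j) + φ (c₁ j) * x) * (1 - ζ) ^ j =
            ((1 - ζ) * ((1 - ζ) ^ (5 - j) * θi * A - B)) * (1 - ζ) ^ j := by
          have e : (φ (c₀ j) + φ (c₁ j) * x) * (1 - ζ) ^ j = -(3 * A) - (1 - ζ) ^ (j + 1) * B := by
            linear_combination hsplit
          rw [e, h3, e6]; ring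
        have ht_eq : φ (c₀ j) + φ (c₁ j) * x = (1 - ζ) * ((1 - ζ) ^ (5 - j) * θi * A - B) :=
          mul_right_cancel₀ (pow_ne_zero j hπ0) hW
        exact norm_lt_one_of_residueFree hx H (h₀ j) (h₁ j)
          (sub_mem (mul_mem (mul_mem (pow_mem one_sub_zeta_mem _) thetaInv_mem) hA) hB) ht_eq
  exact key 6 le_rfl

/-- `[ℚ₃(ζ₉) : ℚ₃] ≤ 9` (`ζ₉` generates and is a root of `X⁹ − 1`; the true value `6` is not needed).
[cite: Katz1981CrystallineDieudonne, §5 (supporting lemma)] -/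
theorem finrank_le_nine : Module.finrank ℚ_[3] KNine ≤ 9 := by
  haveI : Module.Finite ℚ_[3] KNine := IsCyclotomicExtension.finite {9} ℚ_[3] KNine
  have hζ := zeta_spec
  rw [(IsPrimitiveRoot.powerBasis ℚ_[3] hζ).finrank, IsPrimitiveRoot.powerBasis_dim]
  have hdvd : minpoly ℚ_[3] (zeta 9 ℚ_[3] KNine) ∣ (X ^ 9 - C 1 : ℚ_[3][X]) := by
    apply minpoly.dvd
    simp [hζ.pow_eq_one]
  have h9 : (X ^ 9 - C 1 : ℚ_[3][X]).natDegree = 9 := natDegree_X_pow_sub_C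
  have hne : (X ^ 9 - C 1 : ℚ_[3][X]) ≠ 0 := X_pow_sub_C_ne_zero (by norm_num) 1
  calc (minpoly ℚ_[3] (zeta 9 ℚ_[3] KNine)).natDegree ≤ (X ^ 9 - C 1 : ℚ_[3][X]).natDegree :=
        natDegree_le_of_dvd hdvd hne
    _ = 9 := h9

/-- **The residue field of `𝓞` is `𝔽₃`: every `x ∈ 𝓞` is `≡` an integer modulo `(1 − ζ₉)𝓞`.** Proof: otherwise
the `12` elements `xⁱ(1 − ζ₉)ʲ` (`i < 2`, `j < 6`) would be `ℚ₃`-linearly independent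
(`norm_lt_one_of_relation` applied to a dependence normalised to have a unit coefficient), against
`[ℚ₃(ζ₉) : ℚ₃] ≤ 9` — the fundamental inequality `e·f ≤ n` made explicit for `ℚ₃(ζ₉)`, `e = 6`, `f = 1`
(Serre, *Local Fields* I §4, II §3). [cite: Katz1981CrystallineDieudonne, §5 (supporting lemma)] -/
theorem exists_int_sub_eq_mul (x : KNine) (hx : x ∈ ONine) :
    ∃ (a : ℤ) (y : KNine), y ∈ ONine ∧ x - a = (1 - zeta 9 ℚ_[3] KNine) * y := by
  by_contra H'
  have H : ∀ (a : ℤ) (y : KNine), y ∈ ONine → x - a ≠ (1 - zeta 9 ℚ_[3] KNine) * y :=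
    fun a y hy h => H' ⟨a, y, hy, h⟩
  set ζ := zeta 9 ℚ_[3] KNine with hζdef
  set φ := algebraMap ℚ_[3] KNine with hφ
  haveI : Module.Finite ℚ_[3] KNine := IsCyclotomicExtension.finite {9} ℚ_[3] KNine
  let v : Fin 2 × Fin 6 → KNine := fun p => x ^ (p.1 : ℕ) * (1 - ζ) ^ (p.2 : ℕ)
  have hdep : ¬ LinearIndependent ℚ_[3] v := by
    intro hli
    have h := hli.fintype_card_le_finrank
    have h9 := finrank_le_nine
    simp only [Fintype.card_prod, Fintype.card_fin] at h
    omega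
  obtain ⟨g, hsum, i₀, hi₀⟩ := Fintype.not_linearIndependent_iff.mp hdep
  obtain ⟨m, -, hm⟩ := Finset.exists_max_image Finset.univ (fun i => ‖g i‖) Finset.univ_nonempty
  have hgm : g m ≠ 0 := by
    intro h0
    apply hi₀
    have := hm i₀ (Finset.mem_univ _)
    rw [h0, norm_zero] at this
    exact norm_le_zero_iff.mp this
  have hc : ∀ p, ‖g p / g m‖ ≤ 1 := fun p => by
    rw [norm_div]
    exact div_le_one_of_le₀ (hm p (Finset.mem_univ _)) (norm_nonneg _)
  -- the normalised coefficients, as functions on `ℕ`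
  let c₀ : ℕ → ℚ_[3] := fun j => if h : j < 6 then g (0, ⟨j, h⟩) / g m else 0
  let c₁ : ℕ → ℚ_[3] := fun j => if h : j < 6 then g (1, ⟨j, h⟩) / g m else 0
  have h₀ : ∀ j, ‖c₀ j‖ ≤ 1 := by
    intro j; by_cases h : j < 6
    · simp only [c₀, dif_pos h]; exact hc _
    · simp only [c₀, dif_neg h, norm_zero]; exact zero_le_one
  have h₁ : ∀ j, ‖c₁ j‖ ≤ 1 := by
    intro j; by_cases h : j < 6
    · simp only [c₁, dif_pos h]; exact hc _
    · simp only [c₁, dif_neg h, norm_zero]; exact zero_le_one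
  -- the relation, divided by `g m` and regrouped along `j`
  have hrel : ∑ j ∈ Finset.range 6, (φ (c₀ j) + φ (c₁ j) * x) * (1 - ζ) ^ j = 0 := by
    have h1 : ∑ p, (g p / g m) • v p = 0 := by
      have := congrArg (fun z => (g m)⁻¹ • z) hsum
      simp only [Finset.smul_sum, smul_smul, smul_zero] at this
      rw [← this]
      refine Finset.sum_congr rfl fun p _ => ?_
      rw [div_eq_inv_mul]
    rw [Fintype.sum_prod_type, Fin.sum_univ_two, ← Finset.sum_add_distrib] at h1
    rw [← Fin.sum_univ_eq_sum_range (fun j => (φ (c₀ j) + φ (c₁ j) * x) * (1 - ζ) ^ j) 6, ← h1]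
    refine Finset.sum_congr rfl fun j _ => ?_
    simp only [c₀, c₁, dif_pos j.2, Fin.eta, v, Algebra.smul_def, Fin.val_zero, Fin.val_one, pow_zero,
      pow_one]
    ring
  have hall := norm_lt_one_of_relation hx H c₀ c₁ h₀ h₁ hrel
  -- at the index `m` the coefficient is `g m / g m = 1`, not of norm `< 1`
  obtain ⟨i, j⟩ := m
  have hone : ‖g (i, j) / g (i, j)‖ < 1 := by
    fin_cases i
    · have := (hall j j.2).1
      simpa only [c₀, dif_pos j.2, Fin.eta, Fin.zero_eta] using this
    · have := (hall j j.2).2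
      simpa only [c₁, dif_pos j.2, Fin.eta, Fin.mk_one] using this
  rw [div_self hgm, norm_one] at hone
  exact lt_irrefl _ hone

/-- **Uniqueness of the residue**: two integers congruent to the same `x` modulo `(1 − ζ₉)𝓞` are congruent
modulo `3` (`1 − ζ₉` is not a unit of `𝓞` and `3 ∈ (1 − ζ₉)𝓞`; Bézout in `ℤ`). [cite: Katz1981CrystallineDieudonne, §5 (supporting lemma)] -/
theorem int_residue_unique {x : KNine} {a b : ℤ} {y y' : KNine} (hy : y ∈ ONine) (hy' : y' ∈ ONine)
    (ha : x - a = (1 - zeta 9 ℚ_[3] KNine) * y) (hb : x - b = (1 - zeta 9 ℚ_[3] KNine) * y') :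
    (3 : ℤ) ∣ a - b := by
  by_contra hnd
  set ζ := zeta 9 ℚ_[3] KNine with hζdef
  have h3 := three_eq_neg_pow_six_mul_thetaInv zeta_spec
  rw [← hζdef] at h3
  -- Bézout: `u (a - b) + w · 3 = 1`
  have hcop : IsCoprime (a - b) 3 := by
    rw [Int.isCoprime_iff_gcd_eq_one]
    have hp : Nat.Prime (Int.gcd (a - b) 3) ∨ Int.gcd (a - b) 3 = 1 := by
      have hdvd3 : (Int.gcd (a - b) 3 : ℤ) ∣ 3 := Int.gcd_dvd_right _ _
      have h' : Int.gcd (a - b) 3 ∣ 3 := by exact_mod_cast hdvd3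
      rcases (Nat.dvd_prime Nat.prime_three).mp h' with h | h
      · exact Or.inr h
      · exact Or.inl (h ▸ Nat.prime_three)
    rcases hp with hp | hp
    · exfalso
      have hg3 : (Int.gcd (a - b) 3 : ℤ) ∣ 3 := Int.gcd_dvd_right _ _
      have hga : (Int.gcd (a - b) 3 : ℤ) ∣ a - b := Int.gcd_dvd_left _ _
      have : Int.gcd (a - b) 3 = 3 := by
        have h' : Int.gcd (a - b) 3 ∣ 3 := by exact_mod_cast hg3
        rcases (Nat.dvd_prime Nat.prime_three).mp h' with h | h
        · rw [h] at hp; exact absurd hp Nat.not_prime_one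
        · exact h
      rw [this] at hga
      exact hnd (by exact_mod_cast hga)
    · exact hp
  obtain ⟨u, w, huw⟩ := hcop
  have hab : ((a : KNine) - (b : KNine)) = (1 - ζ) * (y' - y) := by linear_combination hb - ha
  apply one_sub_zeta_mul_ne_one (y := (u : KNine) * (y' - y)
      - (w : KNine) * (1 - ζ) ^ 5 * (-10 - 11 * ζ - 7 * ζ ^ 2 - 10 * ζ ^ 3 - 4 * ζ ^ 4 + 4 * ζ ^ 5))
    (sub_mem (mul_mem (intCast_mem ONine u) (sub_mem hy' hy))
      (mul_mem (mul_mem (intCast_mem ONine w) (pow_mem one_sub_zeta_mem 5)) thetaInv_mem))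
  have huwK : (u : KNine) * ((a : KNine) - (b : KNine)) + (w : KNine) * 3 = 1 := by exact_mod_cast huw
  rw [← hζdef]
  linear_combination huwK - (u : KNine) * hab - (w : KNine) * h3

/-- **EXISTENCE of a reduction map `ρ : 𝓞 →+* ZMod 3`** (`𝓞 = integralClosure ℤ₃ ℚ₃(ζ₉)`, the ring over which
the good models `NineGoodModel` of `Literature.DescendedFrobeniusMatrix` live): send `x` to its residue digit
(`exists_int_sub_eq_mul`, well defined by `int_residue_unique`). Its kernel is the maximal ideal `(1 − ζ₉)𝓞`; the
named fact `isDescendedFrobeniusMatrix_exists` and `NineGoodModel.specialFibreTrace` quantify over such `ρ`, and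
this theorem says the quantification is not vacuous. [cite: Katz1981CrystallineDieudonne, §5 (supporting lemma)] -/
theorem nonempty_residueMap : Nonempty (ONine →+* ZMod 3) := by
  classical
  -- the digit
  let d : ONine → ℤ := fun x => (exists_int_sub_eq_mul x.1 x.2).choose
  have hd : ∀ x : ONine, ∃ y : KNine, y ∈ ONine ∧ (x : KNine) - d x = (1 - zeta 9 ℚ_[3] KNine) * y :=
    fun x => (exists_int_sub_eq_mul x.1 x.2).choose_spec
  -- well-definedness: any witness computes the digit mod 3
  have hdig : ∀ (x : ONine) (a : ℤ) (y : KNine), y ∈ ONine → (x : KNine) - a = (1 - zeta 9 ℚ_[3] KNine) * y →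
      ((d x : ℤ) : ZMod 3) = a := by
    intro x a y hy h
    obtain ⟨y₀, hy₀, h₀⟩ := hd x
    exact (ZMod.intCast_eq_intCast_iff_dvd_sub (d x) a 3).mpr (int_residue_unique hy hy₀ h h₀)
  refine ⟨{ toFun := fun x => ((d x : ℤ) : ZMod 3),
             map_one' := ?_, map_mul' := ?_, map_zero' := ?_, map_add' := ?_ }⟩
  · have := hdig 1 1 0 (zero_mem _) (by simp)
    simpa using this
  · intro x y
    obtain ⟨u, hu, hux⟩ := hd x
    obtain ⟨v, hv, hvy⟩ := hd y
    have key := hdig (x * y) (d x * d y) ((x : KNine) * v + (d y : KNine) * u)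
      (add_mem (mul_mem x.2 hv) (mul_mem (intCast_mem ONine _) hu)) (by
        push_cast
        linear_combination (x : KNine) * hvy + (d y : KNine) * hux)
    simpa using key
  · have := hdig 0 0 0 (zero_mem _) (by simp)
    simpa using this
  · intro x y
    obtain ⟨u, hu, hux⟩ := hd x
    obtain ⟨v, hv, hvy⟩ := hd y
    have key := hdig (x + y) (d x + d y) (u + v) (add_mem hu hv) (by
        push_cast
        linear_combination hux + hvy)
    simpa using key

/-- **Every reduction map sends `ζ₉` to `1`** (`ρ(ζ₉)⁹ = 1` in `𝔽₃`, whose only ninth root of unity is `1`).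
[cite: Katz1981CrystallineDieudonne, §5 (supporting lemma)] -/
theorem residueMap_zeta (ρ : ONine →+* ZMod 3) : ρ ⟨zeta 9 ℚ_[3] KNine, zeta_mem⟩ = 1 := by
  have h9 : (ρ ⟨zeta 9 ℚ_[3] KNine, zeta_mem⟩) ^ 9 = 1 := by
    rw [← map_pow, ← map_one ρ]
    congr 1
    apply Subtype.ext
    simp [zeta_spec.pow_eq_one]
  have key : ∀ u : ZMod 3, u ^ 9 = 1 → u = 1 := by decide
  exact key _ h9

/-- Every reduction map kills the uniformizer: `ρ(1 − ζ₉) = 0`. [cite: Katz1981CrystallineDieudonne, §5 (supporting lemma)] -/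
theorem residueMap_one_sub_zeta (ρ : ONine →+* ZMod 3) :
    ρ ⟨1 - zeta 9 ℚ_[3] KNine, one_sub_zeta_mem⟩ = 0 := by
  have e : (⟨1 - zeta 9 ℚ_[3] KNine, one_sub_zeta_mem⟩ : ONine) = 1 - ⟨zeta 9 ℚ_[3] KNine, zeta_mem⟩ :=
    Subtype.ext (by simp)
  rw [e, map_sub, map_one, residueMap_zeta, sub_self]

/-- **Computing a reduction map**: if `x − a ∈ (1 − ζ₉)·𝓞` for an integer `a`, then `ρ x = a` for EVERY
reduction map `ρ` (so the special fibre of an explicit model over `𝓞` does not depend on `ρ`). [cite: Katz1981CrystallineDieudonne, §5 (supporting lemma)] -/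
theorem residueMap_eq_of_sub_eq_mul (ρ : ONine →+* ZMod 3) {x : ONine} {a : ℤ} {y : KNine} (hy : y ∈ ONine)
    (h : (x : KNine) - a = (1 - zeta 9 ℚ_[3] KNine) * y) : ρ x = a := by
  have e : x - (a : ONine) = ⟨1 - zeta 9 ℚ_[3] KNine, one_sub_zeta_mem⟩ * ⟨y, hy⟩ :=
    Subtype.ext (by push_cast; exact h)
  have := congrArg ρ e
  rw [map_sub, map_intCast, map_mul, residueMap_one_sub_zeta, zero_mul, sub_eq_zero] at this
  exact this

end Literature.NumberTheory.EllipticCurves.DescendedFrobenius.NineIntegers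

end Part7

/-!
## Part 8 — port of `Summits/BirchSwinnertonDyer/BirchSwinnertonDyer/Theorems/CyclotomicUntwistNineIntegersStructure.lean` (15 declarations kept)

# The ring `𝓞 = integralClosure ℤ₃ ℚ₃(ζ₉)` of the local currency of `DescendedFrobeniusMatrix`, III: the reduction map is unique with kernel `(1 − ζ₉)𝓞` and `𝓞 ⧸ (1 − ζ₉) ≃ 𝔽₃`; `[ℚ₃(ζ₉) : ℚ₃] = 6`, so `Φ₉` is irreducible over `ℚ₃`; and `𝓞 =

Declarations of this Part (verbatim port; each keeps its own docstring and citation): `exists_int_residueMap_eq`, `residueMap_eq_zero_iff`, `ker_residueMap_eq`, `norm_lt_one_of_relation_pow`, `linearIndependent_one_sub_zeta_pow`, `finrank_eq_six`, `zeta_isIntegral_padic`, `minpoly_zeta_eq_cyclotomic`, `adjoin_zeta_le`, `one_sub_zeta_mem_adjoin`, `exists_mem_adjoin_add_pow_mul`, `exists_mem_adjoin_add_three_mul`, `toSubmodule_fg`, `integralClosure_eq_adjoin`, `exists_aeval_eq_of_mem`.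

Reference keys (see `references.bib` and the declarations' citations): [Katz1981CrystallineDieudonne].
-/

section Part8

open scoped _root_.Polynomial

open _root_.Polynomial _root_.IsCyclotomicExtension Literature.NumberTheory.EllipticCurves.DescendedFrobenius
  Literature.NumberTheory.EllipticCurves.DescendedFrobenius Literature.NumberTheory.EllipticCurves.DescendedFrobenius.PadicNormAux

namespace Literature.NumberTheory.EllipticCurves.DescendedFrobenius.NineIntegers

/-- **Every reduction map is the digit map**: `ρ x = a` for the residue digit `a` of `x` (`exists_int_sub_eq_mul`).
[cite: Katz1981CrystallineDieudonne, §5 (supporting lemma)] -/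
theorem exists_int_residueMap_eq (ρ : ONine →+* ZMod 3) (x : ONine) :
    ∃ (a : ℤ) (y : KNine), y ∈ ONine ∧ (x : KNine) - a = (1 - zeta 9 ℚ_[3] KNine) * y ∧ ρ x = a := by
  obtain ⟨a, y, hy, h⟩ := exists_int_sub_eq_mul x.1 x.2
  exact ⟨a, y, hy, h, residueMap_eq_of_sub_eq_mul ρ hy h⟩

/-- **The kernel of a reduction map is `(1 − ζ₉)𝓞`**: `ρ x = 0 ↔ x ∈ (1 − ζ₉)·𝓞`. [cite: Katz1981CrystallineDieudonne, §5 (supporting lemma)] -/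
theorem residueMap_eq_zero_iff (ρ : ONine →+* ZMod 3) (x : ONine) :
    ρ x = 0 ↔ ∃ y : KNine, y ∈ ONine ∧ (x : KNine) = (1 - zeta 9 ℚ_[3] KNine) * y := by
  set ζ := zeta 9 ℚ_[3] KNine with hζdef
  constructor
  · intro h0
    obtain ⟨a, y, hy, h, hρ⟩ := exists_int_residueMap_eq ρ x
    rw [h0, eq_comm, ZMod.intCast_zmod_eq_zero_iff_dvd] at hρ
    obtain ⟨k, rfl⟩ := hρ
    have h3 := three_eq_neg_pow_six_mul_thetaInv zeta_spec
    rw [← hζdef] at h3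
    refine ⟨y - (1 - ζ) ^ 5 * (-10 - 11 * ζ - 7 * ζ ^ 2 - 10 * ζ ^ 3 - 4 * ζ ^ 4 + 4 * ζ ^ 5) * k,
      sub_mem hy (mul_mem (mul_mem (pow_mem one_sub_zeta_mem 5) thetaInv_mem) (intCast_mem ONine k)), ?_⟩
    have h' : (x : KNine) = ((3 * k : ℤ) : KNine) + (1 - ζ) * y := by rw [← h]; ring
    rw [h']
    push_cast
    linear_combination (k : KNine) * h3
  · rintro ⟨y, hy, h⟩
    have e : x = ⟨1 - zeta 9 ℚ_[3] KNine, one_sub_zeta_mem⟩ * ⟨y, hy⟩ := Subtype.ext (by push_cast; exact h)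
    rw [e, map_mul, residueMap_one_sub_zeta, zero_mul]

/-- The kernel as an ideal: `ker ρ = 𝓞·(1 − ζ₉)`. [cite: Katz1981CrystallineDieudonne, §5 (supporting lemma)] -/
theorem ker_residueMap_eq (ρ : ONine →+* ZMod 3) :
    RingHom.ker ρ = Ideal.span {(⟨1 - zeta 9 ℚ_[3] KNine, one_sub_zeta_mem⟩ : ONine)} := by
  ext x
  rw [RingHom.mem_ker, residueMap_eq_zero_iff, Ideal.mem_span_singleton']
  constructor
  · rintro ⟨y, hy, h⟩
    exact ⟨⟨y, hy⟩, Subtype.ext (by push_cast; rw [h, mul_comm])⟩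
  · rintro ⟨y, hy⟩
    exact ⟨y, y.2, by rw [← hy]; push_cast; ring⟩

/-- **Peeling, digit-free form**: a relation `Σ_{j<6} cⱼ (1 − ζ₉)ʲ = 0` with `cⱼ ∈ ℤ₃` forces every `cⱼ ∈ 3ℤ₃`
(`e ≥ 6`). [cite: Katz1981CrystallineDieudonne, §5 (supporting lemma)] -/
theorem norm_lt_one_of_relation_pow (c : ℕ → ℚ_[3]) (hc : ∀ j, ‖c j‖ ≤ 1)
    (hrel : ∑ j ∈ Finset.range 6, algebraMap ℚ_[3] KNine (c j) * (1 - zeta 9 ℚ_[3] KNine) ^ j = 0) :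
    ∀ j < 6, ‖c j‖ < 1 := by
  set ζ := zeta 9 ℚ_[3] KNine with hζdef
  set φ := algebraMap ℚ_[3] KNine with hφ
  have h3 := three_eq_neg_pow_six_mul_thetaInv zeta_spec
  rw [← hζdef] at h3
  have h3φ : φ 3 = 3 := map_ofNat φ 3
  have hπ0 : (1 - ζ) ≠ 0 := GNine.one_sub_zeta_ne_zero zeta_spec
  have key : ∀ k ≤ 6, ∀ j < k, ‖c j‖ < 1 := by
    intro k
    induction k with
    | zero => intro _ j hj; exact absurd hj (Nat.not_lt_zero j)
    | succ k IH =>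
      intro hk j hj
      have IH' := IH (by omega)
      rcases Nat.lt_succ_iff_lt_or_eq.mp hj with hjk | rfl
      · exact IH' j hjk
      · have hj6 : j < 6 := by omega
        have hlow : ∑ i ∈ Finset.range j, φ (c i) * (1 - ζ) ^ i =
            3 * ∑ i ∈ Finset.range j, φ (c i / 3) * (1 - ζ) ^ i := by
          rw [Finset.mul_sum]
          refine Finset.sum_congr rfl fun i hi => ?_
          have e0 : φ (c i) = 3 * φ (c i / 3) := by rw [← h3φ, ← map_mul]; congr 1; ring
          rw [e0]; ring
        have hA : ∑ i ∈ Finset.range j, φ (c i / 3) * (1 - ζ) ^ i ∈ ONine := by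
          refine sum_mem fun i hi => ?_
          have hij : i < j := Finset.mem_range.mp hi
          exact mul_mem (algebraMap_mem_of_norm_le_one (PadicNormAux.norm_div_three_le_one (IH' i hij)))
            (pow_mem one_sub_zeta_mem i)
        have hup : ∑ i ∈ Finset.Ico (j + 1) 6, φ (c i) * (1 - ζ) ^ i =
            (1 - ζ) ^ (j + 1) * ∑ i ∈ Finset.Ico (j + 1) 6, φ (c i) * (1 - ζ) ^ (i - (j + 1)) := by
          rw [Finset.mul_sum]
          refine Finset.sum_congr rfl fun i hi => ?_
          have hle : j + 1 ≤ i := (Finset.mem_Ico.mp hi).1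
          rw [show (1 - ζ) ^ i = (1 - ζ) ^ (j + 1) * (1 - ζ) ^ (i - (j + 1)) by
            rw [← pow_add, Nat.add_sub_cancel' hle]]
          ring
        have hB : ∑ i ∈ Finset.Ico (j + 1) 6, φ (c i) * (1 - ζ) ^ (i - (j + 1)) ∈ ONine :=
          sum_mem fun i _ => mul_mem (algebraMap_mem_of_norm_le_one (hc i)) (pow_mem one_sub_zeta_mem _)
        have hsplit := hrel
        rw [← Finset.sum_range_add_sum_Ico _ hj6.le, Finset.sum_eq_sum_Ico_succ_bot hj6, hlow, hup]
          at hsplit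
        have e6 : (1 - ζ) ^ 6 = (1 - ζ) ^ (j + 1) * (1 - ζ) ^ (5 - j) := by
          rw [← pow_add]; congr 1; omega
        set A := ∑ i ∈ Finset.range j, φ (c i / 3) * (1 - ζ) ^ i with hAdef
        set B := ∑ i ∈ Finset.Ico (j + 1) 6, φ (c i) * (1 - ζ) ^ (i - (j + 1)) with hBdef
        set θi := (-10 - 11 * ζ - 7 * ζ ^ 2 - 10 * ζ ^ 3 - 4 * ζ ^ 4 + 4 * ζ ^ 5) with hθi
        have hW : φ (c j) * (1 - ζ) ^ j = ((1 - ζ) * ((1 - ζ) ^ (5 - j) * θi * A - B)) * (1 - ζ) ^ j := by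
          have e : φ (c j) * (1 - ζ) ^ j = -(3 * A) - (1 - ζ) ^ (j + 1) * B := by
            linear_combination hsplit
          rw [e, h3, e6]; ring
        have ht_eq : φ (c j) = (1 - ζ) * ((1 - ζ) ^ (5 - j) * θi * A - B) :=
          mul_right_cancel₀ (pow_ne_zero j hπ0) hW
        have hY : (1 - ζ) ^ (5 - j) * θi * A - B ∈ ONine :=
          sub_mem (mul_mem (mul_mem (pow_mem one_sub_zeta_mem _) thetaInv_mem) hA) hB
        -- if `‖c j‖ = 1` then `1 − ζ` would be a unit of `𝓞`
        by_contra hcj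
        have hn : ‖c j‖ = 1 := le_antisymm (hc j) (not_lt.mp hcj)
        have hc0 : c j ≠ 0 := by
          intro h0; rw [h0, norm_zero] at hn; exact zero_ne_one hn
        have hinv : ‖(c j)⁻¹‖ ≤ 1 := by rw [norm_inv, hn, inv_one]
        apply one_sub_zeta_mul_ne_one (mul_mem hY (algebraMap_mem_of_norm_le_one hinv))
        rw [← hζdef, ← mul_assoc, ← ht_eq, ← map_mul, mul_inv_cancel₀ hc0, map_one]
  exact key 6 le_rfl

/-- **`1, (1 − ζ₉), …, (1 − ζ₉)⁵` are `ℚ₃`-linearly independent** (`e(ℚ₃(ζ₉)/ℚ₃) ≥ 6`). [cite: Katz1981CrystallineDieudonne, §5 (supporting lemma)] -/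
theorem linearIndependent_one_sub_zeta_pow :
    LinearIndependent ℚ_[3] (fun j : Fin 6 => (1 - zeta 9 ℚ_[3] KNine) ^ (j : ℕ)) := by
  rw [Fintype.linearIndependent_iff]
  intro g hsum
  by_contra hne
  push Not at hne
  obtain ⟨i₀, hi₀⟩ := hne
  obtain ⟨m, -, hm⟩ := Finset.exists_max_image Finset.univ (fun i => ‖g i‖) Finset.univ_nonempty
  have hgm : g m ≠ 0 := by
    intro h0
    apply hi₀
    have := hm i₀ (Finset.mem_univ _)
    rw [h0, norm_zero] at this
    exact norm_le_zero_iff.mp this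
  let c : ℕ → ℚ_[3] := fun j => if h : j < 6 then g ⟨j, h⟩ / g m else 0
  have hc : ∀ j, ‖c j‖ ≤ 1 := by
    intro j; by_cases h : j < 6
    · simp only [c, dif_pos h, norm_div]
      exact div_le_one_of_le₀ (hm _ (Finset.mem_univ _)) (norm_nonneg _)
    · simp only [c, dif_neg h, norm_zero]; exact zero_le_one
  have hrel : ∑ j ∈ Finset.range 6, algebraMap ℚ_[3] KNine (c j) * (1 - zeta 9 ℚ_[3] KNine) ^ j = 0 := by
    have h1 : ∑ i : Fin 6, (g i / g m) • (1 - zeta 9 ℚ_[3] KNine) ^ (i : ℕ) = 0 := by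
      have := congrArg (fun z => (g m)⁻¹ • z) hsum
      simp only [Finset.smul_sum, smul_smul, smul_zero] at this
      rw [← this]
      refine Finset.sum_congr rfl fun p _ => ?_
      rw [div_eq_inv_mul]
    rw [← Fin.sum_univ_eq_sum_range (fun j => algebraMap ℚ_[3] KNine (c j) * (1 - zeta 9 ℚ_[3] KNine) ^ j) 6,
      ← h1]
    refine Finset.sum_congr rfl fun j _ => ?_
    simp only [c, dif_pos j.2, Fin.eta, Algebra.smul_def]
  have hall := norm_lt_one_of_relation_pow c hc hrel m m.2
  simp only [c, dif_pos m.2, Fin.eta, div_self hgm, norm_one] at hall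
  exact lt_irrefl _ hall

/-- **`[ℚ₃(ζ₉) : ℚ₃] = 6`** (`≥ 6` by `linearIndependent_one_sub_zeta_pow`, `≤ 6` since `ζ₉` is a root of `Φ₉`).
[cite: Katz1981CrystallineDieudonne, §5 (supporting lemma)] -/
theorem finrank_eq_six : Module.finrank ℚ_[3] KNine = 6 := by
  haveI : Module.Finite ℚ_[3] KNine := IsCyclotomicExtension.finite {9} ℚ_[3] KNine
  have hζ := zeta_spec
  refine le_antisymm ?_ ?_
  · rw [(IsPrimitiveRoot.powerBasis ℚ_[3] hζ).finrank, IsPrimitiveRoot.powerBasis_dim]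
    have hdvd : minpoly ℚ_[3] (zeta 9 ℚ_[3] KNine) ∣ cyclotomic 9 ℚ_[3] :=
      minpoly.dvd ℚ_[3] _ (by
        rw [aeval_def, ← eval_map, map_cyclotomic, ← IsRoot.def, isRoot_cyclotomic_iff]
        exact hζ)
    calc (minpoly ℚ_[3] (zeta 9 ℚ_[3] KNine)).natDegree ≤ (cyclotomic 9 ℚ_[3]).natDegree :=
          natDegree_le_of_dvd hdvd (cyclotomic_ne_zero 9 ℚ_[3])
      _ = 6 := by rw [natDegree_cyclotomic]; decide
  · simpa using linearIndependent_one_sub_zeta_pow.fintype_card_le_finrank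

/-- `ζ₉` is integral over `ℚ₃`. [cite: Katz1981CrystallineDieudonne, §5 (supporting lemma)] -/
theorem zeta_isIntegral_padic : IsIntegral ℚ_[3] (zeta 9 ℚ_[3] KNine) := zeta_isIntegral.tower_top

/-- The minimal polynomial of `ζ₉` over `ℚ₃` is `Φ₉`. [cite: Katz1981CrystallineDieudonne, §5 (supporting lemma)] -/
theorem minpoly_zeta_eq_cyclotomic : minpoly ℚ_[3] (zeta 9 ℚ_[3] KNine) = cyclotomic 9 ℚ_[3] := by
  haveI : Module.Finite ℚ_[3] KNine := IsCyclotomicExtension.finite {9} ℚ_[3] KNine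
  have hζ := zeta_spec
  have hdvd : minpoly ℚ_[3] (zeta 9 ℚ_[3] KNine) ∣ cyclotomic 9 ℚ_[3] :=
    minpoly.dvd ℚ_[3] _ (by
      rw [aeval_def, ← eval_map, map_cyclotomic, ← IsRoot.def, isRoot_cyclotomic_iff]
      exact hζ)
  have hdeg : (minpoly ℚ_[3] (zeta 9 ℚ_[3] KNine)).natDegree = 6 := by
    have h := finrank_eq_six
    rw [(IsPrimitiveRoot.powerBasis ℚ_[3] hζ).finrank, IsPrimitiveRoot.powerBasis_dim] at h
    exact h
  symm
  refine eq_of_monic_of_dvd_of_natDegree_le (minpoly.monic zeta_isIntegral_padic) (cyclotomic.monic 9 ℚ_[3])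
    hdvd ?_
  rw [hdeg, natDegree_cyclotomic]; decide

/-- `ℤ₃[ζ₉] ⊆ 𝓞`. [cite: Katz1981CrystallineDieudonne, §5 (supporting lemma)] -/
theorem adjoin_zeta_le : Algebra.adjoin ℤ_[3] {zeta 9 ℚ_[3] KNine} ≤ ONine :=
  Algebra.adjoin_le (Set.singleton_subset_iff.mpr zeta_mem)

/-- `1 − ζ₉ ∈ ℤ₃[ζ₉]`. [cite: Katz1981CrystallineDieudonne, §5 (supporting lemma)] -/
theorem one_sub_zeta_mem_adjoin : 1 - zeta 9 ℚ_[3] KNine ∈ Algebra.adjoin ℤ_[3] {zeta 9 ℚ_[3] KNine} :=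
  sub_mem (one_mem _) (Algebra.subset_adjoin (Set.mem_singleton _))

/-- **Digit expansion to any order**: `x ∈ 𝓞` is `≡` an element of `ℤ₃[ζ₉]` modulo `(1 − ζ₉)ᵏ𝓞`, for every `k`
(iterate `exists_int_sub_eq_mul`). [cite: Katz1981CrystallineDieudonne, §5 (supporting lemma)] -/
theorem exists_mem_adjoin_add_pow_mul (x : KNine) (hx : x ∈ ONine) (k : ℕ) :
    ∃ p ∈ Algebra.adjoin ℤ_[3] {zeta 9 ℚ_[3] KNine}, ∃ y ∈ ONine,
      x = p + (1 - zeta 9 ℚ_[3] KNine) ^ k * y := by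
  induction k with
  | zero => exact ⟨0, zero_mem _, x, hx, by ring⟩
  | succ k IH =>
    obtain ⟨p, hp, y, hy, hxy⟩ := IH
    obtain ⟨a, y', hy', hay⟩ := exists_int_sub_eq_mul y hy
    refine ⟨p + (a : KNine) * (1 - zeta 9 ℚ_[3] KNine) ^ k,
      add_mem hp (mul_mem (intCast_mem _ a) (pow_mem one_sub_zeta_mem_adjoin k)), y', hy', ?_⟩
    have ey : y = (a : KNine) + (1 - zeta 9 ℚ_[3] KNine) * y' := by linear_combination hay
    rw [hxy, ey]; ring

/-- **Digit expansion modulo `3`**: every `x ∈ 𝓞` is `p + 3y` with `p ∈ ℤ₃[ζ₉]`, `y ∈ 𝓞` (order `6`, and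
`(1 − ζ₉)⁶ = −3θ`). [cite: Katz1981CrystallineDieudonne, §5 (supporting lemma)] -/
theorem exists_mem_adjoin_add_three_mul (x : KNine) (hx : x ∈ ONine) :
    ∃ p ∈ Algebra.adjoin ℤ_[3] {zeta 9 ℚ_[3] KNine}, ∃ y ∈ ONine, x = p + 3 * y := by
  obtain ⟨p, hp, y, hy, hxy⟩ := exists_mem_adjoin_add_pow_mul x hx 6
  have h6 := GNine.varpi_pow_six zeta_spec
  refine ⟨p, hp, -(1 - 3 * (1 - zeta 9 ℚ_[3] KNine) + 6 * (1 - zeta 9 ℚ_[3] KNine) ^ 2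
      - 7 * (1 - zeta 9 ℚ_[3] KNine) ^ 3 + 5 * (1 - zeta 9 ℚ_[3] KNine) ^ 4 - 2 * (1 - zeta 9 ℚ_[3] KNine) ^ 5) * y,
    mul_mem (neg_mem theta_mem) hy, ?_⟩
  rw [hxy]
  linear_combination y * h6

/-- `𝓞` is a finitely generated `ℤ₃`-module (integral closure of a Noetherian integrally closed domain in a finite
separable extension). [cite: Katz1981CrystallineDieudonne, §5 (supporting lemma)] -/
theorem toSubmodule_fg : (Subalgebra.toSubmodule ONine).FG := by
  haveI : Module.Finite ℚ_[3] KNine := IsCyclotomicExtension.finite {9} ℚ_[3] KNine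
  haveI : Module.Finite ℤ_[3] ONine := IsIntegralClosure.finite ℤ_[3] ℚ_[3] KNine ONine
  exact (Submodule.fg_top _).mp Module.Finite.fg_top

/-- **`𝓞 = ℤ₃[ζ₉]`: the integral closure of `ℤ₃` in `ℚ₃(ζ₉)` is generated by `ζ₉`** (`𝓞 = ℤ₃[ζ₉] + 3𝓞` by the
digit expansion, `𝓞` finitely generated, `3` in the Jacobson radical of the local ring `ℤ₃`: Nakayama). The local
counterpart of Mathlib's `IsCyclotomicExtension.Rat.isIntegralClosure_adjoin_singleton_of_prime_pow`.
[cite: Katz1981CrystallineDieudonne, §5 (supporting lemma)] -/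
theorem integralClosure_eq_adjoin : ONine = Algebra.adjoin ℤ_[3] {zeta 9 ℚ_[3] KNine} := by
  refine le_antisymm ?_ adjoin_zeta_le
  have key : Subalgebra.toSubmodule ONine ≤ Subalgebra.toSubmodule (Algebra.adjoin ℤ_[3] {zeta 9 ℚ_[3] KNine}) := by
    refine Submodule.le_of_le_smul_of_le_jacobson_bot (I := IsLocalRing.maximalIdeal ℤ_[3]) toSubmodule_fg ?_ ?_
    · rw [IsLocalRing.jacobson_eq_maximalIdeal ⊥ bot_ne_top]
    · intro x hx
      obtain ⟨p, hp, y, hy, hxy⟩ := exists_mem_adjoin_add_three_mul x hx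
      rw [hxy]
      refine Submodule.add_mem_sup (show p ∈ Subalgebra.toSubmodule _ from hp) ?_
      have e3 : (3 : KNine) * y = (3 : ℤ_[3]) • y := by
        rw [Algebra.smul_def, IsScalarTower.algebraMap_apply ℤ_[3] ℚ_[3] KNine, map_ofNat, map_ofNat]
      rw [e3]
      refine Submodule.smul_mem_smul ?_ (show y ∈ Subalgebra.toSubmodule _ from hy)
      rw [PadicInt.maximalIdeal_eq_span_p]
      exact Ideal.mem_span_singleton_self _
  intro x hx
  exact key (show x ∈ Subalgebra.toSubmodule _ from hx)

/-- Hence every element of `𝓞` is a `ℤ₃`-polynomial in `ζ₉`. [cite: Katz1981CrystallineDieudonne, §5 (supporting lemma)] -/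
theorem exists_aeval_eq_of_mem {x : KNine} (hx : x ∈ ONine) :
    ∃ p : ℤ_[3][X], x = aeval (zeta 9 ℚ_[3] KNine) p := by
  have hx' : x ∈ Algebra.adjoin ℤ_[3] {zeta 9 ℚ_[3] KNine} := by rw [← integralClosure_eq_adjoin]; exact hx
  rw [Algebra.adjoin_singleton_eq_range_aeval] at hx'
  obtain ⟨p, hp⟩ := hx'
  exact ⟨p, hp.symm⟩

end Literature.NumberTheory.EllipticCurves.DescendedFrobenius.NineIntegers

end Part8

/-!
## Part 9 — port of `Summits/BirchSwinnertonDyer/BirchSwinnertonDyer/Theorems/CyclotomicUntwistKatzFrobeniusModVarpi.lean` (12 declarations kept)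

# Katz's Key Lemma modulo the uniformizer `ϖ = 1 − ζ₉` of `𝓞 = 𝓞_{ℚ₃(ζ₉)}` for the module with bounded denominators, and the Frobenius `φ : [f] ↦ [f(z³)]` on the second-kind classes of a good model

Declarations of this Part (verbatim port; each keeps its own docstring and citation): `pow_three_sub_pow_three`, `pow_three_dvd_pow_three_sub`, `pow_add_six_dvd_pow_three_sub`, `pow_dvd_pow_three_pow_succ_sub`, `natCast_dvd_three_mul_pow_sub_pow`, `isIntegral_three_pow_mul_mvCoeff_subst_sub_subst`, `exists_uniformizer`, `dvd_mvCoeff_pow_three_sub_expand`, `expand_subst_eq`, `subst_expand_eq`, `isIntegral_three_pow`, `coboundary_expand_three`.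

Reference keys (see `references.bib` and the declarations' citations): [Katz1981CrystallineDieudonne], [BerthelotOgus1983].
-/

section Part9

open _root_.PowerSeries Literature.NumberTheory.EllipticCurves.DescendedFrobenius
  Literature.NumberTheory.EllipticCurves.DescendedFrobenius.DescendedFrobeniusTransfer

namespace Literature.NumberTheory.EllipticCurves.DescendedFrobenius.KatzFrobenius

section Ring

variable {R : Type*} [CommRing R] {ϖ θ θ' u v : R}

/-- `u³ − v³ = (u − v)³ + 3uv(u − v)`. [cite: Katz1981CrystallineDieudonne, §5 Key Lemma 5.1.3] -/
theorem pow_three_sub_pow_three (u v : R) : u ^ 3 - v ^ 3 = (u - v) ^ 3 + 3 * u * v * (u - v) := by ring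

/-- `ϖ ∣ u − v` and `3 = ϖ⁶θ` ⟹ `ϖ³ ∣ u³ − v³`. [cite: Katz1981CrystallineDieudonne, §5 Key Lemma 5.1.3] -/
theorem pow_three_dvd_pow_three_sub (h3 : (3 : R) = ϖ ^ 6 * θ) (h : ϖ ∣ u - v) : ϖ ^ 3 ∣ u ^ 3 - v ^ 3 := by
  obtain ⟨c, hc⟩ := h
  rw [pow_three_sub_pow_three, hc, h3]
  exact ⟨c ^ 3 + ϖ ^ 4 * θ * u * v * c, by ring⟩

/-- `ϖʲ ∣ u − v` with `j ≥ 3` and `3 = ϖ⁶θ` ⟹ `ϖ^{j+6} ∣ u³ − v³`. [cite: Katz1981CrystallineDieudonne, §5 Key Lemma 5.1.3] -/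
theorem pow_add_six_dvd_pow_three_sub (h3 : (3 : R) = ϖ ^ 6 * θ) {j : ℕ} (hj : 3 ≤ j) (h : ϖ ^ j ∣ u - v) :
    ϖ ^ (j + 6) ∣ u ^ 3 - v ^ 3 := by
  obtain ⟨c, hc⟩ := h
  obtain ⟨i, rfl⟩ := Nat.exists_eq_add_of_le hj
  rw [pow_three_sub_pow_three, hc, h3]
  refine ⟨ϖ ^ (2 * i) * c ^ 3 + θ * u * v * c, ?_⟩
  ring

/-- **`ϖ^{6k+3} ∣ u^{3^{k+1}} − v^{3^{k+1}}`** when `ϖ ∣ u − v` and `3 = ϖ⁶θ` (induction: `3, 9, 15, 21, …`).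
[cite: Katz1981CrystallineDieudonne, §5 Key Lemma 5.1.3] -/
theorem pow_dvd_pow_three_pow_succ_sub (h3 : (3 : R) = ϖ ^ 6 * θ) (h : ϖ ∣ u - v) (k : ℕ) :
    ϖ ^ (6 * k + 3) ∣ u ^ 3 ^ (k + 1) - v ^ 3 ^ (k + 1) := by
  induction k with
  | zero => simpa using pow_three_dvd_pow_three_sub h3 h
  | succ k ih =>
    have e : ∀ w : R, w ^ 3 ^ (k + 1 + 1) = (w ^ 3 ^ (k + 1)) ^ 3 := fun w ↦ by rw [← pow_mul, ← pow_succ]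
    rw [e, e, show 6 * (k + 1) + 3 = (6 * k + 3) + 6 by ring]
    exact pow_add_six_dvd_pow_three_sub h3 (by omega) ih

/-- **`m ∣ 3·(uᵐ − vᵐ)`** for every `m`, when `ϖ ∣ u − v`, `3 = ϖ⁶θ` with `θθ' = 1`, and every natural number prime
to `3` is a unit of `R` (write `m = 3ᵏr`: `3ᵏ = ϖ^{6k}θᵏ` divides `3·ϖ^{6k−3}`). This is the bounded-denominator
substitute for Katz's `m·3 ∣ uᵐ − vᵐ` modulo a divided-power ideal. [cite: Katz1981CrystallineDieudonne, §5 Key Lemma 5.1.3] -/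
theorem natCast_dvd_three_mul_pow_sub_pow (h3 : (3 : R) = ϖ ^ 6 * θ) (hθ : θ * θ' = 1)
    (hunit : ∀ r : ℕ, ¬ 3 ∣ r → IsUnit (r : R)) (h : ϖ ∣ u - v) (m : ℕ) :
    (m : R) ∣ 3 * (u ^ m - v ^ m) := by
  rcases eq_or_ne m 0 with rfl | hm
  · simp
  obtain ⟨k, r, hr, rfl⟩ := Nat.exists_eq_pow_mul_and_not_dvd hm 3 (by norm_num)
  rw [Nat.cast_mul, Nat.cast_pow, Nat.cast_ofNat]
  refine (hunit r hr).mul_right_dvd.mpr ?_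
  rcases k with _ | k
  · simp
  -- `u^{3^{k+1}} − v^{3^{k+1}} ∣ uᵐ − vᵐ`
  have h1 : u ^ 3 ^ (k + 1) - v ^ 3 ^ (k + 1) ∣ u ^ (3 ^ (k + 1) * r) - v ^ (3 ^ (k + 1) * r) := by
    rw [pow_mul, pow_mul]; exact sub_dvd_pow_sub_pow _ _ r
  obtain ⟨D, hD⟩ := (pow_dvd_pow_three_pow_succ_sub h3 h k).trans h1
  rw [hD, h3]
  have hθk : θ ^ (k + 1) * θ' ^ k = θ := by
    rw [pow_succ', mul_assoc, ← mul_pow, hθ, one_pow, mul_one]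
  exact ⟨ϖ ^ 3 * θ' ^ k * D, by linear_combination (-(ϖ ^ (6 * k + 9) * D)) * hθk⟩

end Ring

/-- **Katz's Key Lemma 5.1.3 MODULO `ϖ`, for bounded denominators.** Let `3 = ϖ⁶θ` in `𝓞` with `θ` a unit, let
`f ∈ ℚ₃(ζ₉)⟦z⟧` satisfy `3ᵈ·n·[zⁿ]f ∈ 𝓞` for all `n` (`df` has bounded denominators), and let `U, V ∈ 𝓞⟦σ⟧` have no
constant term and satisfy `U ≡ V (mod ϖ𝓞⟦σ⟧)`. Then `3^{d+1}·(f(U) − f(V))` has `𝓞`-integral coefficients: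
`f(U) − f(V) = Σₘ fₘ(Uᵐ − Vᵐ)` and `m ∣ 3(Uᵐ − Vᵐ)` (§1) absorbs the denominator of `fₘ`.
[cite: Katz1981CrystallineDieudonne, §5 Key Lemma 5.1.3] -/
theorem isIntegral_three_pow_mul_mvCoeff_subst_sub_subst {σ : Type*} {ϖ θ θ' : ONine}
    (h3 : (3 : ONine) = ϖ ^ 6 * θ) (hθ : θ * θ' = 1) {f : KNine⟦X⟧} {d : ℕ}
    (hf : ∀ n : ℕ, IsIntegral ℤ_[3] ((3 : KNine) ^ d * ((n : KNine) * coeff n f)))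
    {U V : MvPowerSeries σ ONine} (hU0 : MvPowerSeries.constantCoeff U = 0) (hV0 : MvPowerSeries.constantCoeff V = 0)
    (hUV : MvPowerSeries.C ϖ ∣ U - V) (e : σ →₀ ℕ) :
    IsIntegral ℤ_[3] ((3 : KNine) ^ (d + 1) * MvPowerSeries.coeff e
      (f.subst (U.map (algebraMap ONine KNine)) - f.subst (V.map (algebraMap ONine KNine)))) := by
  have hU0' : MvPowerSeries.constantCoeff (U.map (algebraMap ONine KNine)) = 0 := by
    rw [MvPowerSeries.constantCoeff_map, hU0, map_zero]
  have hV0' : MvPowerSeries.constantCoeff (V.map (algebraMap ONine KNine)) = 0 := by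
    rw [MvPowerSeries.constantCoeff_map, hV0, map_zero]
  -- `3 = C ϖ ^ 6 * C θ` in `𝓞⟦σ⟧`
  have h3' : (3 : MvPowerSeries σ ONine) = MvPowerSeries.C ϖ ^ 6 * MvPowerSeries.C θ := by
    rw [← map_pow, ← map_mul, ← h3, map_ofNat]
  have hθC : MvPowerSeries.C θ * MvPowerSeries.C θ' = (1 : MvPowerSeries σ ONine) := by
    rw [← map_mul, hθ, map_one]
  rw [map_sub, mvCoeff_subst_eq_sum_ring hU0', mvCoeff_subst_eq_sum_ring hV0', ← Finset.sum_sub_distrib,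
    Finset.mul_sum]
  refine IsIntegral.sum _ fun m _ ↦ ?_
  rw [← mul_sub, ← map_pow, ← map_pow, MvPowerSeries.coeff_map, MvPowerSeries.coeff_map, ← map_sub, ← map_sub]
  obtain ⟨w, hw⟩ := natCast_dvd_three_mul_pow_sub_pow (R := MvPowerSeries σ ONine) h3' hθC
    (fun _ hr => isUnit_natCast_mvPowerSeries_ONine hr) hUV m
  -- `3^{d+1} f_m c(Uᵐ − Vᵐ) = (3^d m f_m) · c(w)`
  have hc : (3 : KNine) * algebraMap ONine KNine (MvPowerSeries.coeff e (U ^ m - V ^ m)) =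
      (m : KNine) * algebraMap ONine KNine (MvPowerSeries.coeff e w) := by
    have := congrArg (fun G ↦ algebraMap ONine KNine (MvPowerSeries.coeff e G)) hw
    rw [show (3 : MvPowerSeries σ ONine) = MvPowerSeries.C (3 : ONine) from (map_ofNat _ 3).symm,
      show ((m : ℕ) : MvPowerSeries σ ONine) = MvPowerSeries.C (m : ONine) from (map_natCast _ m).symm,
      MvPowerSeries.coeff_C_mul, MvPowerSeries.coeff_C_mul, map_mul, map_mul, map_natCast] at this
    rw [← this, map_ofNat]
  have e1 : (3 : KNine) ^ (d + 1) * (coeff m f * algebraMap ONine KNine (MvPowerSeries.coeff e (U ^ m - V ^ m))) =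
      ((3 : KNine) ^ d * ((m : KNine) * coeff m f)) * algebraMap ONine KNine (MvPowerSeries.coeff e w) := by
    rw [pow_succ, mul_assoc, ← mul_assoc (3 : KNine), mul_comm (3 : KNine) (coeff m f), mul_assoc (coeff m f), hc]
    ring
  rw [e1]
  exact (hf m).mul (MvPowerSeries.coeff e w).2

section Uniformizer

open _root_.IsCyclotomicExtension Literature.NumberTheory.EllipticCurves.DescendedFrobenius.NineIntegers

/-- **The uniformizer of `𝓞 = 𝓞_{ℚ₃(ζ₉)}`, packaged**: there are `ϖ (= 1 − ζ₉), θ, θ' ∈ 𝓞` with `3 = ϖ⁶θ`,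
`θθ' = 1`, such that every reduction map `ρ : 𝓞 → 𝔽₃` has kernel contained in `ϖ𝓞`, and `x³ ≡ x (mod ϖ)` for every
`x ∈ 𝓞` (the residue field is `𝔽₃`; g7 `NineIntegers.residueMap_eq_zero_iff`, g6
`three_eq_neg_pow_six_mul_thetaInv`). [cite: Katz1981CrystallineDieudonne, §5 Key Lemma 5.1.3] -/
theorem exists_uniformizer : ∃ ϖ θ θ' : ONine, (3 : ONine) = ϖ ^ 6 * θ ∧ θ * θ' = 1 ∧
    (∀ (ρ : ONine →+* ZMod 3) (x : ONine), ρ x = 0 → ϖ ∣ x) ∧ ∀ x : ONine, ϖ ∣ x ^ 3 - x := by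
  set ζ := zeta 9 ℚ_[3] KNine with hζdef
  refine ⟨⟨1 - ζ, one_sub_zeta_mem⟩, -⟨_, thetaInv_mem⟩, -⟨_, theta_mem⟩, ?_, ?_, ?_, ?_⟩
  · apply Subtype.ext
    push_cast
    rw [three_eq_neg_pow_six_mul_thetaInv zeta_spec]
    ring
  · rw [neg_mul_neg]
    apply Subtype.ext
    push_cast
    rw [mul_comm]
    exact theta_mul_thetaInv zeta_spec
  · intro ρ x hx
    obtain ⟨y, hy, h⟩ := (residueMap_eq_zero_iff ρ x).mp hx
    exact ⟨⟨y, hy⟩, Subtype.ext (by push_cast; exact h)⟩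
  · intro x
    obtain ⟨ρ⟩ := nonempty_residueMap
    have h0 : ρ (x ^ 3 - x) = 0 := by rw [map_sub, map_pow, ZMod.pow_card, sub_self]
    obtain ⟨y, hy, h⟩ := (residueMap_eq_zero_iff ρ _).mp h0
    exact ⟨⟨y, hy⟩, Subtype.ext (by push_cast at h ⊢; exact h)⟩

end Uniformizer

/-- **`G³ ≡ G(X³,Y³) (mod ϖ)` coefficientwise** for every `G ∈ 𝓞⟦σ⟧`: along a reduction map `ρ : 𝓞 → 𝔽₃` with
`ker ρ ⊆ (ϖ)` the two sides agree, as `x ↦ x³` is the identity of `𝔽₃` (Mathlib `MvPowerSeries.map_frobenius_expand`,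
`ZMod.frobenius_zmod`). [cite: BerthelotOgus1983, Thm. 2.4 (proof)] -/
theorem dvd_mvCoeff_pow_three_sub_expand {σ : Type*} {ϖ : ONine} (ρ : ONine →+* ZMod 3)
    (hker : ∀ x : ONine, ρ x = 0 → ϖ ∣ x) (G : MvPowerSeries σ ONine) (e : σ →₀ ℕ) :
    ϖ ∣ MvPowerSeries.coeff e (G ^ 3 - MvPowerSeries.expand 3 (by norm_num) G) := by
  apply hker
  have hfrob := MvPowerSeries.map_frobenius_expand 3 (by norm_num) (f := G.map ρ)
  simp only [ZMod.frobenius_zmod, MvPowerSeries.map_id, RingHom.id_apply] at hfrob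
  have h0 : (G ^ 3 - MvPowerSeries.expand 3 (by norm_num) G).map ρ = 0 := by
    rw [map_sub, map_pow, MvPowerSeries.map_expand, hfrob, sub_self]
  rw [← MvPowerSeries.coeff_map, h0, MvPowerSeries.coeff_zero]

/-- `(expand q f)(Γ) = f(Γ^q)` over any commutative ring. [cite: Katz1981CrystallineDieudonne, §5 Key Lemma 5.1.3] -/
theorem expand_subst_eq {S : Type*} [CommRing S] {τ : Type*} {Γ : MvPowerSeries τ S}
    (hΓ : MvPowerSeries.constantCoeff Γ = 0) (q : ℕ) (hq : q ≠ 0) (f : S⟦X⟧) :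
    (expand q hq f).subst Γ = f.subst (Γ ^ q) := by
  have hs : HasSubst Γ := HasSubst.of_constantCoeff_zero hΓ
  rw [expand_apply, subst_comp_subst_apply (PowerSeries.HasSubst.X_pow hq) hs, subst_pow hs, subst_X hs]

/-- `f(Γ(X^q)) = (f(Γ))(X^q)` over any commutative ring. [cite: Katz1981CrystallineDieudonne, §5 Key Lemma 5.1.3] -/
theorem subst_expand_eq {S : Type*} [CommRing S] {τ : Type*} {Γ : MvPowerSeries τ S}
    (hΓ : MvPowerSeries.constantCoeff Γ = 0) (q : ℕ) (hq : q ≠ 0) (f : S⟦X⟧) :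
    f.subst (MvPowerSeries.expand q hq Γ) = MvPowerSeries.expand q hq (f.subst Γ) := by
  have hs : HasSubst Γ := HasSubst.of_constantCoeff_zero hΓ
  rw [PowerSeries.subst, PowerSeries.subst, MvPowerSeries.expand_subst _ _ hs.const]

/-- `3ᵏ` is integral. [cite: Katz1981CrystallineDieudonne, §5 Key Lemma 5.1.3] -/
theorem isIntegral_three_pow (k : ℕ) : IsIntegral ℤ_[3] ((3 : KNine) ^ k) := by
  rw [show (3 : KNine) = algebraMap ℤ_[3] KNine 3 by rw [map_ofNat]]
  exact isIntegral_algebraMap.pow k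

/-- **`φ[f] := [f(z³)]` IS WELL DEFINED ON KATZ'S MODULE OF A WEIERSTRASS EQUATION OVER `𝓞`** (bounded-denominator
version of [Ka81, Thm. 5.1.4] for the lifting `z ↦ z³` of the relative Frobenius, which is a homomorphism of the
reduction modulo `ϖ = 1 − ζ₉` although `(ϖ)` carries no divided powers). Let `E/𝓞` be a Weierstrass equation,
`Ĝ` its formal group law read over `ℚ₃(ζ₉)`, and `f ∈ ℚ₃(ζ₉)⟦z⟧` with `3ᵈ·n·[zⁿ]f ∈ 𝓞` whose coboundary
`∂_Ĝ f = f(Ĝ) − f(X) − f(Y)` has `3^{d'}`-bounded denominators. Then the coboundary of `f(z³)` has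
`3^{d+1+d'}`-bounded denominators: `∂_Ĝ(f(z³)) = [f(Ĝ³) − f(Ĝ(X³,Y³))] + (∂_Ĝ f)(X³,Y³)` with `Ĝ³ ≡ Ĝ(X³,Y³) (mod ϖ)`
and the Key Lemma modulo `ϖ` (§2). [cite: Katz1981CrystallineDieudonne, §5 Thm 5.1.4]
[cite: BerthelotOgus1983, Thm. 2.4 (proof)] -/
theorem coboundary_expand_three {ϖ θ θ' : ONine} (h3 : (3 : ONine) = ϖ ^ 6 * θ) (hθ : θ * θ' = 1)
    (ρ : ONine →+* ZMod 3) (hker : ∀ x : ONine, ρ x = 0 → ϖ ∣ x) (E : WeierstrassCurve ONine)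
    {f : KNine⟦X⟧} {d : ℕ} (hf : ∀ n : ℕ, IsIntegral ℤ_[3] ((3 : KNine) ^ d * ((n : KNine) * coeff n f)))
    {d' : ℕ} (hcob : ∀ e, IsIntegral ℤ_[3] ((3 : KNine) ^ d' * MvPowerSeries.coeff e
      (f.subst (E.map (algebraMap ONine KNine)).formalGroupLaw - f.subst (MvPowerSeries.X 0) -
        f.subst (MvPowerSeries.X 1))))
    (e : Fin 2 →₀ ℕ) :
    IsIntegral ℤ_[3] ((3 : KNine) ^ (d + 1 + d') * MvPowerSeries.coeff e
      ((expand 3 (by norm_num) f).subst (E.map (algebraMap ONine KNine)).formalGroupLaw -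
        (expand 3 (by norm_num) f).subst (MvPowerSeries.X 0) - (expand 3 (by norm_num) f).subst (MvPowerSeries.X 1))) := by
  set ι := algebraMap ONine KNine with hι
  set GO := E.formalGroupLaw with hGO
  have hGK : (E.map ι).formalGroupLaw = GO.map ι := by rw [hGO, WeierstrassCurve.map_formalGroupLaw]
  have hG0 : MvPowerSeries.constantCoeff GO = 0 := E.constantCoeff_formalGroupLaw
  have hGK0 : MvPowerSeries.constantCoeff (GO.map ι) = 0 := by rw [MvPowerSeries.constantCoeff_map, hG0, map_zero]
  have hX0 : ∀ i : Fin 2, MvPowerSeries.constantCoeff (MvPowerSeries.X i : MvPowerSeries (Fin 2) KNine) = 0 :=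
    fun i ↦ MvPowerSeries.constantCoeff_X i
  -- (1) `GO³ ≡ GO(X³,Y³) (mod ϖ)`
  have hUV : MvPowerSeries.C ϖ ∣ GO ^ 3 - MvPowerSeries.expand 3 (by norm_num) GO := by
    choose c hc using dvd_mvCoeff_pow_three_sub_expand ρ hker GO
    refine ⟨fun e ↦ c e, MvPowerSeries.ext fun e ↦ ?_⟩
    rw [MvPowerSeries.coeff_C_mul]
    exact hc e
  -- (2) Key Lemma modulo `ϖ`
  have hkey := isIntegral_three_pow_mul_mvCoeff_subst_sub_subst h3 hθ hf
    (show MvPowerSeries.constantCoeff (GO ^ 3) = 0 by rw [map_pow, hG0, zero_pow (by norm_num)])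
    (show MvPowerSeries.constantCoeff (MvPowerSeries.expand 3 (by norm_num) GO) = 0 by
      rw [MvPowerSeries.constantCoeff_expand, hG0]) hUV e
  -- (3) decomposition of the coboundary of `f(z³)`
  have hdec : (expand 3 (by norm_num) f).subst (E.map ι).formalGroupLaw -
        (expand 3 (by norm_num) f).subst (MvPowerSeries.X 0) - (expand 3 (by norm_num) f).subst (MvPowerSeries.X 1) =
      (f.subst ((GO ^ 3).map ι) - f.subst ((MvPowerSeries.expand 3 (by norm_num) GO).map ι)) +
        MvPowerSeries.expand 3 (by norm_num)
          (f.subst (E.map ι).formalGroupLaw - f.subst (MvPowerSeries.X 0) - f.subst (MvPowerSeries.X 1)) := by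
    rw [hGK, expand_subst_eq hGK0, expand_subst_eq (hX0 0), expand_subst_eq (hX0 1), map_sub, map_sub,
      ← subst_expand_eq hGK0, ← subst_expand_eq (hX0 0), ← subst_expand_eq (hX0 1),
      MvPowerSeries.expand_X, MvPowerSeries.expand_X, map_pow, MvPowerSeries.map_expand]
    ring
  rw [hdec, map_add, mul_add]
  refine IsIntegral.add ?_ ?_
  · rw [pow_add, mul_comm ((3 : KNine) ^ (d + 1)), mul_assoc]
    exact (isIntegral_three_pow d').mul hkey
  · by_cases hd : ∀ i, 3 ∣ e i
    · choose m hm using hd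
      have em : e = 3 • (Finsupp.equivFunOnFinite.symm m : Fin 2 →₀ ℕ) := by
        ext i; simp [hm i]
      rw [em, MvPowerSeries.coeff_expand_smul, pow_add, mul_assoc]
      exact (isIntegral_three_pow (d + 1)).mul (hcob _)
    · obtain ⟨i, hi⟩ := not_forall.mp hd
      rw [MvPowerSeries.coeff_expand_of_not_dvd 3 (by norm_num) _ hi, mul_zero]
      exact isIntegral_zero

end Literature.NumberTheory.EllipticCurves.DescendedFrobenius.KatzFrobenius

end Part9

/-!
## Part 10 — port of `Summits/BirchSwinnertonDyer/BirchSwinnertonDyer/Theorems/CyclotomicUntwistFormalEndomorphismFrobenius.lean` (7 declarations kept)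

# Endomorphisms of the formal group of a Weierstrass curve — aec IV.4.3 in `η`-form (`h′·η = h′(0)·η(h)`) and, in characteristic `p`

Declarations of this Part (verbatim port; each keeps its own docstring and citation): `subst_X_self'`, `subst_zero_pair_eq_subst`, `derivative_mul_formalEta_of_hom`, `eq_expand_of_derivative_eq_zero`, `derivative_eq_zero_of_hom`, `pow_prime_eq_expand`, `exists_hom_expand_of_coeff_one_eq_zero`.

Reference keys (see `references.bib` and the declarations' citations): [SilvermanAEC2009], [Katz1981CrystallineDieudonne].
-/

section Part10

open _root_.PowerSeries Literature.NumberTheory.EllipticCurves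
open Literature.AlgebraicGeometry.Resolution (MvPowerSeries.pderiv MvPowerSeries.coeff_pderiv
  MvPowerSeries.pderiv_X MvPowerSeries.pderiv_C MvPowerSeries.pderiv_powerSeries_subst
  MvPowerSeries.pderiv_powerSeries_subst_X MvPowerSeries.pderiv_subst_pair)

namespace Literature.NumberTheory.EllipticCurves.DescendedFrobenius.FormalEndomorphism

/-! ## §1 AEC IV.4.3 for endomorphisms: `h′·η = h′(0)·η(h)` -/

section AnyRing

variable {R : Type*} [CommRing R] (W : WeierstrassCurve R)

omit W in
/-- `f(X) = f`. [cite: SilvermanAEC2009, IV.4.3] -/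
theorem subst_X_self' (f : R⟦X⟧) : f.subst (PowerSeries.X : R⟦X⟧) = f := by
  rw [← PowerSeries.map_algebraMap_eq_subst_X, Algebra.algebraMap_self, PowerSeries.map_id, id]

/-- `G(0, h(T)) = (G(0, T))(h(T))`: substituting `(0, h)` is substituting `(0, X)` and then `X ↦ h`. [cite: SilvermanAEC2009, IV.4.3] -/
theorem subst_zero_pair_eq_subst (G : MvPowerSeries (Fin 2) R) {h : R⟦X⟧} (hh : constantCoeff h = 0) :
    MvPowerSeries.subst ![(0 : R⟦X⟧), h] G =
      PowerSeries.subst h (MvPowerSeries.subst ![(0 : R⟦X⟧), PowerSeries.X] G) := by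
  have hs := WeierstrassCurve.hasSubst_zero_X (R := R)
  have hh' : PowerSeries.HasSubst h := PowerSeries.HasSubst.of_constantCoeff_zero' hh
  rw [PowerSeries.subst, MvPowerSeries.subst_comp_subst_apply hs hh'.const]
  congr 1
  funext i
  fin_cases i
  · simp only [Fin.zero_eta, Matrix.cons_val_zero]
    rw [← MvPowerSeries.coe_substAlgHom hh'.const, map_zero]
  · simp only [Fin.mk_one, Matrix.cons_val_one, Matrix.cons_val_zero]
    exact (PowerSeries.subst_X (R := R) hh').symm

/-- **AEC IV.4.3 for an endomorphism of `Ê`, `η`-form, over any commutative ring.** If `h ∈ R⟦X⟧`, `h(0) = 0`,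
satisfies `h(F(X,Y)) = F(h(X), h(Y))` for the chord–tangent law `F`, then `h′(X)·η(X) = h′(0)·η(h(X))` with
`η = F_X(0, X) = dX/ω` — i.e. `ω(h)·dh = h′(0)·ω`. Proof: `∂/∂X` of the identity and `X = 0`.
[cite: SilvermanAEC2009, IV.4.3] -/
theorem derivative_mul_formalEta_of_hom {h : R⟦X⟧} (hh0 : constantCoeff h = 0)
    (hh : h.subst W.formalGroupLaw =
      MvPowerSeries.subst ![h.subst (MvPowerSeries.X 0 : MvPowerSeries (Fin 2) R),
        h.subst (MvPowerSeries.X 1 : MvPowerSeries (Fin 2) R)] W.formalGroupLaw) :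
    d⁄dX R h * W.formalEta = PowerSeries.C (coeff 1 h) * W.formalEta.subst h := by
  classical
  set F := W.formalGroupLaw with hF
  have hF0 : MvPowerSeries.constantCoeff F = 0 := W.constantCoeff_formalGroupLaw
  have hA0 : MvPowerSeries.constantCoeff (h.subst (MvPowerSeries.X 0 : MvPowerSeries (Fin 2) R)) = 0 :=
    constantCoeff_powerSeries_subst_eq_zero (MvPowerSeries.constantCoeff_X 0) hh0
  have hB0 : MvPowerSeries.constantCoeff (h.subst (MvPowerSeries.X 1 : MvPowerSeries (Fin 2) R)) = 0 :=
    constantCoeff_powerSeries_subst_eq_zero (MvPowerSeries.constantCoeff_X 1) hh0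
  -- differentiate with respect to `X₀`
  have hd := congrArg (MvPowerSeries.pderiv 0) hh
  rw [MvPowerSeries.pderiv_powerSeries_subst hF0, MvPowerSeries.pderiv_subst_pair hA0 hB0,
    MvPowerSeries.pderiv_powerSeries_subst_X, MvPowerSeries.pderiv_powerSeries_subst_X, if_pos rfl,
    if_neg (by decide), mul_zero, add_zero] at hd
  -- put `X₀ = 0`, `X₁ = X`
  have hs := WeierstrassCurve.hasSubst_zero_X (R := R)
  have hT := congrArg (MvPowerSeries.subst ![(0 : R⟦X⟧), PowerSeries.X]) hd
  rw [MvPowerSeries.subst_mul hs, MvPowerSeries.subst_mul hs, mvSubst_powerSeries_subst W.hasSubst_formalGroupLaw hs,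
    W.formalGroupLaw_subst_zero_X, W.subst_zero_X_pderiv_formalGroupLaw, subst_X_self'] at hT
  -- `(d/dX h)(0) = coeff 1 h`
  have hc : (d⁄dX R h).constantCoeff = coeff 1 h := by
    rw [← coeff_zero_eq_constantCoeff_apply, coeff_derivative, zero_add, Nat.cast_zero, zero_add, mul_one]
  have hlast : MvPowerSeries.subst ![(0 : R⟦X⟧), PowerSeries.X]
      ((d⁄dX R h).subst (MvPowerSeries.X 0 : MvPowerSeries (Fin 2) R)) = PowerSeries.C (coeff 1 h) := by
    rw [mvSubst_powerSeries_subst (PowerSeries.HasSubst.X 0) hs, WeierstrassCurve.subst_zero_X_X_zero,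
      PowerSeries.subst_zero_eq_C_constantCoeff, hc, MvPowerSeries.map_C]
    rfl
  -- the pair `(h(X₀), h(X₁))` at `X₀ = 0`, `X₁ = X` is `(0, h)`
  have hpair : MvPowerSeries.subst ![(0 : R⟦X⟧), PowerSeries.X]
      (MvPowerSeries.subst ![h.subst (MvPowerSeries.X 0 : MvPowerSeries (Fin 2) R),
        h.subst (MvPowerSeries.X 1 : MvPowerSeries (Fin 2) R)] (MvPowerSeries.pderiv 0 F)) =
      W.formalEta.subst h := by
    rw [MvPowerSeries.subst_comp_subst_apply (WeierstrassCurve.hasSubst_pair hA0 hB0) hs,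
      ← W.subst_zero_X_pderiv_formalGroupLaw, ← subst_zero_pair_eq_subst _ hh0]
    congr 1
    funext i
    fin_cases i
    · simp only [Fin.zero_eta, Matrix.cons_val_zero]
      rw [mvSubst_powerSeries_subst (PowerSeries.HasSubst.X 0) hs, WeierstrassCurve.subst_zero_X_X_zero,
        PowerSeries.subst_zero_of_constantCoeff_zero hh0]
    · simp only [Fin.mk_one, Matrix.cons_val_one, Matrix.cons_val_zero]
      rw [mvSubst_powerSeries_subst (PowerSeries.HasSubst.X 1) hs, WeierstrassCurve.subst_zero_X_X_one,
        subst_X_self']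
  rw [hpair, hlast] at hT
  rw [hT]
  ring

end AnyRing

/-! ## §2 Characteristic `p`: `h′(0) = 0` forces `h = g(Xᵖ)` with `g` an endomorphism -/

section CharP

variable {p : ℕ} [hp : Fact p.Prime] (E : WeierstrassCurve (ZMod p))

omit E in
/-- In characteristic `p`, a series with zero derivative is a series in `Xᵖ`. [cite: SilvermanAEC2009, IV.4.3] -/
theorem eq_expand_of_derivative_eq_zero {f : (ZMod p)⟦X⟧} (hf : d⁄dX (ZMod p) f = 0) :
    f = expand p hp.out.ne_zero (PowerSeries.mk fun n ↦ coeff (p * n) f) := by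
  ext n
  rw [coeff_expand]
  split_ifs with h
  · obtain ⟨m, rfl⟩ := h
    rw [coeff_mk, Nat.mul_div_cancel_left m hp.out.pos]
  · -- `n` is prime to `p`, so `n · f_n = 0` forces `f_n = 0`
    rcases n with _ | k
    · exact absurd (dvd_zero p) h
    · have hk := congrArg (coeff k) hf
      rw [coeff_derivative, map_zero] at hk
      have hu : IsUnit ((k + 1 : ℕ) : ZMod p) := by
        rw [ZMod.isUnit_iff_coprime]
        exact (Nat.coprime_comm.mp ((Nat.Prime.coprime_iff_not_dvd hp.out).mpr h))
      have : coeff (k + 1) f * ((k : ZMod p) + 1) = 0 := by exact_mod_cast hk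
      rw [show ((k : ZMod p) + 1) = ((k + 1 : ℕ) : ZMod p) by push_cast; ring] at this
      exact (hu.mul_left_eq_zero).mp this

/-- **`h′(0) = 0` ⟹ `h′ = 0`** for an endomorphism in characteristic `p` (`h′η = h′(0)η(h)` and `η` is a unit).
[cite: SilvermanAEC2009, IV.4.3 and IV.7.4] -/
theorem derivative_eq_zero_of_hom {h : (ZMod p)⟦X⟧} (hh0 : constantCoeff h = 0)
    (hh : h.subst E.formalGroupLaw =
      MvPowerSeries.subst ![h.subst (MvPowerSeries.X 0 : MvPowerSeries (Fin 2) (ZMod p)),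
        h.subst (MvPowerSeries.X 1 : MvPowerSeries (Fin 2) (ZMod p))] E.formalGroupLaw)
    (h1 : coeff 1 h = 0) : d⁄dX (ZMod p) h = 0 := by
  have key := derivative_mul_formalEta_of_hom E hh0 hh
  rw [h1, map_zero, zero_mul] at key
  have hu : IsUnit E.formalEta := by
    rw [PowerSeries.isUnit_iff_constantCoeff, E.constantCoeff_formalEta]; exact isUnit_one
  exact (hu.mul_left_eq_zero).mp key

omit hp in
/-- Over `𝔽_p` the `p`-th power of a two-variable series is its expansion: `G(X,Y)ᵖ = G(Xᵖ,Yᵖ)`. [cite: SilvermanAEC2009, IV.4.3] -/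
theorem pow_prime_eq_expand [Fact p.Prime] (G : MvPowerSeries (Fin 2) (ZMod p)) :
    G ^ p = MvPowerSeries.expand p (Nat.Prime.ne_zero Fact.out) G := by
  have h := MvPowerSeries.map_frobenius_expand p (Nat.Prime.ne_zero Fact.out) (f := G)
  rw [ZMod.frobenius_zmod, MvPowerSeries.map_id] at h
  exact h.symm

/-- **`h′(0) = 0` ⟹ `h = g(Xᵖ)` with `g` again an endomorphism** (characteristic `p`, `F̄` defined over `𝔽_p`):
`h = g(Xᵖ)` by `derivative_eq_zero_of_hom`, and `g(F̄(X,Y))(Xᵖ,Yᵖ) = g(F̄(X,Y)ᵖ) = h(F̄) = F̄(h,h) =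
F̄(g,g)(Xᵖ,Yᵖ)`, so `g` is a homomorphism since `(X,Y) ↦ (Xᵖ,Yᵖ)` is injective on series. The digit map
`h ↦ h′(0)` on `End(F̄)` thus has kernel `π ∘ End(F̄)`, `π = Frobenius`. [cite: SilvermanAEC2009, IV.7 (Thm. 7.4, proof)]
[cite: Katz1981CrystallineDieudonne, §5.3] -/
theorem exists_hom_expand_of_coeff_one_eq_zero {h : (ZMod p)⟦X⟧} (hh0 : constantCoeff h = 0)
    (hh : h.subst E.formalGroupLaw =
      MvPowerSeries.subst ![h.subst (MvPowerSeries.X 0 : MvPowerSeries (Fin 2) (ZMod p)),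
        h.subst (MvPowerSeries.X 1 : MvPowerSeries (Fin 2) (ZMod p))] E.formalGroupLaw)
    (h1 : coeff 1 h = 0) :
    ∃ g : (ZMod p)⟦X⟧, constantCoeff g = 0 ∧ h = expand p hp.out.ne_zero g ∧
      g.subst E.formalGroupLaw =
        MvPowerSeries.subst ![g.subst (MvPowerSeries.X 0 : MvPowerSeries (Fin 2) (ZMod p)),
          g.subst (MvPowerSeries.X 1 : MvPowerSeries (Fin 2) (ZMod p))] E.formalGroupLaw := by
  classical
  set g : (ZMod p)⟦X⟧ := PowerSeries.mk fun n ↦ coeff (p * n) h with hgdef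
  have hg : h = expand p hp.out.ne_zero g := eq_expand_of_derivative_eq_zero (derivative_eq_zero_of_hom E hh0 hh h1)
  have hg0 : constantCoeff g = 0 := by
    rw [← coeff_zero_eq_constantCoeff_apply, hgdef, coeff_mk, mul_zero, coeff_zero_eq_constantCoeff_apply, hh0]
  refine ⟨g, hg0, hg, ?_⟩
  set F := E.formalGroupLaw with hF
  have hF0 : MvPowerSeries.constantCoeff F = 0 := E.constantCoeff_formalGroupLaw
  have hp0 : p ≠ 0 := hp.out.ne_zero
  have hgs : PowerSeries.HasSubst g := PowerSeries.HasSubst.of_constantCoeff_zero' hg0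
  have hX : ∀ i : Fin 2, MvPowerSeries.constantCoeff (MvPowerSeries.X i : MvPowerSeries (Fin 2) (ZMod p)) = 0 :=
    fun i ↦ MvPowerSeries.constantCoeff_X i
  -- both sides of the homomorphism identity for `h`, rewritten as expansions
  have hL : h.subst F = MvPowerSeries.expand p hp0 (g.subst F) := by
    rw [hg, Literature.NumberTheory.EllipticCurves.DescendedFrobenius.KatzFrobenius.expand_subst_eq hF0 p hp0,
      pow_prime_eq_expand, PowerSeries.subst, PowerSeries.subst,
      MvPowerSeries.expand_subst _ _ (PowerSeries.HasSubst.of_constantCoeff_zero hF0).const]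
  have hgi : ∀ i : Fin 2, h.subst (MvPowerSeries.X i : MvPowerSeries (Fin 2) (ZMod p)) =
      MvPowerSeries.expand p hp0 (g.subst (MvPowerSeries.X i : MvPowerSeries (Fin 2) (ZMod p))) := fun i ↦ by
    have e : (fun _ : Unit => (MvPowerSeries.X i : MvPowerSeries (Fin 2) (ZMod p)) ^ p) =
        fun _ : Unit => MvPowerSeries.expand p hp0 (MvPowerSeries.X i : MvPowerSeries (Fin 2) (ZMod p)) := by
      funext; rw [MvPowerSeries.expand_X]
    rw [hg, Literature.NumberTheory.EllipticCurves.DescendedFrobenius.KatzFrobenius.expand_subst_eq (hX i) p hp0,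
      PowerSeries.subst, PowerSeries.subst, e,
      MvPowerSeries.expand_subst _ _ (PowerSeries.HasSubst.X i).const]
  have hgA0 : MvPowerSeries.constantCoeff (g.subst (MvPowerSeries.X 0 : MvPowerSeries (Fin 2) (ZMod p))) = 0 :=
    constantCoeff_powerSeries_subst_eq_zero (hX 0) hg0
  have hgB0 : MvPowerSeries.constantCoeff (g.subst (MvPowerSeries.X 1 : MvPowerSeries (Fin 2) (ZMod p))) = 0 :=
    constantCoeff_powerSeries_subst_eq_zero (hX 1) hg0
  have hR : MvPowerSeries.subst ![h.subst (MvPowerSeries.X 0 : MvPowerSeries (Fin 2) (ZMod p)),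
        h.subst (MvPowerSeries.X 1 : MvPowerSeries (Fin 2) (ZMod p))] F =
      MvPowerSeries.expand p hp0 (MvPowerSeries.subst ![g.subst (MvPowerSeries.X 0 : MvPowerSeries (Fin 2) (ZMod p)),
        g.subst (MvPowerSeries.X 1 : MvPowerSeries (Fin 2) (ZMod p))] F) := by
    rw [hgi 0, hgi 1]
    have e2 : (![MvPowerSeries.expand p hp0 (g.subst (MvPowerSeries.X 0 : MvPowerSeries (Fin 2) (ZMod p))),
        MvPowerSeries.expand p hp0 (g.subst (MvPowerSeries.X 1 : MvPowerSeries (Fin 2) (ZMod p)))] :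
          Fin 2 → MvPowerSeries (Fin 2) (ZMod p)) =
        fun i => MvPowerSeries.expand p hp0 ((![g.subst (MvPowerSeries.X 0 : MvPowerSeries (Fin 2) (ZMod p)),
          g.subst (MvPowerSeries.X 1 : MvPowerSeries (Fin 2) (ZMod p))]) i) := by
      funext i; fin_cases i <;> rfl
    rw [e2, MvPowerSeries.expand_subst _ _ (WeierstrassCurve.hasSubst_pair hgA0 hgB0)]
  have key : MvPowerSeries.expand p hp0 (g.subst F) =
      MvPowerSeries.expand p hp0 (MvPowerSeries.subst ![g.subst (MvPowerSeries.X 0 : MvPowerSeries (Fin 2) (ZMod p)),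
        g.subst (MvPowerSeries.X 1 : MvPowerSeries (Fin 2) (ZMod p))] F) := by
    rw [← hL, ← hR]; exact hh
  -- `expand` is injective
  ext e
  have := congrArg (MvPowerSeries.coeff (p • e)) key
  rwa [MvPowerSeries.coeff_expand_smul, MvPowerSeries.coeff_expand_smul] at this

end CharP

end Literature.NumberTheory.EllipticCurves.DescendedFrobenius.FormalEndomorphism

end Part10

/-!
## Part 11 — port of `Summits/BirchSwinnertonDyer/BirchSwinnertonDyer/Theorems/CyclotomicUntwistFormalEndomorphismAlgebra.lean` (22 declarations kept)

# Endomorphisms of the formal group of a Weierstrass curve, I — the group law applied to series (associativity, commutativity, zero, inverse, interchange), linear coefficients, and the closure of `End(F)` under `⊕`, `i`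

Declarations of this Part (verbatim port; each keeps its own docstring and citation): `subst_subst_pair`, `subst_pair_subst`, `constantCoeff_subst_pair`, `subst_pair_comm`, `subst_pair_assoc`, `subst_pair_zero`, `subst_pair_formalNeg`, `eq_of_subst_pair_eq_zero`, `eq_subst_pair_formalNeg`, `subst_pair_subst_pair_comm`, `zero_subst`, `coeff_single_one_formalGroupLaw'`, `coeff_one_subst_pair`, `coeff_one_subst`, `constantCoeff_subst_X`, `hom_subst_pair`, `hom_pair`, `subst_X_pair_self`, `hom_formalNeg`, `hom_formalMul`, `hom_comp`, `formalMul_subst_hom`.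

Reference keys (see `references.bib` and the declarations' citations): [SilvermanAEC2009].
-/

section Part11

open _root_.PowerSeries Literature.NumberTheory.EllipticCurves Literature.NumberTheory.GaloisRepresentations

namespace Literature.NumberTheory.EllipticCurves.DescendedFrobenius.FormalEndomorphismAlgebra

/-! ## §1 The formal group law applied to series: associativity, commutativity, zero, inverse -/

section AnyRing

variable {R : Type*} [CommRing R] (W : WeierstrassCurve R)

/-- Substituting into `F(u, v)` substitutes into `u` and `v`. [cite: SilvermanAEC2009, IV.2.1] -/
theorem subst_subst_pair {σ τ : Type*} {u v : MvPowerSeries σ R}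
    (hu : MvPowerSeries.constantCoeff u = 0) (hv : MvPowerSeries.constantCoeff v = 0)
    {s : σ → MvPowerSeries τ R} (hs : MvPowerSeries.HasSubst s) :
    MvPowerSeries.subst s (MvPowerSeries.subst ![u, v] W.formalGroupLaw) =
      MvPowerSeries.subst ![MvPowerSeries.subst s u, MvPowerSeries.subst s v] W.formalGroupLaw := by
  rw [MvPowerSeries.subst_comp_subst_apply (WeierstrassCurve.hasSubst_pair hu hv) hs]
  congr 1
  funext i
  fin_cases i <;> rfl

/-- One-variable form: `F(u, v)(w) = F(u(w), v(w))`. [cite: SilvermanAEC2009, IV.2.1] -/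
theorem subst_pair_subst {τ : Type*} {u v : R⟦X⟧}
    (hu : constantCoeff u = 0) (hv : constantCoeff v = 0)
    {w : MvPowerSeries τ R} (hw : PowerSeries.HasSubst w) :
    PowerSeries.subst w (MvPowerSeries.subst ![u, v] W.formalGroupLaw) =
      MvPowerSeries.subst ![u.subst w, v.subst w] W.formalGroupLaw := by
  rw [PowerSeries.subst_def, subst_subst_pair W hu hv hw.const]
  rfl

/-- `F(u, v)` has no constant term. [cite: SilvermanAEC2009, IV.2.1] -/
theorem constantCoeff_subst_pair {σ : Type*} {u v : MvPowerSeries σ R}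
    (hu : MvPowerSeries.constantCoeff u = 0) (hv : MvPowerSeries.constantCoeff v = 0) :
    MvPowerSeries.constantCoeff (MvPowerSeries.subst ![u, v] W.formalGroupLaw) = 0 :=
  MvPowerSeries.constantCoeff_subst_eq_zero (WeierstrassCurve.hasSubst_pair hu hv)
    (fun k => by fin_cases k <;> assumption) W.constantCoeff_formalGroupLaw

/-- **Commutativity, applied**: `F(v, u) = F(u, v)`. [cite: SilvermanAEC2009, IV.2.1] -/
theorem subst_pair_comm {σ : Type*} {u v : MvPowerSeries σ R}
    (hu : MvPowerSeries.constantCoeff u = 0) (hv : MvPowerSeries.constantCoeff v = 0) :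
    MvPowerSeries.subst ![v, u] W.formalGroupLaw = MvPowerSeries.subst ![u, v] W.formalGroupLaw := by
  have hs := WeierstrassCurve.hasSubst_pair hu hv
  have h := congrArg (MvPowerSeries.subst ![u, v]) W.formalGroupLaw_comm'
  rw [subst_subst_pair W (MvPowerSeries.constantCoeff_X 1) (MvPowerSeries.constantCoeff_X 0) hs,
    MvPowerSeries.subst_X hs, MvPowerSeries.subst_X hs] at h
  exact h

/-- **Associativity, applied**: `F(F(u, v), w) = F(u, F(v, w))`. [cite: SilvermanAEC2009, IV.2.1] -/
theorem subst_pair_assoc {σ : Type*} {u v w : MvPowerSeries σ R}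
    (hu : MvPowerSeries.constantCoeff u = 0) (hv : MvPowerSeries.constantCoeff v = 0)
    (hw : MvPowerSeries.constantCoeff w = 0) :
    MvPowerSeries.subst ![MvPowerSeries.subst ![u, v] W.formalGroupLaw, w] W.formalGroupLaw =
      MvPowerSeries.subst ![u, MvPowerSeries.subst ![v, w] W.formalGroupLaw] W.formalGroupLaw := by
  have hs : MvPowerSeries.HasSubst ![u, v, w] :=
    MvPowerSeries.hasSubst_of_constantCoeff_zero fun k => by
      fin_cases k
      · exact hu
      · exact hv
      · exact hw
  have h := congrArg (MvPowerSeries.subst ![u, v, w]) W.formalGroupLaw_assoc'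
  rw [subst_subst_pair W (W.constantCoeff_subst_X_pair_formalGroupLaw 0 1) (MvPowerSeries.constantCoeff_X 2) hs,
    subst_subst_pair W (MvPowerSeries.constantCoeff_X 0) (MvPowerSeries.constantCoeff_X 1) hs,
    subst_subst_pair W (MvPowerSeries.constantCoeff_X 0) (W.constantCoeff_subst_X_pair_formalGroupLaw 1 2) hs,
    subst_subst_pair W (MvPowerSeries.constantCoeff_X 1) (MvPowerSeries.constantCoeff_X 2) hs,
    MvPowerSeries.subst_X hs, MvPowerSeries.subst_X hs, MvPowerSeries.subst_X hs] at h
  exact h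

/-- **Zero, applied**: `F(u, 0) = u`. [cite: SilvermanAEC2009, IV.2.1] -/
theorem subst_pair_zero {σ : Type*} {u : MvPowerSeries σ R} (hu : MvPowerSeries.constantCoeff u = 0) :
    MvPowerSeries.subst ![u, 0] W.formalGroupLaw = u := by
  have h0 : MvPowerSeries.constantCoeff (0 : MvPowerSeries σ R) = 0 := map_zero _
  rw [subst_pair_comm W h0 hu]
  exact W.formalGroupLaw_subst_zero (PowerSeries.HasSubst.of_constantCoeff_zero hu)

/-- **Inverse, applied**: `F(u, i(u)) = 0`. [cite: SilvermanAEC2009, IV.2.1] -/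
theorem subst_pair_formalNeg {σ : Type*} {u : MvPowerSeries σ R} (hu : MvPowerSeries.constantCoeff u = 0) :
    MvPowerSeries.subst ![u, W.formalNeg.subst u] W.formalGroupLaw = 0 := by
  have hw : PowerSeries.HasSubst u := PowerSeries.HasSubst.of_constantCoeff_zero hu
  have h := congrArg (PowerSeries.subst u) W.formalGroupLaw_subst_X_formalNeg'
  rw [subst_pair_subst W PowerSeries.constantCoeff_X W.constantCoeff_formalNeg hw, PowerSeries.subst_X hw] at h
  rw [h, ← PowerSeries.coe_substAlgHom hw, map_zero]

/-- **Uniqueness of the inverse**: `F(z, u) = 0 = F(z, v) ⟹ u = v`. [cite: SilvermanAEC2009, IV.2.1] -/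
theorem eq_of_subst_pair_eq_zero {σ : Type*} {z u v : MvPowerSeries σ R}
    (hz : MvPowerSeries.constantCoeff z = 0) (hu : MvPowerSeries.constantCoeff u = 0)
    (hv : MvPowerSeries.constantCoeff v = 0)
    (h1 : MvPowerSeries.subst ![z, u] W.formalGroupLaw = 0) (h2 : MvPowerSeries.subst ![z, v] W.formalGroupLaw = 0) :
    u = v := by
  calc u = MvPowerSeries.subst ![u, 0] W.formalGroupLaw := (subst_pair_zero W hu).symm
    _ = MvPowerSeries.subst ![u, MvPowerSeries.subst ![z, v] W.formalGroupLaw] W.formalGroupLaw := by rw [h2]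
    _ = MvPowerSeries.subst ![MvPowerSeries.subst ![u, z] W.formalGroupLaw, v] W.formalGroupLaw :=
        (subst_pair_assoc W hu hz hv).symm
    _ = MvPowerSeries.subst ![MvPowerSeries.subst ![z, u] W.formalGroupLaw, v] W.formalGroupLaw := by
        rw [subst_pair_comm W hz hu]
    _ = v := by rw [h1, W.formalGroupLaw_subst_zero (PowerSeries.HasSubst.of_constantCoeff_zero hv)]

/-- **Solving `F(x, y) = z` for `x`**: `x = F(z, i(y))`. [cite: SilvermanAEC2009, IV.2.1] -/
theorem eq_subst_pair_formalNeg {σ : Type*} {x y z : MvPowerSeries σ R}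
    (hx : MvPowerSeries.constantCoeff x = 0) (hy : MvPowerSeries.constantCoeff y = 0)
    (h : MvPowerSeries.subst ![x, y] W.formalGroupLaw = z) :
    x = MvPowerSeries.subst ![z, W.formalNeg.subst y] W.formalGroupLaw := by
  have hiy : MvPowerSeries.constantCoeff (W.formalNeg.subst y) = 0 :=
    PowerSeries.constantCoeff_subst_eq_zero hy _ W.constantCoeff_formalNeg
  rw [← h, subst_pair_assoc W hx hy hiy, subst_pair_formalNeg W hy, subst_pair_zero W hx]

/-- **The middle-four interchange**: `F(F(a, b), F(c, d)) = F(F(a, c), F(b, d))`. [cite: SilvermanAEC2009, IV.2.1] -/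
theorem subst_pair_subst_pair_comm {σ : Type*} {a b c d : MvPowerSeries σ R}
    (ha : MvPowerSeries.constantCoeff a = 0) (hb : MvPowerSeries.constantCoeff b = 0)
    (hc : MvPowerSeries.constantCoeff c = 0) (hd : MvPowerSeries.constantCoeff d = 0) :
    MvPowerSeries.subst ![MvPowerSeries.subst ![a, b] W.formalGroupLaw,
        MvPowerSeries.subst ![c, d] W.formalGroupLaw] W.formalGroupLaw =
      MvPowerSeries.subst ![MvPowerSeries.subst ![a, c] W.formalGroupLaw,
        MvPowerSeries.subst ![b, d] W.formalGroupLaw] W.formalGroupLaw := by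
  rw [subst_pair_assoc W ha hb (constantCoeff_subst_pair W hc hd),
    ← subst_pair_assoc W hb hc hd, subst_pair_comm W hc hb, subst_pair_assoc W hc hb hd,
    ← subst_pair_assoc W ha hc (constantCoeff_subst_pair W hb hd)]

/-- `0 ∘ a = 0`. [cite: SilvermanAEC2009, IV.2.1] -/
theorem zero_subst {τ : Type*} {S : Type*} [CommRing S] [Algebra R S] {a : MvPowerSeries τ S}
    (ha : PowerSeries.HasSubst a) : PowerSeries.subst a (0 : R⟦X⟧) = 0 := by
  rw [← PowerSeries.coe_substAlgHom ha, map_zero]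

/-! ### Linear coefficients -/

/-- `F ≡ X₀ + X₁ (mod deg 2)`: both linear coefficients of `F` are `1` (any ring). [cite: SilvermanAEC2009, IV.2.1] -/
theorem coeff_single_one_formalGroupLaw' (i : Fin 2) :
    MvPowerSeries.coeff (Finsupp.single i 1) W.formalGroupLaw = 1 := by
  have h1 : MvPowerSeries.coeff (Finsupp.single (1 : Fin 2) 1) W.formalGroupLaw = 1 := by
    rw [← coeff_subst_zero_X W.formalGroupLaw 1, W.formalGroupLaw_subst_zero_X, PowerSeries.coeff_one_X]
  fin_cases i
  · have hc := congrArg (MvPowerSeries.coeff (Finsupp.single (0 : Fin 2) 1)) W.formalGroupLaw_comm'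
    rw [LubinTate.coeff_single_subst (fun j => by fin_cases j <;> exact MvPowerSeries.constantCoeff_X _),
      Fin.sum_univ_two] at hc
    simp only [Matrix.cons_val_zero, Matrix.cons_val_one, MvPowerSeries.coeff_X,
      Finsupp.single_eq_single_iff] at hc
    simpa [h1] using hc.symm
  · exact h1

/-- **`F(u, v) = u + v + O(X²)`**: the linear coefficient is additive. [cite: SilvermanAEC2009, IV.2.1] -/
theorem coeff_one_subst_pair {u v : R⟦X⟧} (hu : constantCoeff u = 0) (hv : constantCoeff v = 0) :
    coeff 1 (MvPowerSeries.subst ![u, v] W.formalGroupLaw) = coeff 1 u + coeff 1 v := by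
  have h := LubinTate.coeff_single_subst (F := W.formalGroupLaw) (b := ![u, v])
    (fun j => by fin_cases j <;> assumption) ()
  rw [Fin.sum_univ_two, coeff_single_one_formalGroupLaw', coeff_single_one_formalGroupLaw', one_mul, one_mul] at h
  exact h

/-- The linear coefficient of a composite: `(u ∘ v)'(0) = u'(0) v'(0)`. [cite: SilvermanAEC2009, IV.2.1] -/
theorem coeff_one_subst {u v : R⟦X⟧} (hv : constantCoeff v = 0) :
    coeff 1 (u.subst v) = coeff 1 u * coeff 1 v := by
  have h := LubinTate.coeff_single_subst (F := u) (b := fun _ : Unit => v) (fun _ => hv) ()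
  rw [Fintype.sum_unique] at h
  rw [PowerSeries.subst_def]
  exact h

/-! ## §2 Endomorphisms: closure properties

An endomorphism of `F` is a series `h` with `h(0) = 0` and `h(F(X₀, X₁)) = F(h(X₀), h(X₁))`, written out
(no definition is introduced, as in `CyclotomicUntwistFormalEndomorphismFrobenius`). -/

/-- `h(Xᵢ)` has no constant term. [cite: SilvermanAEC2009, IV.2.1] -/
theorem constantCoeff_subst_X {σ : Type*} {h : R⟦X⟧} (hh0 : constantCoeff h = 0) (i : σ) :
    MvPowerSeries.constantCoeff (h.subst (MvPowerSeries.X i : MvPowerSeries σ R)) = 0 :=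
  PowerSeries.constantCoeff_subst_eq_zero (MvPowerSeries.constantCoeff_X i) _ hh0

/-- **An endomorphism is additive on all arguments**: `h(F(u, v)) = F(h(u), h(v))`. [cite: SilvermanAEC2009, IV.2.1] -/
theorem hom_subst_pair {h : R⟦X⟧} (hh0 : constantCoeff h = 0)
    (hh : h.subst W.formalGroupLaw =
      MvPowerSeries.subst ![h.subst (MvPowerSeries.X 0 : MvPowerSeries (Fin 2) R),
        h.subst (MvPowerSeries.X 1 : MvPowerSeries (Fin 2) R)] W.formalGroupLaw)
    {τ : Type*} {u v : MvPowerSeries τ R}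
    (hu : MvPowerSeries.constantCoeff u = 0) (hv : MvPowerSeries.constantCoeff v = 0) :
    h.subst (MvPowerSeries.subst ![u, v] W.formalGroupLaw) =
      MvPowerSeries.subst ![h.subst u, h.subst v] W.formalGroupLaw := by
  have hs := WeierstrassCurve.hasSubst_pair hu hv
  have e := congrArg (MvPowerSeries.subst ![u, v]) hh
  rw [mvSubst_powerSeries_subst W.hasSubst_formalGroupLaw hs,
    subst_subst_pair W (constantCoeff_subst_X hh0 0) (constantCoeff_subst_X hh0 1) hs,
    mvSubst_powerSeries_subst (PowerSeries.HasSubst.X 0) hs,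
    mvSubst_powerSeries_subst (PowerSeries.HasSubst.X 1) hs,
    MvPowerSeries.subst_X hs, MvPowerSeries.subst_X hs] at e
  exact e

/-- **The sum of two endomorphisms is an endomorphism.** [cite: SilvermanAEC2009, IV.2.1] -/
theorem hom_pair {u v : R⟦X⟧} (hu0 : constantCoeff u = 0)
    (hu : u.subst W.formalGroupLaw =
      MvPowerSeries.subst ![u.subst (MvPowerSeries.X 0 : MvPowerSeries (Fin 2) R),
        u.subst (MvPowerSeries.X 1 : MvPowerSeries (Fin 2) R)] W.formalGroupLaw)
    (hv0 : constantCoeff v = 0)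
    (hv : v.subst W.formalGroupLaw =
      MvPowerSeries.subst ![v.subst (MvPowerSeries.X 0 : MvPowerSeries (Fin 2) R),
        v.subst (MvPowerSeries.X 1 : MvPowerSeries (Fin 2) R)] W.formalGroupLaw) :
    PowerSeries.subst W.formalGroupLaw (MvPowerSeries.subst ![u, v] W.formalGroupLaw) =
      MvPowerSeries.subst ![PowerSeries.subst (MvPowerSeries.X 0 : MvPowerSeries (Fin 2) R)
          (MvPowerSeries.subst ![u, v] W.formalGroupLaw),
        PowerSeries.subst (MvPowerSeries.X 1 : MvPowerSeries (Fin 2) R)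
          (MvPowerSeries.subst ![u, v] W.formalGroupLaw)] W.formalGroupLaw := by
  rw [subst_pair_subst W hu0 hv0 W.hasSubst_formalGroupLaw, subst_pair_subst W hu0 hv0 (PowerSeries.HasSubst.X 0),
    subst_pair_subst W hu0 hv0 (PowerSeries.HasSubst.X 1), hu, hv]
  exact subst_pair_subst_pair_comm W (constantCoeff_subst_X hu0 0) (constantCoeff_subst_X hu0 1)
    (constantCoeff_subst_X hv0 0) (constantCoeff_subst_X hv0 1)

/-- `F(X₀, X₁) = F`. [cite: SilvermanAEC2009, IV.2.1] -/
theorem subst_X_pair_self :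
    MvPowerSeries.subst ![(MvPowerSeries.X 0 : MvPowerSeries (Fin 2) R), MvPowerSeries.X 1] W.formalGroupLaw =
      W.formalGroupLaw := by
  have e : (![(MvPowerSeries.X 0 : MvPowerSeries (Fin 2) R), MvPowerSeries.X 1]) = MvPowerSeries.X := by
    funext i; fin_cases i <;> rfl
  rw [e, MvPowerSeries.subst_self]
  rfl

/-- **The inverse `i` is an endomorphism** (any ring): both `i(F)` and `F(i(X₀), i(X₁))` are inverses of `F`.
[cite: SilvermanAEC2009, IV.2.3] -/
theorem hom_formalNeg :
    W.formalNeg.subst W.formalGroupLaw =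
      MvPowerSeries.subst ![W.formalNeg.subst (MvPowerSeries.X 0 : MvPowerSeries (Fin 2) R),
        W.formalNeg.subst (MvPowerSeries.X 1 : MvPowerSeries (Fin 2) R)] W.formalGroupLaw := by
  have hF0 := W.constantCoeff_formalGroupLaw
  have hi0 := W.constantCoeff_formalNeg
  refine eq_of_subst_pair_eq_zero W hF0 (PowerSeries.constantCoeff_subst_eq_zero hF0 _ hi0)
    (constantCoeff_subst_pair W (constantCoeff_subst_X hi0 0) (constantCoeff_subst_X hi0 1))
    (subst_pair_formalNeg W hF0) ?_
  conv_lhs => rw [show (![W.formalGroupLaw, MvPowerSeries.subst ![W.formalNeg.subst (MvPowerSeries.X 0 :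
      MvPowerSeries (Fin 2) R), W.formalNeg.subst (MvPowerSeries.X 1 : MvPowerSeries (Fin 2) R)] W.formalGroupLaw]) =
      ![MvPowerSeries.subst ![(MvPowerSeries.X 0 : MvPowerSeries (Fin 2) R), MvPowerSeries.X 1] W.formalGroupLaw,
        MvPowerSeries.subst ![W.formalNeg.subst (MvPowerSeries.X 0 : MvPowerSeries (Fin 2) R),
          W.formalNeg.subst (MvPowerSeries.X 1 : MvPowerSeries (Fin 2) R)] W.formalGroupLaw] by
      rw [subst_X_pair_self]]
  rw [subst_pair_subst_pair_comm W (MvPowerSeries.constantCoeff_X 0) (MvPowerSeries.constantCoeff_X 1)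
    (constantCoeff_subst_X hi0 0) (constantCoeff_subst_X hi0 1),
    subst_pair_formalNeg W (MvPowerSeries.constantCoeff_X 0), subst_pair_formalNeg W (MvPowerSeries.constantCoeff_X 1),
    subst_pair_zero W (map_zero _)]

/-- **`[n]` is an endomorphism** (any ring), by induction from `[n+1] = F(X, [n])`. [cite: SilvermanAEC2009, IV.2.3] -/
theorem hom_formalMul (n : ℕ) :
    (W.formalMul n).subst W.formalGroupLaw =
      MvPowerSeries.subst ![(W.formalMul n).subst (MvPowerSeries.X 0 : MvPowerSeries (Fin 2) R),
        (W.formalMul n).subst (MvPowerSeries.X 1 : MvPowerSeries (Fin 2) R)] W.formalGroupLaw := by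
  induction n with
  | zero =>
    rw [W.formalMul_zero, zero_subst W.hasSubst_formalGroupLaw, zero_subst (PowerSeries.HasSubst.X 0),
      zero_subst (PowerSeries.HasSubst.X 1), subst_pair_zero W (map_zero _)]
  | succ n ih =>
    have hn0 := W.constantCoeff_formalMul n
    rw [W.formalMul_succ'', subst_pair_subst W PowerSeries.constantCoeff_X hn0 W.hasSubst_formalGroupLaw,
      subst_pair_subst W PowerSeries.constantCoeff_X hn0 (PowerSeries.HasSubst.X 0),
      subst_pair_subst W PowerSeries.constantCoeff_X hn0 (PowerSeries.HasSubst.X 1),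
      PowerSeries.subst_X W.hasSubst_formalGroupLaw, PowerSeries.subst_X (PowerSeries.HasSubst.X 0),
      PowerSeries.subst_X (PowerSeries.HasSubst.X 1), ih]
    rw [show (![W.formalGroupLaw, MvPowerSeries.subst ![(W.formalMul n).subst (MvPowerSeries.X 0 :
        MvPowerSeries (Fin 2) R), (W.formalMul n).subst (MvPowerSeries.X 1 : MvPowerSeries (Fin 2) R)]
          W.formalGroupLaw] : Fin 2 → MvPowerSeries (Fin 2) R) =
        ![MvPowerSeries.subst ![(MvPowerSeries.X 0 : MvPowerSeries (Fin 2) R), MvPowerSeries.X 1] W.formalGroupLaw,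
          MvPowerSeries.subst ![(W.formalMul n).subst (MvPowerSeries.X 0 : MvPowerSeries (Fin 2) R),
            (W.formalMul n).subst (MvPowerSeries.X 1 : MvPowerSeries (Fin 2) R)] W.formalGroupLaw] by
      rw [subst_X_pair_self]]
    exact subst_pair_subst_pair_comm W (MvPowerSeries.constantCoeff_X 0) (MvPowerSeries.constantCoeff_X 1)
      (constantCoeff_subst_X hn0 0) (constantCoeff_subst_X hn0 1)

/-- **The composite of two endomorphisms is an endomorphism.** [cite: SilvermanAEC2009, IV.2.1] -/
theorem hom_comp {u v : R⟦X⟧} (hu0 : constantCoeff u = 0)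
    (hu : u.subst W.formalGroupLaw =
      MvPowerSeries.subst ![u.subst (MvPowerSeries.X 0 : MvPowerSeries (Fin 2) R),
        u.subst (MvPowerSeries.X 1 : MvPowerSeries (Fin 2) R)] W.formalGroupLaw)
    (hv0 : constantCoeff v = 0)
    (hv : v.subst W.formalGroupLaw =
      MvPowerSeries.subst ![v.subst (MvPowerSeries.X 0 : MvPowerSeries (Fin 2) R),
        v.subst (MvPowerSeries.X 1 : MvPowerSeries (Fin 2) R)] W.formalGroupLaw) :
    PowerSeries.subst W.formalGroupLaw (u.subst v) =
      MvPowerSeries.subst ![PowerSeries.subst (MvPowerSeries.X 0 : MvPowerSeries (Fin 2) R) (u.subst v),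
        PowerSeries.subst (MvPowerSeries.X 1 : MvPowerSeries (Fin 2) R) (u.subst v)] W.formalGroupLaw := by
  have hvs : PowerSeries.HasSubst v := PowerSeries.HasSubst.of_constantCoeff_zero' hv0
  rw [PowerSeries.subst_comp_subst_apply hvs W.hasSubst_formalGroupLaw,
    PowerSeries.subst_comp_subst_apply hvs (PowerSeries.HasSubst.X 0),
    PowerSeries.subst_comp_subst_apply hvs (PowerSeries.HasSubst.X 1), hv,
    hom_subst_pair W hu0 hu (constantCoeff_subst_X hv0 0) (constantCoeff_subst_X hv0 1)]

/-- **Endomorphisms commute with `[n]`**: `[n](h(X)) = h([n](X))`. [cite: SilvermanAEC2009, IV.2.3] -/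
theorem formalMul_subst_hom {h : R⟦X⟧} (hh0 : constantCoeff h = 0)
    (hh : h.subst W.formalGroupLaw =
      MvPowerSeries.subst ![h.subst (MvPowerSeries.X 0 : MvPowerSeries (Fin 2) R),
        h.subst (MvPowerSeries.X 1 : MvPowerSeries (Fin 2) R)] W.formalGroupLaw) (n : ℕ) :
    (W.formalMul n).subst h = h.subst (W.formalMul n) := by
  have hhs : PowerSeries.HasSubst h := PowerSeries.HasSubst.of_constantCoeff_zero' hh0
  induction n with
  | zero =>
    rw [W.formalMul_zero, PowerSeries.subst_zero_of_constantCoeff_zero hh0, zero_subst hhs]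
  | succ n ih =>
    rw [W.formalMul_succ'', subst_pair_subst W PowerSeries.constantCoeff_X (W.constantCoeff_formalMul n) hhs,
      PowerSeries.subst_X hhs, ih,
      hom_subst_pair W hh0 hh PowerSeries.constantCoeff_X (W.constantCoeff_formalMul n), PowerSeries.X_subst]

end AnyRing

end Literature.NumberTheory.EllipticCurves.DescendedFrobenius.FormalEndomorphismAlgebra

end Part11

/-!
## Part 12 — port of `Summits/BirchSwinnertonDyer/BirchSwinnertonDyer/Theorems/CyclotomicUntwistFormalEndomorphismDigits.lean` (11 declarations kept)

# Endomorphisms of the formal group, II — the digit expansion `h̄ = F̄(F̄([a_J](X), [b_J](Xᵖ)), [p^J](g_J))` in `End_{𝔽_p⟦X⟧}(F̄)` with `a_J → A`, `b_J → B` in `ℤ_p` (, Katz's rank `2` for a height-`2` formal group, in di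

Declarations of this Part (verbatim port; each keeps its own docstring and citation): `hom_X_pow`, `hom_expand`, `constantCoeff_expand'`, `expand_subst_pair`, `exists_digit`, `subst_expand'`, `expand_expand_eq`, `exists_two_digits`, `exists_digitExpansion`, `formalMul_prime_mul_expand`, `exists_hom_formalMul_subst_eq_X_pow_sq`.

Reference keys (see `references.bib` and the declarations' citations): [Katz1981CrystallineDieudonne], [SilvermanAEC2009].
-/

section Part12

open _root_.PowerSeries Literature.NumberTheory.EllipticCurves
  Literature.NumberTheory.EllipticCurves.DescendedFrobenius.FormalEndomorphismAlgebra

namespace Literature.NumberTheory.EllipticCurves.DescendedFrobenius.FormalEndomorphismDigits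

/-! ## §1 Frobenius `π = (X ↦ Xᵖ)` in characteristic `p` -/

section CharP

variable {p : ℕ} [hp : Fact p.Prime] (E : WeierstrassCurve (ZMod p))

/-- `X ↦ Xᵖ` is an endomorphism of `F̄` over `𝔽_p`: `F̄(X,Y)ᵖ = F̄(Xᵖ, Yᵖ)`. [cite: SilvermanAEC2009, IV.7 (proof of Thm. 7.4)] -/
theorem hom_X_pow :
    ((PowerSeries.X : (ZMod p)⟦X⟧) ^ p).subst E.formalGroupLaw =
      MvPowerSeries.subst ![((PowerSeries.X : (ZMod p)⟦X⟧) ^ p).subst (MvPowerSeries.X 0 : MvPowerSeries (Fin 2) (ZMod p)),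
        ((PowerSeries.X : (ZMod p)⟦X⟧) ^ p).subst (MvPowerSeries.X 1 : MvPowerSeries (Fin 2) (ZMod p))] E.formalGroupLaw := by
  have hp0 : p ≠ 0 := hp.out.ne_zero
  rw [PowerSeries.subst_pow E.hasSubst_formalGroupLaw, PowerSeries.subst_X E.hasSubst_formalGroupLaw,
    PowerSeries.subst_pow (PowerSeries.HasSubst.X 0), PowerSeries.subst_X (PowerSeries.HasSubst.X 0),
    PowerSeries.subst_pow (PowerSeries.HasSubst.X 1), PowerSeries.subst_X (PowerSeries.HasSubst.X 1),
    FormalEndomorphism.pow_prime_eq_expand, MvPowerSeries.expand, MvPowerSeries.substAlgHom_apply]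
  congr 1
  funext i
  fin_cases i <;> rfl

/-- `(expand p g) = g ∘ (X ↦ Xᵖ)` is an endomorphism if `g` is. [cite: Katz1981CrystallineDieudonne, §5.3] -/
theorem hom_expand {g : (ZMod p)⟦X⟧} (hg0 : constantCoeff g = 0)
    (hg : g.subst E.formalGroupLaw =
      MvPowerSeries.subst ![g.subst (MvPowerSeries.X 0 : MvPowerSeries (Fin 2) (ZMod p)),
        g.subst (MvPowerSeries.X 1 : MvPowerSeries (Fin 2) (ZMod p))] E.formalGroupLaw) :
    (expand p hp.out.ne_zero g).subst E.formalGroupLaw =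
      MvPowerSeries.subst ![(expand p hp.out.ne_zero g).subst (MvPowerSeries.X 0 : MvPowerSeries (Fin 2) (ZMod p)),
        (expand p hp.out.ne_zero g).subst (MvPowerSeries.X 1 : MvPowerSeries (Fin 2) (ZMod p))] E.formalGroupLaw := by
  have hXp : constantCoeff ((PowerSeries.X : (ZMod p)⟦X⟧) ^ p) = 0 := by
    rw [map_pow, PowerSeries.constantCoeff_X, zero_pow hp.out.ne_zero]
  rw [expand_apply]
  exact hom_comp E hg0 hg hXp (hom_X_pow E)

/-- `expand p 0 = 0` bookkeeping: `(expand p g)(0) = g(0)`. [cite: Katz1981CrystallineDieudonne, §5.3] -/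
theorem constantCoeff_expand' (g : (ZMod p)⟦X⟧) :
    constantCoeff (expand p hp.out.ne_zero g) = constantCoeff g :=
  PowerSeries.constantCoeff_expand p hp.out.ne_zero g

/-- `expand` passes inside `F̄(u, v)`: `F̄(u,v)(Xᵖ) = F̄(u(Xᵖ), v(Xᵖ))`. [cite: Katz1981CrystallineDieudonne, §5.3] -/
theorem expand_subst_pair {u v : (ZMod p)⟦X⟧} (hu : constantCoeff u = 0) (hv : constantCoeff v = 0) :
    expand p hp.out.ne_zero (MvPowerSeries.subst ![u, v] E.formalGroupLaw) =
      MvPowerSeries.subst ![expand p hp.out.ne_zero u, expand p hp.out.ne_zero v] E.formalGroupLaw := by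
  rw [expand_apply, expand_apply, expand_apply]
  exact subst_pair_subst E hu hv (PowerSeries.HasSubst.X_pow hp.out.ne_zero)

/-! ## §2 One digit: `h = [a] ⊕ g(Xᵖ)` with `a = h'(0)` and `g` an endomorphism -/

/-- **The first digit.** For an endomorphism `h` of `F̄` over `𝔽_p`, with `a := h'(0) ∈ {0,…,p−1}`:
`h = F̄([a], g(Xᵖ))` for an endomorphism `g` — since `h ⊖ [a]` is an endomorphism with vanishing linear
term, hence a series in `Xᵖ` (`FormalEndomorphism.exists_hom_expand_of_coeff_one_eq_zero`).
[cite: Katz1981CrystallineDieudonne, §5.3] [cite: SilvermanAEC2009, IV.7] -/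
theorem exists_digit {h : (ZMod p)⟦X⟧} (hh0 : constantCoeff h = 0)
    (hh : h.subst E.formalGroupLaw =
      MvPowerSeries.subst ![h.subst (MvPowerSeries.X 0 : MvPowerSeries (Fin 2) (ZMod p)),
        h.subst (MvPowerSeries.X 1 : MvPowerSeries (Fin 2) (ZMod p))] E.formalGroupLaw) :
    ∃ (a : ℕ) (g : (ZMod p)⟦X⟧), constantCoeff g = 0 ∧
      g.subst E.formalGroupLaw =
        MvPowerSeries.subst ![g.subst (MvPowerSeries.X 0 : MvPowerSeries (Fin 2) (ZMod p)),
          g.subst (MvPowerSeries.X 1 : MvPowerSeries (Fin 2) (ZMod p))] E.formalGroupLaw ∧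
      h = MvPowerSeries.subst ![E.formalMul a, expand p hp.out.ne_zero g] E.formalGroupLaw := by
  set a : ℕ := (coeff 1 h).val with ha
  -- `k := h ⊖ [a]`, `ia := i([a] X) = [a](i(X))`
  set ia : (ZMod p)⟦X⟧ := E.formalNeg.subst (E.formalMul a) with hia_def
  have has : PowerSeries.HasSubst (E.formalMul a) := PowerSeries.HasSubst.of_constantCoeff_zero' (E.constantCoeff_formalMul a)
  have hia0 : constantCoeff ia = 0 :=
    PowerSeries.constantCoeff_subst_eq_zero (E.constantCoeff_formalMul a) _ E.constantCoeff_formalNeg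
  have hia : PowerSeries.subst E.formalGroupLaw ia =
      MvPowerSeries.subst ![PowerSeries.subst (MvPowerSeries.X 0 : MvPowerSeries (Fin 2) (ZMod p)) ia,
        PowerSeries.subst (MvPowerSeries.X 1 : MvPowerSeries (Fin 2) (ZMod p)) ia] E.formalGroupLaw :=
    hom_comp E E.constantCoeff_formalNeg (hom_formalNeg E) (E.constantCoeff_formalMul a) (hom_formalMul E a)
  have hk0 : constantCoeff (MvPowerSeries.subst ![h, ia] E.formalGroupLaw) = 0 := constantCoeff_subst_pair E hh0 hia0
  have hk := hom_pair E hh0 hh hia0 hia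
  have hk1 : coeff 1 (MvPowerSeries.subst ![h, ia] E.formalGroupLaw) = 0 := by
    rw [coeff_one_subst_pair E hh0 hia0, hia_def, coeff_one_subst (E.constantCoeff_formalMul a), E.coeff_one_formalNeg,
      E.coeff_one_formalMul', ha, ZMod.natCast_zmod_val]
    ring
  obtain ⟨g, hg0, hkg, hg⟩ := FormalEndomorphism.exists_hom_expand_of_coeff_one_eq_zero E hk0 hk hk1
  refine ⟨a, g, hg0, hg, ?_⟩
  -- `h = F̄(k, i(i([a]))) = F̄(k, [a]) = F̄([a], k)`
  have hsol := eq_subst_pair_formalNeg E hh0 hia0 (z := MvPowerSeries.subst ![h, ia] E.formalGroupLaw) rfl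
  have hii : E.formalNeg.subst ia = E.formalMul a := by
    rw [hia_def, ← PowerSeries.subst_comp_subst_apply
      (PowerSeries.HasSubst.of_constantCoeff_zero' E.constantCoeff_formalNeg) has, E.formalNeg_subst_formalNeg_eq_X,
      PowerSeries.subst_X has]
  rw [hii, hkg] at hsol
  rw [hsol]
  exact subst_pair_comm E (E.constantCoeff_formalMul a) ((constantCoeff_expand' g).trans hg0)

/-! ## §3 Two digits and one factor `[p]`, granted `π² ∈ [p] ∘ End(F̄)`; the digit expansion -/

/-- `f ∘ (g(Xᵖ)) = (f ∘ g)(Xᵖ)`. [cite: Katz1981CrystallineDieudonne, §5.3] -/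
theorem subst_expand' (f : (ZMod p)⟦X⟧) {g : (ZMod p)⟦X⟧} (hg0 : constantCoeff g = 0) :
    f.subst (expand p hp.out.ne_zero g) = expand p hp.out.ne_zero (f.subst g) := by
  rw [expand_apply, expand_apply, ← PowerSeries.subst_comp_subst_apply
    (PowerSeries.HasSubst.of_constantCoeff_zero' hg0) (PowerSeries.HasSubst.X_pow hp.out.ne_zero)]

/-- **`g(X^{p²}) = [p](g(e))`** for an endomorphism `g`, when `[p] ∘ e = X^{p²}` (`π² = [p] ∘ e` in
`End(F̄)`: every endomorphism over `𝔽_p` commutes with `[p]` and with `π`). [cite: Katz1981CrystallineDieudonne, §5.3] -/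
theorem expand_expand_eq {e : (ZMod p)⟦X⟧} (he0 : constantCoeff e = 0)
    (hπ : (E.formalMul p).subst e = (PowerSeries.X : (ZMod p)⟦X⟧) ^ p ^ 2)
    {g : (ZMod p)⟦X⟧} (hg0 : constantCoeff g = 0)
    (hg : g.subst E.formalGroupLaw =
      MvPowerSeries.subst ![g.subst (MvPowerSeries.X 0 : MvPowerSeries (Fin 2) (ZMod p)),
        g.subst (MvPowerSeries.X 1 : MvPowerSeries (Fin 2) (ZMod p))] E.formalGroupLaw) :
    expand p hp.out.ne_zero (expand p hp.out.ne_zero g) = (E.formalMul p).subst (g.subst e) := by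
  have hp0 : p ≠ 0 := hp.out.ne_zero
  have hes : PowerSeries.HasSubst e := PowerSeries.HasSubst.of_constantCoeff_zero' he0
  have hgs : PowerSeries.HasSubst g := PowerSeries.HasSubst.of_constantCoeff_zero' hg0
  have hps : PowerSeries.HasSubst (E.formalMul p) := PowerSeries.HasSubst.of_constantCoeff_zero' (E.constantCoeff_formalMul p)
  rw [← expand_mul p hp0 p hp0, expand_apply, ← pow_two, ← hπ, ← PowerSeries.subst_comp_subst_apply hps hes,
    ← formalMul_subst_hom E hg0 hg p, PowerSeries.subst_comp_subst_apply hgs hes]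

/-- **Two digits and one factor `[p]`.** Granted `π² = [p] ∘ e` with `e ∈ End(F̄)`, every endomorphism `k`
is `F̄(F̄([a], [b](Xᵖ)), [p](k₁))` with `a, b ∈ ℕ` and `k₁` an endomorphism. [cite: Katz1981CrystallineDieudonne, §5.3] -/
theorem exists_two_digits {e : (ZMod p)⟦X⟧} (he0 : constantCoeff e = 0)
    (he : e.subst E.formalGroupLaw =
      MvPowerSeries.subst ![e.subst (MvPowerSeries.X 0 : MvPowerSeries (Fin 2) (ZMod p)),
        e.subst (MvPowerSeries.X 1 : MvPowerSeries (Fin 2) (ZMod p))] E.formalGroupLaw)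
    (hπ : (E.formalMul p).subst e = (PowerSeries.X : (ZMod p)⟦X⟧) ^ p ^ 2)
    {k : (ZMod p)⟦X⟧} (hk0 : constantCoeff k = 0)
    (hk : k.subst E.formalGroupLaw =
      MvPowerSeries.subst ![k.subst (MvPowerSeries.X 0 : MvPowerSeries (Fin 2) (ZMod p)),
        k.subst (MvPowerSeries.X 1 : MvPowerSeries (Fin 2) (ZMod p))] E.formalGroupLaw) :
    ∃ (a b : ℕ) (k₁ : (ZMod p)⟦X⟧), constantCoeff k₁ = 0 ∧
      k₁.subst E.formalGroupLaw =
        MvPowerSeries.subst ![k₁.subst (MvPowerSeries.X 0 : MvPowerSeries (Fin 2) (ZMod p)),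
          k₁.subst (MvPowerSeries.X 1 : MvPowerSeries (Fin 2) (ZMod p))] E.formalGroupLaw ∧
      k = MvPowerSeries.subst ![MvPowerSeries.subst ![E.formalMul a, expand p hp.out.ne_zero (E.formalMul b)]
        E.formalGroupLaw, (E.formalMul p).subst k₁] E.formalGroupLaw := by
  obtain ⟨a, g₁, hg₁0, hg₁, hk1⟩ := exists_digit E hk0 hk
  obtain ⟨b, g₂, hg₂0, hg₂, hk2⟩ := exists_digit E hg₁0 hg₁
  have hk₁0 : constantCoeff (g₂.subst e : (ZMod p)⟦X⟧) = 0 := PowerSeries.constantCoeff_subst_eq_zero he0 _ hg₂0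
  refine ⟨a, b, g₂.subst e, hk₁0, hom_comp E hg₂0 hg₂ he0 he, ?_⟩
  have hb0 := E.constantCoeff_formalMul b
  have heb0 : constantCoeff (expand p hp.out.ne_zero (E.formalMul b)) = 0 := (constantCoeff_expand' _).trans hb0
  have hpk0 : constantCoeff ((E.formalMul p).subst (g₂.subst e : (ZMod p)⟦X⟧)) = 0 :=
    PowerSeries.constantCoeff_subst_eq_zero hk₁0 _ (E.constantCoeff_formalMul p)
  rw [hk1, hk2, expand_subst_pair E hb0 ((constantCoeff_expand' _).trans hg₂0), expand_expand_eq E he0 hπ hg₂0 hg₂,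
    ← subst_pair_assoc E (E.constantCoeff_formalMul _) heb0 hpk0]

/-- **THE DIGIT EXPANSION of an endomorphism of `F̄`** (characteristic `p`, `π² ∈ [p] ∘ End(F̄)`): for every
endomorphism `h` there are digits `da db : ℕ → ℕ` and endomorphisms `g J` with, for EVERY `J`,
`h = F̄(F̄([∑_{j<J} pʲ·da j], [∑_{j<J} pʲ·db j](Xᵖ)), [p^J](g J))` — the partial sums are the truncations of two
`p`-adic integers `A = ∑ pʲ da j`, `B = ∑ pʲ db j` (`h̄ = [A] ⊕ [B]π` in `End(F̄) = ℤ_p[π]`, sequel file).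
[cite: Katz1981CrystallineDieudonne, §5.3] [cite: SilvermanAEC2009, IV.7.4] -/
theorem exists_digitExpansion {e : (ZMod p)⟦X⟧} (he0 : constantCoeff e = 0)
    (he : e.subst E.formalGroupLaw =
      MvPowerSeries.subst ![e.subst (MvPowerSeries.X 0 : MvPowerSeries (Fin 2) (ZMod p)),
        e.subst (MvPowerSeries.X 1 : MvPowerSeries (Fin 2) (ZMod p))] E.formalGroupLaw)
    (hπ : (E.formalMul p).subst e = (PowerSeries.X : (ZMod p)⟦X⟧) ^ p ^ 2)
    {h : (ZMod p)⟦X⟧} (hh0 : constantCoeff h = 0)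
    (hh : h.subst E.formalGroupLaw =
      MvPowerSeries.subst ![h.subst (MvPowerSeries.X 0 : MvPowerSeries (Fin 2) (ZMod p)),
        h.subst (MvPowerSeries.X 1 : MvPowerSeries (Fin 2) (ZMod p))] E.formalGroupLaw) :
    ∃ (da db : ℕ → ℕ) (g : ℕ → (ZMod p)⟦X⟧),
      (∀ J, constantCoeff (g J) = 0 ∧ (g J).subst E.formalGroupLaw =
        MvPowerSeries.subst ![(g J).subst (MvPowerSeries.X 0 : MvPowerSeries (Fin 2) (ZMod p)),
          (g J).subst (MvPowerSeries.X 1 : MvPowerSeries (Fin 2) (ZMod p))] E.formalGroupLaw) ∧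
      ∀ J, h = MvPowerSeries.subst ![MvPowerSeries.subst ![E.formalMul (∑ j ∈ Finset.range J, p ^ j * da j),
          expand p hp.out.ne_zero (E.formalMul (∑ j ∈ Finset.range J, p ^ j * db j))] E.formalGroupLaw,
        (E.formalMul (p ^ J)).subst (g J)] E.formalGroupLaw := by
  have hp0 : p ≠ 0 := hp.out.ne_zero
  -- the endomorphisms of `F̄`, as a subtype, and the two-digit step as a function on it
  let S := {k : (ZMod p)⟦X⟧ // constantCoeff k = 0 ∧ k.subst E.formalGroupLaw =
    MvPowerSeries.subst ![k.subst (MvPowerSeries.X 0 : MvPowerSeries (Fin 2) (ZMod p)),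
      k.subst (MvPowerSeries.X 1 : MvPowerSeries (Fin 2) (ZMod p))] E.formalGroupLaw}
  have step : ∀ k : S, ∃ t : ℕ × ℕ × S, (k : (ZMod p)⟦X⟧) =
      MvPowerSeries.subst ![MvPowerSeries.subst ![E.formalMul t.1, expand p hp0 (E.formalMul t.2.1)]
        E.formalGroupLaw, (E.formalMul p).subst (t.2.2 : (ZMod p)⟦X⟧)] E.formalGroupLaw := fun k => by
    obtain ⟨a, b, k₁, hk₁0, hk₁, hk⟩ := exists_two_digits E he0 he hπ k.2.1 k.2.2
    exact ⟨⟨a, b, ⟨k₁, hk₁0, hk₁⟩⟩, hk⟩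
  choose T hT using step
  let s : ℕ → S := fun J => Nat.rec ⟨h, hh0, hh⟩ (fun _ k => (T k).2.2) J
  have hs0 : (s 0).val = h := rfl
  have hsS : ∀ J, (s (J + 1)).val = ((T (s J)).2.2).val := fun J => rfl
  refine ⟨fun j => (T (s j)).1, fun j => (T (s j)).2.1, fun J => (s J).val, fun J => ⟨(s J).property.1, (s J).property.2⟩,
    fun J => ?_⟩
  induction J with
  | zero =>
    dsimp only
    rw [Finset.sum_range_zero, Finset.sum_range_zero, E.formalMul_zero, map_zero, pow_zero, E.formalMul_one, hs0,
      subst_pair_zero E (map_zero _), PowerSeries.subst_X (PowerSeries.HasSubst.of_constantCoeff_zero' hh0),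
      E.formalGroupLaw_subst_zero (PowerSeries.HasSubst.of_constantCoeff_zero' hh0)]
  | succ J ih =>
    dsimp only at ih ⊢
    rw [Finset.sum_range_succ, Finset.sum_range_succ, hsS J]
    -- the step at `s J`, then names for its digits
    have hstep := hT (s J)
    have hk₁0 : constantCoeff ((T (s J)).2.2).val = 0 := (T (s J)).2.2.property.1
    set a' : ℕ := (T (s J)).1 with ha'
    set b' : ℕ := (T (s J)).2.1 with hb'
    set k₁ : (ZMod p)⟦X⟧ := ((T (s J)).2.2).val with hk₁
    set A : ℕ := ∑ j ∈ Finset.range J, p ^ j * (T (s j)).1 with hA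
    set B : ℕ := ∑ j ∈ Finset.range J, p ^ j * (T (s j)).2.1 with hB
    -- constant terms
    have hPJ0 := E.constantCoeff_formalMul (p ^ J)
    have ha0 := E.constantCoeff_formalMul a'
    have hb0 := E.constantCoeff_formalMul b'
    have heb0 : constantCoeff (expand p hp0 (E.formalMul b')) = 0 := (constantCoeff_expand' _).trans hb0
    have hab0 := constantCoeff_subst_pair E ha0 heb0
    have hpk0 : constantCoeff ((E.formalMul p).subst k₁ : (ZMod p)⟦X⟧) = 0 :=
      PowerSeries.constantCoeff_subst_eq_zero hk₁0 _ (E.constantCoeff_formalMul p)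
    have hA0 := E.constantCoeff_formalMul A
    have hB0 := E.constantCoeff_formalMul B
    have heB0 : constantCoeff (expand p hp0 (E.formalMul B)) = 0 := (constantCoeff_expand' _).trans hB0
    have hPJa0 := E.constantCoeff_formalMul (p ^ J * a')
    have hPJb0 := E.constantCoeff_formalMul (p ^ J * b')
    have hePJb0 : constantCoeff (expand p hp0 (E.formalMul (p ^ J * b'))) = 0 := (constantCoeff_expand' _).trans hPJb0
    have hPk0 : constantCoeff ((E.formalMul (p ^ (J + 1))).subst k₁ : (ZMod p)⟦X⟧) = 0 :=
      PowerSeries.constantCoeff_subst_eq_zero hk₁0 _ (E.constantCoeff_formalMul _)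
    -- `[p^J] ∘ (step)`
    have hmul : (E.formalMul (p ^ J)).subst (s J).val =
        MvPowerSeries.subst ![MvPowerSeries.subst ![E.formalMul (p ^ J * a'),
          expand p hp0 (E.formalMul (p ^ J * b'))] E.formalGroupLaw, (E.formalMul (p ^ (J + 1))).subst k₁]
          E.formalGroupLaw := by
      rw [hstep, hom_subst_pair E hPJ0 (hom_formalMul E (p ^ J)) hab0 hpk0,
        hom_subst_pair E hPJ0 (hom_formalMul E (p ^ J)) ha0 heb0, E.formalMul_mul_subst',
        subst_expand' _ hb0, E.formalMul_mul_subst', pow_succ, ← E.formalMul_mul_subst' (p ^ J) p,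
        PowerSeries.subst_comp_subst_apply (PowerSeries.HasSubst.of_constantCoeff_zero' (E.constantCoeff_formalMul p))
          (PowerSeries.HasSubst.of_constantCoeff_zero' hk₁0)]
    rw [ih, hmul, ← subst_pair_assoc E (constantCoeff_subst_pair E hA0 heB0) (constantCoeff_subst_pair E hPJa0 hePJb0) hPk0,
      subst_pair_subst_pair_comm E hA0 heB0 hPJa0 hePJb0, ← E.formalMul_add', ← expand_subst_pair E hB0 hPJb0,
      ← E.formalMul_add']

end CharP

/-! ## §4 Supersingular fibres: `π² ∈ [p] ∘ End(F̄)` from the Frobenius identity `π² − [t]π + [p] = 0`, `p ∣ t` -/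

section Supersingular

variable {p : ℕ} [hp : Fact p.Prime] (V : WeierstrassCurve ℤ_[p]) [hE : (V.map PadicInt.Coe.ringHom).IsElliptic]
  [hEt : (V.map PadicInt.toZMod).IsElliptic]

/-- `[p·c](Xᵖ) = [p]([c](Xᵖ))`. [cite: Katz1981CrystallineDieudonne, §5.3] -/
theorem formalMul_prime_mul_expand (E : WeierstrassCurve (ZMod p)) (c : ℕ) :
    expand p hp.out.ne_zero (E.formalMul (p * c)) = (E.formalMul p).subst (expand p hp.out.ne_zero (E.formalMul c)) := by
  rw [← E.formalMul_mul_subst', subst_expand' _ (E.constantCoeff_formalMul c)]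

/-- **`π² ∈ [p] ∘ End(F̄)` on a fibre with `p ∣ t`** (`t = p + 1 − #Ẽ(𝔽_p)`; supersingular when `p ≥ 5`, and the
case of the principal-series rows at `p = 3`, `t ∈ {0, ±3}`): there is an endomorphism `e` of `F̄` with `[p](e(X)) = X^{p²}`
— namely `e = F̄([t/p](Xᵖ), i(X))` (resp. `F̄(i([|t|/p](Xᵖ)), i(X))`), read off from the tree's Frobenius identity
`F̄(X^{p²}, [p](X)) = [t](Xᵖ)` (`frobenius_formal_identity_of_nonneg'/_of_neg'`).
[cite: SilvermanAEC2009, Thm. V.2.3.1(b)] [cite: Katz1981CrystallineDieudonne, §5.3] -/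
theorem exists_hom_formalMul_subst_eq_X_pow_sq
    (hdvd : (p : ℤ) ∣ Literature.NumberTheory.EllipticCurves.HasseManin.tr (V.map PadicInt.toZMod)) :
    ∃ e : (ZMod p)⟦X⟧, constantCoeff e = 0 ∧
      e.subst (V.map PadicInt.toZMod).formalGroupLaw =
        MvPowerSeries.subst ![e.subst (MvPowerSeries.X 0 : MvPowerSeries (Fin 2) (ZMod p)),
          e.subst (MvPowerSeries.X 1 : MvPowerSeries (Fin 2) (ZMod p))] (V.map PadicInt.toZMod).formalGroupLaw ∧
      ((V.map PadicInt.toZMod).formalMul p).subst e = (PowerSeries.X : (ZMod p)⟦X⟧) ^ p ^ 2 := by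
  set E := V.map PadicInt.toZMod with hEdef
  set t := Literature.NumberTheory.EllipticCurves.HasseManin.tr (V.map PadicInt.toZMod) with htdef
  have hp0 : p ≠ 0 := hp.out.ne_zero
  have hX : constantCoeff (PowerSeries.X : (ZMod p)⟦X⟧) = 0 := PowerSeries.constantCoeff_X
  have hXp2 : constantCoeff ((PowerSeries.X : (ZMod p)⟦X⟧) ^ p ^ 2) = 0 := by
    rw [map_pow, hX, zero_pow (pow_ne_zero 2 hp0)]
  have hi0 := E.constantCoeff_formalNeg
  have hP0 := E.constantCoeff_formalMul p
  have hPs : PowerSeries.HasSubst (E.formalMul p) := PowerSeries.HasSubst.of_constantCoeff_zero' hP0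
  -- `[p] ∘ i = i ∘ [p]`
  have hPi : (E.formalMul p).subst E.formalNeg = E.formalNeg.subst (E.formalMul p) := formalMul_subst_hom E hi0 (hom_formalNeg E) p
  obtain ⟨c, hc⟩ : ∃ c : ℕ, t.natAbs = p * c := by
    obtain ⟨d, hd⟩ := hdvd
    refine ⟨d.natAbs, ?_⟩
    rw [hd, Int.natAbs_mul, Int.natAbs_natCast]
  have hc0 := E.constantCoeff_formalMul c
  have hec0 : constantCoeff (expand p hp0 (E.formalMul c)) = 0 := (constantCoeff_expand' _).trans hc0
  have hec : (expand p hp0 (E.formalMul c)).subst E.formalGroupLaw =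
      MvPowerSeries.subst ![(expand p hp0 (E.formalMul c)).subst (MvPowerSeries.X 0 : MvPowerSeries (Fin 2) (ZMod p)),
        (expand p hp0 (E.formalMul c)).subst (MvPowerSeries.X 1 : MvPowerSeries (Fin 2) (ZMod p))] E.formalGroupLaw :=
    hom_expand E hc0 (hom_formalMul E c)
  rcases le_or_gt 0 t with ht | ht
  · -- `F̄(X^{p²}, [p]) = [t](Xᵖ) = [p]([c](Xᵖ))`, so `X^{p²} = F̄([p]([c](Xᵖ)), i([p])) = [p](F̄([c](Xᵖ), i))`
    have hid := V.frobenius_formal_identity_of_nonneg' ht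
    rw [PowerSeries.X_subst, ← expand_apply p hp0, show t.toNat = p * c by rw [← Int.natAbs_of_nonneg ht]; exact hc,
      formalMul_prime_mul_expand] at hid
    have hsol := eq_subst_pair_formalNeg E hXp2 hP0 hid
    refine ⟨MvPowerSeries.subst ![expand p hp0 (E.formalMul c), E.formalNeg] E.formalGroupLaw,
      constantCoeff_subst_pair E hec0 hi0, hom_pair E hec0 hec hi0 (hom_formalNeg E), ?_⟩
    rw [hom_subst_pair E hP0 (hom_formalMul E p) hec0 hi0, hPi]
    exact hsol.symm
  · -- `F̄(X^{p²}, [p]) = i([|t|](Xᵖ)) = [p](i([c](Xᵖ)))`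
    have hid := V.frobenius_formal_identity_of_neg' ht
    rw [PowerSeries.X_subst, ← expand_apply p hp0, hc, formalMul_prime_mul_expand,
      ← PowerSeries.subst_comp_subst_apply hPs (PowerSeries.HasSubst.of_constantCoeff_zero' hec0), ← hPi,
      PowerSeries.subst_comp_subst_apply (PowerSeries.HasSubst.of_constantCoeff_zero' hi0)
        (PowerSeries.HasSubst.of_constantCoeff_zero' hec0)] at hid
    have hiec0 : constantCoeff (E.formalNeg.subst (expand p hp0 (E.formalMul c)) : (ZMod p)⟦X⟧) = 0 :=
      PowerSeries.constantCoeff_subst_eq_zero hec0 _ hi0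
    have hiec := hom_comp E hi0 (hom_formalNeg E) hec0 hec
    have hsol := eq_subst_pair_formalNeg E hXp2 hP0 hid
    refine ⟨MvPowerSeries.subst ![E.formalNeg.subst (expand p hp0 (E.formalMul c)), E.formalNeg] E.formalGroupLaw,
      constantCoeff_subst_pair E hiec0 hi0, hom_pair E hiec0 hiec hi0 (hom_formalNeg E), ?_⟩
    rw [hom_subst_pair E hP0 (hom_formalMul E p) hiec0 hi0, hPi]
    exact hsol.symm

end Supersingular

end Literature.NumberTheory.EllipticCurves.DescendedFrobenius.FormalEndomorphismDigits

end Part12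

/-!
## Part 13 — port of `Summits/BirchSwinnertonDyer/BirchSwinnertonDyer/Theorems/CyclotomicUntwistFormalLogBoundedIffDivisible.lean` (7 declarations kept)

# Lemma Λ: `log_V(γ)` has bounded denominators iff `p ∣ γ` — for a `p`-integral series `γ ∈ ℚ_p⟦σ⟧` without constant term and an elliptic curve `V/ℤ_p` with elliptic special fibre (`p` odd)

Declarations of this Part (verbatim port; each keeps its own docstring and citation): `constantCoeff_subst_mv`, `subst_ne_zero_of_ne_zero_mv`, `norm_p_pow_pred_le_norm_factorial`, `isPadicInt_inv_mul_formalExp_subst_smul`, `map_toZMod_eq_zero_of_isPadicInt_inv_mul`, `isPadicInt_inv_mul_of_map_toZMod_eq_zero`, `isPadicInt_inv_mul_of_isPadicInt_pow_mul_formalLog_subst`.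

Reference keys (see `references.bib` and the declarations' citations): [SilvermanAEC2009], [Katz1981CrystallineDieudonne].
-/

section Part13

open scoped _root_.Classical
open _root_.PowerSeries _root_.Nat _root_.WeierstrassCurve Literature.NumberTheory.EllipticCurves
  Literature.NumberTheory.EllipticCurves.DescendedFrobenius.DescendedFrobeniusTransfer

namespace Literature.NumberTheory.EllipticCurves.DescendedFrobenius.FormalLogDivisibility

/-- The constant coefficient of `f(g)` is `f(0)` when `g(0) = 0` (several variables). [cite: SilvermanAEC2009, IV.6.2] -/
theorem constantCoeff_subst_mv {k : Type*} [CommRing k] {σ : Type*} (f : k⟦X⟧) {g : MvPowerSeries σ k}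
    (hg0 : MvPowerSeries.constantCoeff g = 0) :
    MvPowerSeries.constantCoeff (f.subst g) = constantCoeff f := by
  rw [← MvPowerSeries.coeff_zero_eq_constantCoeff_apply, mvCoeff_subst_eq_sum_ring hg0 f 0]
  simp [coeff_zero_eq_constantCoeff]

/-- **`f(g) ≠ 0`** for `f ≠ 0` in one variable and `g ≠ 0` in several variables without constant term, over a ring
without zero divisors: `f = Xⁿ·f₁` with `f₁(0) ≠ 0`, so `f(g) = gⁿ·f₁(g)` with `f₁(g)(0) = f₁(0) ≠ 0`. [cite: SilvermanAEC2009, IV.6.2] -/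
theorem subst_ne_zero_of_ne_zero_mv {k : Type*} [CommRing k] [NoZeroDivisors k] {σ : Type*} {f : k⟦X⟧}
    (hf : f ≠ 0) {g : MvPowerSeries σ k} (hg0 : MvPowerSeries.constantCoeff g = 0) (hg : g ≠ 0) :
    f.subst g ≠ 0 := by
  have hs : HasSubst g := HasSubst.of_constantCoeff_zero hg0
  have hf' : f = X ^ f.order.toNat * divXPowOrder f := X_pow_order_mul_divXPowOrder.symm
  have hc : constantCoeff (divXPowOrder f) ≠ 0 := by
    rw [ne_eq, constantCoeff_divXPowOrder_eq_zero_iff]; exact hf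
  intro h
  rw [hf', subst_mul hs, subst_pow hs, subst_X hs] at h
  rcases mul_eq_zero.mp h with h1 | h2
  · exact hg (eq_zero_of_pow_eq_zero h1)
  · have := congrArg MvPowerSeries.constantCoeff h2
    rw [constantCoeff_subst_mv _ hg0, map_zero] at this
    exact hc this

section Curve

variable {p : ℕ} [hp : Fact p.Prime] (W : WeierstrassCurve ℚ_[p]) [hW : W.IsIntegral ℤ_[p]]

/-- `‖p^{n−1}‖ ≤ ‖n!‖` in `ℚ_p` for `n ≥ 1` (`v_p(n!) ≤ n − 1`, Legendre; AEC IV.6.2). [cite: SilvermanAEC2009, IV.6.2] -/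
theorem norm_p_pow_pred_le_norm_factorial {n : ℕ} (hn : n ≠ 0) :
    ‖(p : ℚ_[p]) ^ (n - 1)‖ ≤ ‖((n ! : ℕ) : ℚ_[p])‖ := by
  have hp1 : (1 : ℝ) < p := by exact_mod_cast hp.out.one_lt
  have hfact : ((n ! : ℕ) : ℚ_[p]) ≠ 0 := by exact_mod_cast (Nat.factorial_pos n).ne'
  have hv : padicValNat p n ! < n := padicValNat_factorial_lt_of_ne_zero p hn
  rw [Padic.norm_p_pow, Padic.norm_eq_zpow_neg_valuation hfact, Padic.valuation_natCast]
  exact zpow_le_zpow_right₀ hp1.le (by omega)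

/-- **`p⁻¹·exp_W(p·G) ∈ ℤ_p⟦σ⟧`** for an integral `G ∈ ℚ_p⟦σ⟧` without constant term: the `n`-th term of
`exp_W(pG) = Σ eₙ pⁿ Gⁿ` has norm `≤ p^{v_p(n!) − n} ≤ p⁻¹` for `n ≥ 1` (`‖n!·eₙ‖ ≤ 1`, AEC IV.6.3(b) with `v(p) = 1`,
`p` odd or not), and `e₀ = 0`. [cite: SilvermanAEC2009, IV.6.3] -/
theorem isPadicInt_inv_mul_formalExp_subst_smul {σ : Type*} {G : MvPowerSeries σ ℚ_[p]} (hG : IsPadicInt G)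
    (hG0 : MvPowerSeries.constantCoeff G = 0) :
    IsPadicInt (MvPowerSeries.C (p : ℚ_[p])⁻¹ * W.formalExp.subst ((p : ℚ_[p]) • G)) := by
  intro d
  have hpG : (p : ℚ_[p]) • G = MvPowerSeries.C (p : ℚ_[p]) * G := by
    rw [MvPowerSeries.smul_eq_C_mul]
  have hpG0 : MvPowerSeries.constantCoeff ((p : ℚ_[p]) • G) = 0 := by
    rw [hpG, map_mul, hG0, mul_zero]
  rw [MvPowerSeries.coeff_C_mul, mvCoeff_subst_eq_sum_ring hpG0, Finset.mul_sum]
  refine IsUltrametricDist.norm_sum_le_of_forall_le_of_nonneg zero_le_one fun n _ ↦ ?_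
  rcases Nat.eq_zero_or_pos n with rfl | hn
  · rw [coeff_zero_eq_constantCoeff, W.constantCoeff_formalExp, zero_mul, mul_zero, norm_zero]
    exact zero_le_one
  · have hpow : MvPowerSeries.coeff d (((p : ℚ_[p]) • G) ^ n) = (p : ℚ_[p]) ^ n * MvPowerSeries.coeff d (G ^ n) := by
      rw [smul_pow, MvPowerSeries.coeff_smul]
    rw [hpow]
    have e : (p : ℚ_[p])⁻¹ * (coeff n W.formalExp * ((p : ℚ_[p]) ^ n * MvPowerSeries.coeff d (G ^ n))) =
        ((p : ℚ_[p]) ^ (n - 1) * coeff n W.formalExp) * MvPowerSeries.coeff d (G ^ n) := by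
      have hp0 : (p : ℚ_[p]) ≠ 0 := by exact_mod_cast hp.out.ne_zero
      obtain ⟨k, rfl⟩ := Nat.exists_eq_succ_of_ne_zero hn.ne'
      rw [Nat.succ_sub_one, pow_succ]
      field_simp
    rw [e, norm_mul]
    have h1 : ‖(p : ℚ_[p]) ^ (n - 1) * coeff n W.formalExp‖ ≤ 1 := by
      calc ‖(p : ℚ_[p]) ^ (n - 1) * coeff n W.formalExp‖
          = ‖(p : ℚ_[p]) ^ (n - 1)‖ * ‖coeff n W.formalExp‖ := norm_mul _ _
        _ ≤ ‖((n ! : ℕ) : ℚ_[p])‖ * ‖coeff n W.formalExp‖ :=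
            mul_le_mul_of_nonneg_right (norm_p_pow_pred_le_norm_factorial hn.ne') (norm_nonneg _)
        _ = ‖((n ! : ℕ) : ℚ_[p]) * coeff n W.formalExp‖ := (norm_mul _ _).symm
        _ ≤ 1 := W.norm_factorial_mul_coeff_formalExp_le_one n
    have h2 : ‖MvPowerSeries.coeff d (G ^ n)‖ ≤ 1 := hG.pow n d
    calc _ ≤ 1 * 1 := mul_le_mul h1 h2 (norm_nonneg _) zero_le_one
      _ = 1 := mul_one _

end Curve

section Hard

variable {p : ℕ} [hp : Fact p.Prime] (V : WeierstrassCurve ℤ_[p])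
  [hE : (V.map PadicInt.Coe.ringHom).IsElliptic] [hEt : (V.map PadicInt.toZMod).IsElliptic]

/-- An integral series `F ∈ ℤ_p⟦σ⟧` with `p⁻¹·F` integral reduces to `0` modulo `p`. [cite: SilvermanAEC2009, IV.6.2] -/
theorem map_toZMod_eq_zero_of_isPadicInt_inv_mul {σ : Type*} (F : MvPowerSeries σ ℤ_[p])
    (h : IsPadicInt (MvPowerSeries.C (p : ℚ_[p])⁻¹ * F.map (PadicInt.Coe.ringHom (p := p)))) :
    F.map (PadicInt.toZMod (p := p)) = 0 := by
  have hp0 : (p : ℚ_[p]) ≠ 0 := by exact_mod_cast hp.out.ne_zero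
  have hp1 : (1 : ℝ) < p := by exact_mod_cast hp.out.one_lt
  ext d
  rw [MvPowerSeries.coeff_map, MvPowerSeries.coeff_zero, ← RingHom.mem_ker, PadicInt.ker_toZMod,
    IsLocalRing.mem_maximalIdeal, PadicInt.mem_nonunits]
  have hd := h d
  rw [MvPowerSeries.coeff_C_mul, MvPowerSeries.coeff_map, norm_mul, norm_inv, Padic.norm_p, inv_inv] at hd
  have hx : ‖(PadicInt.Coe.ringHom (p := p)) (MvPowerSeries.coeff d F)‖ ≤ (p : ℝ)⁻¹ := by
    have hppos : (0 : ℝ) < p := by positivity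
    calc ‖(PadicInt.Coe.ringHom (p := p)) (MvPowerSeries.coeff d F)‖
        = (p : ℝ)⁻¹ * ((p : ℝ) * ‖(PadicInt.Coe.ringHom (p := p)) (MvPowerSeries.coeff d F)‖) := by
          field_simp
      _ ≤ (p : ℝ)⁻¹ * 1 := by gcongr
      _ = (p : ℝ)⁻¹ := mul_one _
  calc ‖MvPowerSeries.coeff d F‖ = ‖(PadicInt.Coe.ringHom (p := p)) (MvPowerSeries.coeff d F)‖ := rfl
    _ ≤ (p : ℝ)⁻¹ := hx
    _ < 1 := inv_lt_one_of_one_lt₀ hp1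

/-- A series `F ∈ ℤ_p⟦σ⟧` reducing to `0` modulo `p` has `p⁻¹·F` integral. [cite: SilvermanAEC2009, IV.6.2] -/
theorem isPadicInt_inv_mul_of_map_toZMod_eq_zero {σ : Type*} (F : MvPowerSeries σ ℤ_[p])
    (h : F.map (PadicInt.toZMod (p := p)) = 0) :
    IsPadicInt (MvPowerSeries.C (p : ℚ_[p])⁻¹ * F.map (PadicInt.Coe.ringHom (p := p))) := by
  intro d
  have hd : PadicInt.toZMod (MvPowerSeries.coeff d F) = 0 := by
    have := congrArg (MvPowerSeries.coeff d) h
    rwa [MvPowerSeries.coeff_map, MvPowerSeries.coeff_zero] at this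
  rw [← RingHom.mem_ker, PadicInt.ker_toZMod, IsLocalRing.mem_maximalIdeal, PadicInt.mem_nonunits,
    PadicInt.norm_lt_one_iff_dvd] at hd
  obtain ⟨y, hy⟩ := hd
  have hp0 : (p : ℚ_[p]) ≠ 0 := by exact_mod_cast hp.out.ne_zero
  rw [MvPowerSeries.coeff_C_mul, MvPowerSeries.coeff_map, hy, map_mul, map_natCast, ← mul_assoc,
    inv_mul_cancel₀ hp0, one_mul]
  exact PadicInt.norm_le_one y

/-- **LEMMA Λ (hard half).** Let `V/ℤ_p` (`p` odd) have elliptic generic and special fibres, `ℓ = log_V`, and let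
`γ ∈ ℚ_p⟦σ⟧` be integral without constant term. If `pᵐ·ℓ(γ)` is integral for some `m`, then `p ∣ γ`, i.e. `p⁻¹·γ` is
integral: `[p^{m+1}](γ) = exp(p·pᵐℓ(γ)) ∈ pℤ_p⟦σ⟧` (§2, `exp ∘ ℓ = id`, `ℓ∘[N] = N·ℓ`), so `[p^{m+1}]˜(γ̄) = 0` over
`𝔽_p`, while `[p^{m+1}]˜ ≠ 0` (finite height) — hence `γ̄ = 0` (§1). [cite: SilvermanAEC2009, IV.6.3 and IV.7]
[cite: Katz1981CrystallineDieudonne, Thm. 5.3.3] -/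
theorem isPadicInt_inv_mul_of_isPadicInt_pow_mul_formalLog_subst (hp2 : p ≠ 2) {σ : Type*}
    {γ : MvPowerSeries σ ℚ_[p]} (hγ : IsPadicInt γ) (hγ0 : MvPowerSeries.constantCoeff γ = 0) {m : ℕ}
    (h : IsPadicInt (MvPowerSeries.C ((p : ℚ_[p]) ^ m) *
      (V.map PadicInt.Coe.ringHom).formalLog.subst γ)) :
    IsPadicInt (MvPowerSeries.C (p : ℚ_[p])⁻¹ * γ) := by
  set W := V.map (PadicInt.Coe.ringHom (p := p)) with hWdef
  haveI : W.IsIntegral ℤ_[p] := ⟨⟨V, rfl⟩⟩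
  set N : ℕ := p ^ (m + 1) with hN
  have hN0 : 0 < N := pow_pos hp.out.pos _
  have hp0 : (p : ℚ_[p]) ≠ 0 := by exact_mod_cast hp.out.ne_zero
  -- substitution data
  have hγs : HasSubst γ := HasSubst.of_constantCoeff_zero hγ0
  have hℓ0 : constantCoeff W.formalLog = 0 := W.constantCoeff_formalLog
  have hℓs : HasSubst W.formalLog := HasSubst.of_constantCoeff_zero' hℓ0
  have hM0 : constantCoeff (W.formalMul N) = 0 := W.constantCoeff_formalMul N
  have hMs : HasSubst (W.formalMul N) := HasSubst.of_constantCoeff_zero' hM0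
  -- `[N] = exp(N·ℓ)`
  have hMexp : W.formalMul N = W.formalExp.subst ((N : ℚ_[p]) • W.formalLog) := by
    have h1 := congrArg (PowerSeries.subst (W.formalMul N)) W.formalExp_subst_formalLog
    rw [subst_comp_subst_apply hℓs hMs, W.formalLog_subst_formalMul, subst_X hMs] at h1
    rw [← h1, nsmul_eq_mul, ← map_natCast (C (R := ℚ_[p])), ← smul_eq_C_mul]
  -- `[N](γ) = exp(p·G)`, `G = pᵐ·ℓ(γ)` integral
  set G : MvPowerSeries σ ℚ_[p] := MvPowerSeries.C ((p : ℚ_[p]) ^ m) * W.formalLog.subst γ with hGdef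
  have hℓγ0 : MvPowerSeries.constantCoeff (W.formalLog.subst γ) = 0 :=
    PowerSeries.constantCoeff_subst_eq_zero hγ0 _ hℓ0
  have hG0 : MvPowerSeries.constantCoeff G = 0 := by
    rw [hGdef, map_mul, hℓγ0, mul_zero]
  have hNℓs : HasSubst ((N : ℚ_[p]) • W.formalLog) := by
    refine HasSubst.of_constantCoeff_zero' ?_
    rw [smul_eq_C_mul, map_mul, hℓ0, mul_zero]
  have hMγ : (W.formalMul N).subst γ = W.formalExp.subst ((p : ℚ_[p]) • G) := by
    rw [hMexp, subst_comp_subst_apply hNℓs hγs, subst_smul hγs, hGdef, hN, pow_succ, Nat.cast_mul,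
      Nat.cast_pow, mul_comm ((p : ℚ_[p]) ^ m), ← smul_smul, MvPowerSeries.smul_eq_C_mul,
      MvPowerSeries.smul_eq_C_mul, MvPowerSeries.smul_eq_C_mul]
  have hint : IsPadicInt (MvPowerSeries.C (p : ℚ_[p])⁻¹ * (W.formalMul N).subst γ) := by
    rw [hMγ]; exact isPadicInt_inv_mul_formalExp_subst_smul W h hG0
  -- read over `ℤ_p` and reduce modulo `p`
  obtain ⟨γ₀, rfl⟩ := isPadicInt_iff_exists_map.mp hγ
  have hγ₀0 : MvPowerSeries.constantCoeff γ₀ = 0 := by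
    have : (PadicInt.Coe.ringHom (p := p)) (MvPowerSeries.constantCoeff γ₀) = 0 := by
      rwa [← MvPowerSeries.constantCoeff_map]
    exact PadicInt.coe_eq_zero.mp this
  have hγ₀s : HasSubst γ₀ := HasSubst.of_constantCoeff_zero hγ₀0
  have hP : ((V.formalMul N).subst γ₀).map (PadicInt.Coe.ringHom (p := p)) = (W.formalMul N).subst
      (γ₀.map (PadicInt.Coe.ringHom (p := p))) := by
    rw [PowerSeries.map_subst hγ₀s, V.map_formalMul]
  rw [← hP] at hint
  have hred := map_toZMod_eq_zero_of_isPadicInt_inv_mul _ hint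
  rw [PowerSeries.map_subst hγ₀s, V.map_formalMul] at hred
  -- `[N]˜ ≠ 0` and `𝔽_p⟦σ⟧` is a domain ⟹ `γ̄ = 0`
  have hFne : (V.map PadicInt.toZMod).formalMul N ≠ 0 := V.formalMul_map_toZMod_ne_zero hp2 hN0
  have hγbar0 : MvPowerSeries.constantCoeff (γ₀.map (PadicInt.toZMod (p := p))) = 0 := by
    rw [MvPowerSeries.constantCoeff_map, hγ₀0, map_zero]
  have hγbar : γ₀.map (PadicInt.toZMod (p := p)) = 0 := by
    by_contra hne
    exact subst_ne_zero_of_ne_zero_mv hFne hγbar0 hne hred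
  exact isPadicInt_inv_mul_of_map_toZMod_eq_zero γ₀ hγbar

end Hard

end Literature.NumberTheory.EllipticCurves.DescendedFrobenius.FormalLogDivisibility

end Part13

/-!
## Part 14 — port of `Summits/BirchSwinnertonDyer/BirchSwinnertonDyer/Theorems/CyclotomicUntwistPadicRankTwoAssembly.lean` (9 declarations kept)

# Rank `≤ 2` of Katz's Dieudonné module over `ℤ_p`, assembled from Honda's functional equation and the endomorphisms of the reduced formal group

Declarations of this Part (verbatim port; each keeps its own docstring and citation): `formalLog_subst_pair`, `eq_of_formalLog_subst_eq`, `norm_inv_mul_le_one_iff`, `isPadicInt_inv_mul_formalLog_subst_sub`, `isPadicInt_pair`, `constantCoeff_pair`, `isPadicInt_inv_mul_hom_defect`, `map_hom_defect`, `map_toZMod_subst_formalGroupLaw`.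

Reference keys (see `references.bib` and the declarations' citations): [SilvermanAEC2009], [Katz1981CrystallineDieudonne], [Honda1970].
-/

section Part14

open _root_.PowerSeries _root_.WeierstrassCurve Literature.NumberTheory.EllipticCurves Literature.RingTheory.FormalGroups

namespace Literature.NumberTheory.EllipticCurves.DescendedFrobenius.PadicRankTwoAssembly

variable {p : ℕ} [hp : Fact p.Prime]

section LogCalculus

variable (W : WeierstrassCurve ℚ_[p])

/-- `log_W(F(P, Q)) = log_W P + log_W Q` for series `P, Q` (any number of variables) without constant term.
[cite: SilvermanAEC2009, IV.5.2] -/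
theorem formalLog_subst_pair {τ : Type*} {P Q : MvPowerSeries τ ℚ_[p]} (hP : MvPowerSeries.constantCoeff P = 0)
    (hQ : MvPowerSeries.constantCoeff Q = 0) :
    W.formalLog.subst (MvPowerSeries.subst ![P, Q] W.formalGroupLaw) = W.formalLog.subst P + W.formalLog.subst Q := by
  have hS : MvPowerSeries.constantCoeff (W.formalLog.subst P + W.formalLog.subst Q) = 0 := by
    rw [map_add, constantCoeff_powerSeries_subst_eq_zero hP W.constantCoeff_formalLog,
      constantCoeff_powerSeries_subst_eq_zero hQ W.constantCoeff_formalLog, add_zero]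
  rw [W.subst_pair_formalGroupLaw_eq hP hQ, ← subst_comp_subst_apply
    (HasSubst.of_constantCoeff_zero' W.constantCoeff_formalExp) (HasSubst.of_constantCoeff_zero hS),
    W.formalLog_subst_formalExp, subst_X (HasSubst.of_constantCoeff_zero hS)]

/-- `log_W` is injective on series without constant term: `log_W Z₁ = log_W Z₂ ⟹ Z₁ = Z₂` (apply `exp_W`). [cite: SilvermanAEC2009, IV.5.2] -/
theorem eq_of_formalLog_subst_eq {τ : Type*} {Z₁ Z₂ : MvPowerSeries τ ℚ_[p]} (h₁ : MvPowerSeries.constantCoeff Z₁ = 0)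
    (h₂ : MvPowerSeries.constantCoeff Z₂ = 0) (h : W.formalLog.subst Z₁ = W.formalLog.subst Z₂) : Z₁ = Z₂ := by
  have e : ∀ {Z : MvPowerSeries τ ℚ_[p]}, MvPowerSeries.constantCoeff Z = 0 →
      W.formalExp.subst (W.formalLog.subst Z) = Z := fun {Z} hZ => by
    rw [← subst_comp_subst_apply (HasSubst.of_constantCoeff_zero' W.constantCoeff_formalLog)
      (HasSubst.of_constantCoeff_zero hZ), W.formalExp_subst_formalLog, subst_X (HasSubst.of_constantCoeff_zero hZ)]
  rw [← e h₁, h, e h₂]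

end LogCalculus

section Congruence

variable (W : WeierstrassCurve ℚ_[p]) [hW : W.IsIntegral ℤ_[p]]

/-- `‖p⁻¹·c‖ ≤ 1 ↔ ‖c‖ ≤ p⁻¹` in `ℚ_p`. [cite: SilvermanAEC2009, IV.5.2] -/
theorem norm_inv_mul_le_one_iff (c : ℚ_[p]) : ‖(p : ℚ_[p])⁻¹ * c‖ ≤ 1 ↔ ‖c‖ ≤ (p : ℝ)⁻¹ := by
  rw [norm_mul, norm_inv, Padic.norm_p, inv_inv, ← one_div, le_div_iff₀' (by exact_mod_cast hp.out.pos : (0 : ℝ) < p)]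

/-- **`log_W(h) ≡ log_W(h₁) (mod pℤ_p⟦X⟧)`** for `p`-integral `h ≡ h₁ (mod p)` without constant term
(`n·[Xⁿ]log_W ∈ ℤ_p` absorbs the denominators: `hᵐ − h₁ᵐ ∈ mpℤ_p⟦X⟧`).
[cite: Katz1981CrystallineDieudonne, §5 Key Lemma 5.1.3] [cite: Honda1970, Lemma 2.3] -/
theorem isPadicInt_inv_mul_formalLog_subst_sub {h h₁ : ℚ_[p]⟦X⟧} (h0 : constantCoeff h = 0)
    (hint : IsPadicInt h) (h₁0 : constantCoeff h₁ = 0) (hint₁ : IsPadicInt h₁)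
    (hc : IsPadicInt (C (p : ℚ_[p])⁻¹ * (h - h₁))) :
    IsPadicInt (C (p : ℚ_[p])⁻¹ * (W.formalLog.subst h - W.formalLog.subst h₁)) := by
  rw [isPadicInt_iff_coeff] at hint hint₁ hc ⊢
  intro n
  rw [coeff_C_mul, norm_inv_mul_le_one_iff]
  exact norm_coeff_subst_sub_subst_le_of_natCast_mul_coeff_le W.norm_natCast_mul_coeff_formalLog_le h0 hint
    h₁0 hint₁ (fun m => (norm_inv_mul_le_one_iff _).mp (by rw [← coeff_C_mul]; exact hc m)) n

end Congruence

/-- Both entries of a pair of integral series are integral. [cite: SilvermanAEC2009, IV.5.2] -/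
theorem isPadicInt_pair {τ : Type*} {a b : MvPowerSeries τ ℚ_[p]} (ha : IsPadicInt a) (hb : IsPadicInt b) :
    ∀ s : Fin 2, IsPadicInt (![a, b] s) := fun s => by
  fin_cases s <;> [exact ha; exact hb]

/-- Both entries of a pair of series without constant term have no constant term. [cite: SilvermanAEC2009, IV.5.2] -/
theorem constantCoeff_pair {R : Type*} [CommRing R] {τ : Type*} {a b : MvPowerSeries τ R}
    (ha : MvPowerSeries.constantCoeff a = 0) (hb : MvPowerSeries.constantCoeff b = 0) :
    ∀ s : Fin 2, MvPowerSeries.constantCoeff (![a, b] s) = 0 := fun s => by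
  fin_cases s <;> [exact ha; exact hb]

section Endomorphism

variable (V : WeierstrassCurve ℤ_[p]) [hE : (V.map PadicInt.Coe.ringHom).IsElliptic]
  [hEt : (V.map PadicInt.toZMod).IsElliptic]

/-- **If `log_W(h) = pᵏ·g` with `h ∈ Xℤ_p⟦X⟧` and `g` of the second kind (coboundary with bounded denominators),
then `h(F(X,Y)) ≡ F(h(X), h(Y)) (mod p)`** — i.e. `h̄` is an endomorphism of the reduced formal group. With
`u = h(F)`, `v = F(h(X),h(Y))` and the formal difference `γ = F(u, i(v))`: `log_W γ = log_W u − log_W v =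
pᵏ·(g(F) − g(X) − g(Y))` has bounded denominators, so `p ∣ γ` by Lemma Λ
(`FormalLogDivisibility.isPadicInt_inv_mul_of_isPadicInt_pow_mul_formalLog_subst`), and `u = F(γ, v) ≡ F(0, v) = v`.
[cite: Katz1981CrystallineDieudonne, §5 (5.1.3)–(5.3.3)] [cite: Honda1970, Thm. 2] -/
theorem isPadicInt_inv_mul_hom_defect (hp2 : p ≠ 2) {g h : ℚ_[p]⟦X⟧} (h0 : constantCoeff h = 0)
    (hint : IsPadicInt h) {k d' : ℕ}
    (hℓh : (V.map PadicInt.Coe.ringHom).formalLog.subst h = C ((p : ℚ_[p]) ^ k) * g)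
    (hcob : ∀ e : Fin 2 →₀ ℕ, ‖(p : ℚ_[p]) ^ d' * MvPowerSeries.coeff e
      (g.subst (V.map PadicInt.Coe.ringHom).formalGroupLaw - g.subst (MvPowerSeries.X 0) -
        g.subst (MvPowerSeries.X 1))‖ ≤ 1) :
    IsPadicInt (MvPowerSeries.C (p : ℚ_[p])⁻¹ *
      (h.subst (V.map PadicInt.Coe.ringHom).formalGroupLaw -
        MvPowerSeries.subst ![h.subst (MvPowerSeries.X 0 : MvPowerSeries (Fin 2) ℚ_[p]),
          h.subst (MvPowerSeries.X 1 : MvPowerSeries (Fin 2) ℚ_[p])] (V.map PadicInt.Coe.ringHom).formalGroupLaw)) := by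
  set W := V.map (PadicInt.Coe.ringHom (p := p)) with hWdef
  haveI : W.IsIntegral ℤ_[p] := ⟨⟨V, rfl⟩⟩
  set F := W.formalGroupLaw with hF
  set ℓ := W.formalLog with hℓ
  have hp0 : (p : ℚ_[p]) ≠ 0 := by exact_mod_cast hp.out.ne_zero
  have hF0 : MvPowerSeries.constantCoeff F = 0 := W.constantCoeff_formalGroupLaw
  have hFi : IsPadicInt F := W.isPadicInt_formalGroupLaw
  -- `g(0) = 0`
  have hg0 : constantCoeff g = 0 := by
    have := congrArg constantCoeff hℓh
    rw [Literature.RingTheory.FormalGroups.constantCoeff_subst_of_constantCoeff_eq_zero h0, map_mul,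
      constantCoeff_C] at this
    exact (mul_eq_zero.mp this.symm).resolve_left (pow_ne_zero _ hp0)
  -- the players `u = h(F)`, `v = F(h(X), h(Y))`, `i(v)`, `γ = F(u, i(v))`
  set u : MvPowerSeries (Fin 2) ℚ_[p] := h.subst F with hu
  have hu0 : MvPowerSeries.constantCoeff u = 0 := constantCoeff_powerSeries_subst_eq_zero hF0 h0
  have hui : IsPadicInt u := hint.powerSeries_subst hFi (HasSubst.of_constantCoeff_zero hF0)
  have hX0 : MvPowerSeries.constantCoeff (h.subst (MvPowerSeries.X 0 : MvPowerSeries (Fin 2) ℚ_[p])) = 0 :=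
    constantCoeff_powerSeries_subst_eq_zero (MvPowerSeries.constantCoeff_X 0) h0
  have hX1 : MvPowerSeries.constantCoeff (h.subst (MvPowerSeries.X 1 : MvPowerSeries (Fin 2) ℚ_[p])) = 0 :=
    constantCoeff_powerSeries_subst_eq_zero (MvPowerSeries.constantCoeff_X 1) h0
  have hX0i : IsPadicInt (h.subst (MvPowerSeries.X 0 : MvPowerSeries (Fin 2) ℚ_[p])) :=
    hint.powerSeries_subst (IsPadicInt.X 0) (HasSubst.of_constantCoeff_zero (MvPowerSeries.constantCoeff_X 0))
  have hX1i : IsPadicInt (h.subst (MvPowerSeries.X 1 : MvPowerSeries (Fin 2) ℚ_[p])) :=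
    hint.powerSeries_subst (IsPadicInt.X 1) (HasSubst.of_constantCoeff_zero (MvPowerSeries.constantCoeff_X 1))
  set v : MvPowerSeries (Fin 2) ℚ_[p] := MvPowerSeries.subst ![h.subst (MvPowerSeries.X 0 : MvPowerSeries (Fin 2) ℚ_[p]),
    h.subst (MvPowerSeries.X 1 : MvPowerSeries (Fin 2) ℚ_[p])] F with hv
  have hv0 : MvPowerSeries.constantCoeff v = 0 :=
    MvPowerSeries.constantCoeff_subst_eq_zero (hasSubst_pair hX0 hX1) (constantCoeff_pair hX0 hX1) hF0
  have hvi : IsPadicInt v := hFi.subst (isPadicInt_pair hX0i hX1i) (hasSubst_pair hX0 hX1)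
  set nv : MvPowerSeries (Fin 2) ℚ_[p] := W.formalNeg.subst v with hnv
  have hnv0 : MvPowerSeries.constantCoeff nv = 0 := constantCoeff_powerSeries_subst_eq_zero hv0 W.constantCoeff_formalNeg
  have hnvi : IsPadicInt nv := W.isPadicInt_formalNeg.powerSeries_subst hvi (HasSubst.of_constantCoeff_zero hv0)
  set γ : MvPowerSeries (Fin 2) ℚ_[p] := MvPowerSeries.subst ![u, nv] F with hγ
  have hγ0 : MvPowerSeries.constantCoeff γ = 0 :=
    MvPowerSeries.constantCoeff_subst_eq_zero (hasSubst_pair hu0 hnv0) (constantCoeff_pair hu0 hnv0) hF0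
  have hγi : IsPadicInt γ := hFi.subst (isPadicInt_pair hui hnvi) (hasSubst_pair hu0 hnv0)
  -- `log(h(Z)) = pᵏ g(Z)`
  have hℓhZ : ∀ {Z : MvPowerSeries (Fin 2) ℚ_[p]}, MvPowerSeries.constantCoeff Z = 0 →
      ℓ.subst (h.subst Z) = (p : ℚ_[p]) ^ k • g.subst Z := fun {Z} hZ => by
    rw [← subst_comp_subst_apply (HasSubst.of_constantCoeff_zero' h0) (HasSubst.of_constantCoeff_zero hZ), hℓh,
      ← smul_eq_C_mul, subst_smul (HasSubst.of_constantCoeff_zero hZ)]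
  -- `log γ = log u − log v = pᵏ·(coboundary of g)`
  have hℓv : ℓ.subst v = (p : ℚ_[p]) ^ k • (g.subst (MvPowerSeries.X 0 : MvPowerSeries (Fin 2) ℚ_[p]) +
      g.subst (MvPowerSeries.X 1 : MvPowerSeries (Fin 2) ℚ_[p])) := by
    rw [hv, formalLog_subst_pair W hX0 hX1, hℓhZ (MvPowerSeries.constantCoeff_X 0), hℓhZ (MvPowerSeries.constantCoeff_X 1),
      smul_add]
  have hℓnv : ℓ.subst nv = -ℓ.subst v := by
    rw [hnv, ← subst_comp_subst_apply (HasSubst.of_constantCoeff_zero' W.constantCoeff_formalNeg)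
      (HasSubst.of_constantCoeff_zero hv0), W.formalLog_subst_formalNeg, ← coe_substAlgHom
      (HasSubst.of_constantCoeff_zero hv0), map_neg]
  have hℓγ : ℓ.subst γ = (p : ℚ_[p]) ^ k • (g.subst F - g.subst (MvPowerSeries.X 0) - g.subst (MvPowerSeries.X 1)) := by
    rw [hγ, formalLog_subst_pair W hu0 hnv0, hℓnv, hu, hℓhZ hF0, hℓv, smul_sub, smul_sub, smul_add]
    ring
  -- Lemma Λ: `p ∣ γ`
  have hΛ : IsPadicInt (MvPowerSeries.C ((p : ℚ_[p]) ^ d') * ℓ.subst γ) := by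
    intro e
    rw [hℓγ, MvPowerSeries.smul_eq_C_mul, ← mul_assoc, ← map_mul, MvPowerSeries.coeff_C_mul,
      mul_comm ((p : ℚ_[p]) ^ d'), mul_assoc, norm_mul]
    have hpk : ‖(p : ℚ_[p]) ^ k‖ ≤ 1 := by
      rw [norm_pow, Padic.norm_p]
      exact pow_le_one₀ (by positivity) (inv_le_one_of_one_le₀ (by exact_mod_cast hp.out.one_le))
    exact mul_le_one₀ hpk (norm_nonneg _) (hcob e)
  have hpγ : IsPadicInt (MvPowerSeries.C (p : ℚ_[p])⁻¹ * γ) :=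
    FormalLogDivisibility.isPadicInt_inv_mul_of_isPadicInt_pow_mul_formalLog_subst V hp2 hγi hγ0 hΛ
  -- `u = F(γ, v)` and `v = F(0, v)` (compare logarithms)
  have huγ : u = MvPowerSeries.subst ![γ, v] F := by
    refine eq_of_formalLog_subst_eq W hu0 (MvPowerSeries.constantCoeff_subst_eq_zero (hasSubst_pair hγ0 hv0)
      (constantCoeff_pair hγ0 hv0) hF0) ?_
    rw [formalLog_subst_pair W hγ0 hv0, hγ, formalLog_subst_pair W hu0 hnv0, hℓnv]
    ring
  have hv' : v = MvPowerSeries.subst ![(0 : MvPowerSeries (Fin 2) ℚ_[p]), v] F := by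
    refine eq_of_formalLog_subst_eq W hv0 (MvPowerSeries.constantCoeff_subst_eq_zero (hasSubst_pair (map_zero _) hv0)
      (constantCoeff_pair (map_zero _) hv0) hF0) ?_
    rw [formalLog_subst_pair W (map_zero _) hv0, subst_zero_of_constantCoeff_zero W.constantCoeff_formalLog, zero_add]
  -- reduce modulo `p`: lift `γ, v` to `ℤ_p⟦X,Y⟧`
  obtain ⟨Γ, hΓ⟩ := isPadicInt_iff_exists_map.mp hγi
  obtain ⟨Vv, hVv⟩ := isPadicInt_iff_exists_map.mp hvi
  have hcc : ∀ {Z : MvPowerSeries (Fin 2) ℤ_[p]} {z : MvPowerSeries (Fin 2) ℚ_[p]}, Z.map PadicInt.Coe.ringHom = z →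
      MvPowerSeries.constantCoeff z = 0 → MvPowerSeries.constantCoeff Z = 0 := fun {Z z} hZ hz => by
    apply (PadicInt.coe_eq_zero).mp
    have := congrArg MvPowerSeries.constantCoeff hZ
    rwa [MvPowerSeries.constantCoeff_map, hz] at this
  have hΓ0 : MvPowerSeries.constantCoeff Γ = 0 := hcc hΓ hγ0
  have hVv0 : MvPowerSeries.constantCoeff Vv = 0 := hcc hVv hv0
  have hΓbar : Γ.map (PadicInt.toZMod (p := p)) = 0 :=
    FormalLogDivisibility.map_toZMod_eq_zero_of_isPadicInt_inv_mul Γ (by rw [hΓ]; exact hpγ)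
  set D : MvPowerSeries (Fin 2) ℤ_[p] := MvPowerSeries.subst ![Γ, Vv] V.formalGroupLaw -
    MvPowerSeries.subst ![0, Vv] V.formalGroupLaw with hD
  have hDmap : D.map (PadicInt.Coe.ringHom (p := p)) = u - v := by
    rw [hD, map_sub, map_subst_pair_formalGroupLaw V _ hΓ0 hVv0, map_subst_pair_formalGroupLaw V _ (map_zero _) hVv0,
      hΓ, hVv, map_zero, ← hWdef, ← hF, ← huγ, ← hv']
  have hDbar : D.map (PadicInt.toZMod (p := p)) = 0 := by
    rw [hD, map_sub, map_subst_pair_formalGroupLaw V _ hΓ0 hVv0, map_subst_pair_formalGroupLaw V _ (map_zero _) hVv0,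
      hΓbar, map_zero, sub_self]
  have := FormalLogDivisibility.isPadicInt_inv_mul_of_map_toZMod_eq_zero D hDbar
  rwa [hDmap] at this

/-- Pushing a ring map through the homomorphism defect `H(F(X,Y)) − F(H(X), H(Y))`. [cite: SilvermanAEC2009, IV.5.2] -/
theorem map_hom_defect {R S : Type*} [CommRing R] [CommRing S] (U : WeierstrassCurve R) (φ : R →+* S)
    {H : R⟦X⟧} (hH0 : constantCoeff H = 0) :
    MvPowerSeries.map φ (H.subst U.formalGroupLaw -
      MvPowerSeries.subst ![H.subst (MvPowerSeries.X 0 : MvPowerSeries (Fin 2) R),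
        H.subst (MvPowerSeries.X 1 : MvPowerSeries (Fin 2) R)] U.formalGroupLaw) =
      (H.map φ).subst (U.map φ).formalGroupLaw -
        MvPowerSeries.subst ![(H.map φ).subst (MvPowerSeries.X 0 : MvPowerSeries (Fin 2) S),
          (H.map φ).subst (MvPowerSeries.X 1 : MvPowerSeries (Fin 2) S)] (U.map φ).formalGroupLaw := by
  have hHX : ∀ i : Fin 2, MvPowerSeries.constantCoeff (H.subst (MvPowerSeries.X i : MvPowerSeries (Fin 2) R)) = 0 :=
    fun i => constantCoeff_powerSeries_subst_eq_zero (MvPowerSeries.constantCoeff_X i) hH0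
  have hmapX : ∀ i : Fin 2, MvPowerSeries.map φ (H.subst (MvPowerSeries.X i : MvPowerSeries (Fin 2) R)) =
      (H.map φ).subst (MvPowerSeries.X i : MvPowerSeries (Fin 2) S) := fun i => by
    rw [PowerSeries.map_subst (HasSubst.of_constantCoeff_zero (MvPowerSeries.constantCoeff_X i)), MvPowerSeries.map_X]
  rw [map_sub, PowerSeries.map_subst U.hasSubst_formalGroupLaw, map_formalGroupLaw,
    map_subst_pair_formalGroupLaw U φ (hHX 0) (hHX 1), hmapX 0, hmapX 1]

/-- **The endomorphism, in characteristic `p`.** Under the hypotheses of `isPadicInt_inv_mul_hom_defect`, the reduction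
`h̄ ∈ 𝔽_p⟦X⟧` of `h = H ⊗ ℚ_p` satisfies `h̄(F̄(X,Y)) = F̄(h̄(X), h̄(Y))` for the reduced formal group law `F̄` of
`V ⊗ 𝔽_p`. [cite: Katz1981CrystallineDieudonne, §5] -/
theorem map_toZMod_subst_formalGroupLaw (hp2 : p ≠ 2) {g : ℚ_[p]⟦X⟧} {H : ℤ_[p]⟦X⟧} (hH0 : constantCoeff H = 0)
    {k d' : ℕ}
    (hℓh : (V.map PadicInt.Coe.ringHom).formalLog.subst (H.map PadicInt.Coe.ringHom) = C ((p : ℚ_[p]) ^ k) * g)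
    (hcob : ∀ e : Fin 2 →₀ ℕ, ‖(p : ℚ_[p]) ^ d' * MvPowerSeries.coeff e
      (g.subst (V.map PadicInt.Coe.ringHom).formalGroupLaw - g.subst (MvPowerSeries.X 0) -
        g.subst (MvPowerSeries.X 1))‖ ≤ 1) :
    (H.map PadicInt.toZMod).subst (V.map PadicInt.toZMod).formalGroupLaw =
      MvPowerSeries.subst ![(H.map PadicInt.toZMod).subst (MvPowerSeries.X 0 : MvPowerSeries (Fin 2) (ZMod p)),
        (H.map PadicInt.toZMod).subst (MvPowerSeries.X 1 : MvPowerSeries (Fin 2) (ZMod p))]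
        (V.map PadicInt.toZMod).formalGroupLaw := by
  set h := H.map (PadicInt.Coe.ringHom (p := p)) with hh
  have h0 : constantCoeff h = 0 := by
    rw [hh, ← coeff_zero_eq_constantCoeff_apply, coeff_map, coeff_zero_eq_constantCoeff_apply, hH0, map_zero]
  have hint : IsPadicInt h := isPadicInt_map H
  have key := isPadicInt_inv_mul_hom_defect V hp2 h0 hint hℓh hcob
  set D : MvPowerSeries (Fin 2) ℤ_[p] := H.subst V.formalGroupLaw -
    MvPowerSeries.subst ![H.subst (MvPowerSeries.X 0 : MvPowerSeries (Fin 2) ℤ_[p]),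
      H.subst (MvPowerSeries.X 1 : MvPowerSeries (Fin 2) ℤ_[p])] V.formalGroupLaw with hD
  have hDbar : D.map (PadicInt.toZMod (p := p)) = 0 :=
    FormalLogDivisibility.map_toZMod_eq_zero_of_isPadicInt_inv_mul D (by rw [hD, map_hom_defect V _ hH0]; exact key)
  rw [hD, map_hom_defect V _ hH0] at hDbar
  exact sub_eq_zero.mp hDbar

end Endomorphism

end Literature.NumberTheory.EllipticCurves.DescendedFrobenius.PadicRankTwoAssembly

end Part14

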